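import Literature.NumberTheory.Automorphic.PolarizedCompatibleSystemRationalModels
import Literature.NumberTheory.Automorphic.ReciprocityGLnRankOneProofs
import Literature.NumberTheory.Automorphic.ReciprocityGLnProofs
import Literature.NumberTheory.Automorphic.ClozelAlgebraicity
import Literature.NumberTheory.Automorphic.ChebotarevArtinRepHolds
import Literature.NumberTheory.GaloisRepresentations.HeckeCharacterValueFieldProofs
import Literature.NumberTheory.GaloisRepresentations.FrobeniusDensity
import Literature.NumberTheory.GaloisRepresentations.IntegralGaloisActionProofs
import Literature.NumberTheory.GaloisRepresentations.FramedGaloisRepSemisimplification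
import Literature.NumberTheory.Automorphic.AutomorphicRepsGLSatakeFlathProofs
import Literature.RepresentationTheory.Semisimple.SubrepresentationEquiv
import Literature.RepresentationTheory.Semisimple.RationalFormRankLeThree
import Literature.RepresentationTheory.Semisimple.FinTwoSemisimplification
import Literature.FieldTheory.AlgClosed.PadicAlgClEquivComplex
import Mathlib.LinearAlgebra.Lagrange
import Mathlib.RingTheory.Polynomial.Resultant.Basic
import Mathlib.LinearAlgebra.Matrix.Charpoly.Univ
import Mathlib.Topology.Algebra.MvPolynomial
import Mathlib.LinearAlgebra.Eigenspace.Minpoly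
import Mathlib.LinearAlgebra.Eigenspace.Charpoly
import Mathlib.LinearAlgebra.Charpoly.ToMatrix
import Mathlib.LinearAlgebra.FiniteDimensional.Lemmas
import Mathlib.LinearAlgebra.Basis.SMul
import Mathlib.RingTheory.MvPolynomial.Symmetric.Defs
import Mathlib.Algebra.Polynomial.BigOperators
import Mathlib.FieldTheory.IsAlgClosed.Basic
import Mathlib.Tactic.Module
import HarnessLib

/-!
# `BLGGT2014_polarized_compatibleSystem_rationalModels`: the degenerate ranks, proved, and the
# reduction of a discharge to rank `n ≥ 2`

Topic `Literature/NumberTheory/Automorphic`; sibling proof file of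
`PolarizedCompatibleSystemRationalModels.lean`, whose named fact
`BLGGT2014_polarized_compatibleSystem_rationalModels` (Barnet-Lamb–Gee–Geraghty–Taylor 2014,
Thm. 2.1.1 with §5.1 and Lemma 5.3.1 (3): the compatible system `{r_{l,ı}(π)}` of a norm-polarized
regular algebraic cuspidal `π` on `GL_n(𝔸_K)`, `K` CM, exists, and has `E_λ`-rational members for
ONE number field `E ⊂ ℂ`) quantifies over every rank `n : ℕ`.  Nothing here is a new named fact
(D-0026); the statement of the fact is untouched.

* `BLGGT2014_polarized_compatibleSystem_rationalModels_rank_zero` — the slice `n = 0`, proved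
  (the trivial homomorphism `Γ_K → GL_0`; `E = ℚ`).
* `BLGGT2014_polarized_compatibleSystem_rationalModels_rank_one` — the slice `n = 1`, proved for
  EVERY number field `K` and without the polarization hypothesis: a regular algebraic cuspidal `π`
  on `GL_1(𝔸_K)` is an algebraic Hecke character `χ_π` (`exists_heckeCharacter_glOne`,
  `isAlgebraic_heckeCharacter_glOne_of_isCAlgebraic`); Weil's theorem gives ONE number field
  `E ⊂ ℂ` with `χ_π(ϖ_v) ∈ E` at every unramified `v`
  (`HeckeCharacter.IsAlgebraic.exists_intermediateField_valueAtUniformizer_mem`) and, for every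
  `(ℓ, ι)`, the `ℓ`-adic character `r = χ_{π,ℓ,ι}` with `r(Frob_v) = ι⁻¹(χ_π(ϖ_v))⁻¹` at every
  unramified `v ∤ ℓ` (`HeckeCharacter.IsAlgebraic.exists_lAdic`), which is the attachment clause of
  the fact in rank one (`arithFrobPolyOfSatake_one`, exactly as in
  `HarrisLanTaylorThorne2016.theoremA_existence_rank_one`).  The `E_λ`-RATIONALITY clause — every
  value `r(g)`, `g ∈ Γ_K`, lies in the closure of `ι⁻¹(E)` in `ℚ̄_ℓ` — is the argument of [BLGGT],
  proof of Lemma 5.3.1 (3), in rank one: the values at the Frobenius elements outside the finite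
  set `{v ∣ ℓ} ∪ Ram(χ_π)` lie in `ι⁻¹(E)`, these Frobenius elements are dense in `Γ_K` (Chebotarev:
  `absoluteGaloisGroup.frobenius_dense` fed with the PROVED `chebotarev_artinRep_holds`), `r` is
  continuous and the closure is closed ("`tr r_λ ∈ M_λ` … by compactness").
* `BLGGT2014_polarized_compatibleSystem_rationalModels_of_two_le_rank` — the fact follows from its
  own restriction to `2 ≤ n`, the genuine content ([BLGGT, Thm. 2.1.1]: the étale cohomology of
  unitary Shimura varieties, Shin 2011 / Chenevier–Harris 2013; Lemma 5.3.1 (3): a regular element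
  from Sen theory); a `theorem` with the restricted statement as hypothesis, recording exactly what
  a discharge `BLGGT2014_polarized_compatibleSystem_rationalModels_holds` still requires.

Written while the fact was held as the blocker of
`HarrisLanTaylorThorne2016_corollary13_cuspidalUnitary` (HLTT Cor. 1.3, whose combination step
`HarrisLanTaylorThorne2016.corollary13_cuspidalUnitary_of_polarizedProp12_pos` takes this fact as
its Galois input).

## The mechanism of Lemma 5.3.1 (3) in rank `n ≥ 2`, proved, and the exact residue (2026-08-17)

The printed proof of the `E_λ`-rationality (final arXiv version of [BLGGT], proof of Prop. 5.2.2,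
first paragraph = published Lemma 5.3.1 (3)) reads: "By the argument of Proposition VII.1.8 and
Lemma I.2.2 of [HT] the regularity assumption tells us that `G_λ^0` contains an element whose
characteristic polynomial has `n` distinct roots. As the images of Frobenius elements … are
Zariski dense … infinitely many `Q_v(X)` … have `n` distinct roots. Replacing `M` by the
splitting field of the product `Q_v(X) Q_{v'}(X)` for two such `v, v'` with distinct residue
characteristic, we may suppose that for all `λ` the image `r_λ(G_{F^1})` contains an element with
`n` distinct `M_λ`-rational eigenvalues. This implies that, perhaps after replacing each `r_λ` by
a conjugate, we may suppose that `r_λ : G_F → GL_n(𝒪_{M,λ})` for all `λ`."  This file now PROVES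
everything in that paragraph after its first sentence, and the assembly of the fact from it:

* namespace `RegularDescent` (abstract algebra over any field `k` with a subfield `L`): the
  descent `RegularDescent.exists_basis_repr_apply_mem` / `….exists_conj_apply_mem` — a
  SEMISIMPLE `ρ : G → GL_n(k)` with all traces in `L` and an element `ρ(γ)` with `n` distinct
  `L`-rational eigenvalues is `GL_n(k)`-conjugate to an `L`-valued homomorphism (eigenprojectors
  are `L`-polynomials in `ρ(γ)`; "`b_i` occurs in some `ρ(g) b_j`" is an equivalence relation by
  semisimplicity, `rel_symm`; rescale the eigenbasis along its classes; the new coefficients are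
  quotients of traces of `L`-words, `trace_proj_mul_proj_mul`), with the eigenbasis produced from
  a split separable characteristic polynomial (`exists_eigenbasis_of_charpoly_eq_prod`);
* the rank-`n` inputs: Frobenius density for traces (`trace_apply_mem_of_frobenius`, Chebotarev
  in the proved form `chebotarev_artinRep_holds`), change of frame preserves semisimplicity
  (`isSemisimpleRepresentation_conj`), trace / determinant from a split characteristic polynomial,
  `Σ xᵢ⁻¹ · e_n = e_{n-1}`, and the integrality over `ℚ` of the geometric-Frobenius eigenvalues
  `q_v^{(n-1)/2} β_i` at a place whose integral Hecke eigenvalues lie in a number field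
  (`isIntegral_coeff_heckePolynomial`, `isIntegral_of_coeff_prod_X_sub_C`) — which is what makes
  "the splitting field of `Q_v Q_{v'}`" a NUMBER field here;
* `BLGGT2014_polarized_compatibleSystem_rationalModels_of_regularPlaces` — the fact from four
  inputs: the EXISTING named facts `exists_galoisRep_of_regularAlgebraic` (lang.S27: the attached
  semisimple `r_{ℓ,ι}(π)`, i.e. [BLGGT, Thm. 2.1.1] = [BLGHT, Thm. 1.2] in the tree),
  `Clozel1990_heckeEigenvalueField` (Clozel, Thm. 3.13: the `Q_{π,v}` have coefficients in one
  number field `M_π`) and `AutomorphicRepData.hasSatakeParamAt_cofinite` (Flath: `S_π` is finite),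
  and ONE raw hypothesis, the first sentence of the paragraph ("infinitely many `Q_v(X)` have `n`
  distinct roots": `∃ᶠ v in cofinite, ∃ β, HasSatakeParamAt v β ∧ β.Nodup`), whose printed proof
  is `p`-adic Hodge theory (Hodge–Tate regularity of `r_{ℓ,ı}(π)`, [BLGGT, Thm. 2.1.1 (3)], and
  Sen's theorem via [HT, VII.1.8]) and is not in the tree.  So a discharge
  `BLGGT2014_polarized_compatibleSystem_rationalModels_holds` needs exactly: lang.S27 (XL, named
  leaves in `BaseChangeStrongCuspidalPrime.lean`), Clozel's Thm. 3.13, Flath's theorem, and the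
  Sen-theory sentence.

## The polarized inputs (2026-08-17, second pass): Fakhruddin–Pilloni's attached representation,
## semisimplified; Flath discharged; the exact residue

Of the four inputs of `…_of_regularPlaces`, Flath's is a THEOREM of the tree
(`AutomorphicRepData.hasSatakeParamAt_cofinite_holds` of `AutomorphicRepsGLSatakeFlathProofs`) and is
discharged here, and the existence input is re-pointed from lang.S27 (Harris–Lan–Taylor–Thorne,
Thm. A: ALL regular algebraic `π`, whose printed proof USES the polarized case) to the polarized
case itself as the tree states it — Fakhruddin–Pilloni 2021, Thm. 9.10 with Thm. 9.1
(`FakhruddinPilloni2021_galoisRep_of_weaklyRegular_normTwist`, through its proved regular slice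
`FakhruddinPilloni2021_galoisRep_of_regularAlgebraic_normTwist`; for REGULAR `π` this is
[BLGGT, Thm. 2.1.1] = Shin / Chenevier–Harris), which carries no semisimplicity clause:
`exists_semisimple_attached_of_normTwist` SEMISIMPLIFIES it
(`FramedGaloisRep.exists_semisimplification`: same characteristic polynomials, hence the same
unramified places and Frobenius polynomials).  The assembly is restated once with the weakest
existence hypothesis (`…_of_attached_of_regularPlaces`: an attached semisimple `r` for the
polarized regular algebraic `π` of rank `≥ 2` only), from which `…_of_regularPlaces` (lang.S27) and
`…_of_normTwist_of_regularPlaces` (Fakhruddin–Pilloni) are one-liners.  RESIDUE of a discharge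
`BLGGT2014_polarized_compatibleSystem_rationalModels_holds`, exactly: the existing named facts
`FakhruddinPilloni2021_galoisRep_of_weaklyRegular_normTwist` (or `exists_galoisRep_of_regularAlgebraic`)
and `Clozel1990_heckeEigenvalueField`, and the raw hypothesis `hReg` ("infinitely many `Q_{π,v}`
have `n` distinct roots": [BLGGT], proof of Lemma 5.3.1 (3), from the Hodge–Tate regularity of
`r_{l,ı}(π)`, Thm. 2.1.1 (3), and Sen's theorem via [HT] VII.1.8 — a published statement the tree
does not hold as a named fact; a proving seat may not add it, D-0026).  Of that printed sentence
the part AFTER its first clause is proved here too: "`n` distinct roots" is an OPEN condition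
(the resultant `Res(χ, χ')`, one integer polynomial in the matrix entries,
`RegularDescent.continuous_resultant_charpoly`, `….resultant_charpoly_ne_zero_iff`), so ONE element
with separable characteristic polynomial in the image of ONE attached `r` gives, by Chebotarev
density and Flath, infinitely many regular places (`frequently_satakeParam_nodup_of_separable_charpoly`),
whence `…_of_normTwist_of_regularElement`: the residue is the existence of such an element
(Hodge–Tate regularity + Sen).

## The residue in operative form (2026-08-17, third pass)

The density step needs of `r` only that its Frobenius characteristic polynomials at all but
finitely many unramified places of `π` are the `arithFrobPolyOfSatake ι q_v n β` — no attachment at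
EVERY `v ∤ ℓ`, no unramifiedness of `r`, no semisimplicity
(`frequently_satakeParam_nodup_of_separable_charpoly_of_eventually`).  In particular it applies to
any `r` with Harris–Lan–Taylor–Thorne's characterising property
`HarrisLanTaylorThorne2016.IsCompatible π ι r` — compatibility above the good rational primes, the
vocabulary in which the tree states `p`-adic Hodge-theoretic properties of `r_{ℓ,ι}(π)`
(`AHTW2026.deRham_hodgeTateRegular`, `Varma2024.corollary93_unramified`) — whose exceptional places
lie over `ℓ` or over the finitely many rational primes below a ramified place of `π`
(`eventually_isGaloisCompatibleAt_of_isCompatible`).  The attached representations of this file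
are HLTT-compatible (`isCompatible_of_attached`, `exists_semisimple_isCompatible_of_normTwist`), so
the residue takes its final operative form
`BLGGT2014_polarized_compatibleSystem_rationalModels_of_normTwist_of_forall_isCompatible`: the two
existing named facts `FakhruddinPilloni2021_galoisRep_of_weaklyRegular_normTwist` and
`Clozel1990_heckeEigenvalueField`, and ONE statement `hSen` about every semisimple HLTT-compatible
`r` of a polarized regular algebraic `π` of rank `≥ 2` over a CM field — "some `r(g)` has separable
characteristic polynomial" — which in print is [BLGGT, Thm. 2.1.1 (3)] (Hodge–Tate regularity) with
Sen's theorem ([HT, VII.1.8]: the Lie algebra of the image contains, over `ℂ_ℓ`, the Sen operator,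
a regular semisimple element).  Variants with the regular element in an eventually-compatible or an
HLTT-compatible `r` at one `(ℓ, ι)` are `…_of_normTwist_of_eventuallyCompatible_regularElement` and
`…_of_normTwist_of_isCompatible_regularElement`.

## Rank `2` without Sen theory (2026-08-17, fourth pass)

In rank `2` the Sen-theoretic input can be bypassed, so that the rank-`2` slice of the fact follows
from the two existing named facts alone
(`BLGGT2014_polarized_compatibleSystem_rationalModels_rank_two_of_normTwist`), and the residue
`hSen` is only needed for `3 ≤ n`
(`BLGGT2014_polarized_compatibleSystem_rationalModels_of_normTwist_of_forall_isCompatible_three_le`).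
The dichotomy (`exists_rationalModel_rank_two_of_attached`): either `π` has infinitely many regular
places — then the per-`π` form of the assembly, `exists_rationalModel_of_attached_of_frequently_nodup`
— or, by the density step, NO value of an attached semisimple `r : Γ_K → GL₂(ℚ̄_ℓ)` has two distinct
eigenvalues, i.e. `(r(g) - c_g)² = 0` for every `g` (`RegularDescent.exists_sub_sq_eq_zero_of_not_separable`);
then every `r(g)` is the SCALAR `c_g` (`RegularDescent.forall_eq_smul_one_of_sub_sq_eq_zero`: a
stable line and its stable complement are both killed by the square-zero `r(g) - c_g`; if there
is no stable line, the "`k`-trick" `tr (N r(h)) = 0` for `N = r(g) - c_g ≠ 0` — from the vanishing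
discriminants of `r(gʲh)`, `j = 1, 2, 3` — makes `ker N` a stable line), and `c_g = tr r(g) / 2`
lies in `E_λ` for Clozel's field `E` (`trace_apply_mem_closure_of_attached`), so `r` itself is
`E_λ`-valued.  This deviates from the printed proof, which treats all ranks through Sen theory;
in higher rank no such shortcut is available in general (a semisimple linear group none of whose
elements has distinct eigenvalues need not be scalar: the sum of the three non-trivial characters
of the Klein four-group in rank `3`, the extraspecial group `2^{1+4}` in its irreducible
`4`-dimensional representation), and the regularity of the Hodge–Tate weights is then essential,
as in print.

## References

* T. Barnet-Lamb, T. Gee, D. Geraghty, R. Taylor, *Potential automorphy and change of weight*,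
  Ann. of Math. 179 (2014), Thm. 2.1.1, §5.1, Lemma 5.3.1 (3) and its proof (= arXiv:1010.2561,
  final version, proof of Prop. 5.2.2, first paragraph). [BarnetlambEtAl2014]
* L. Clozel, *Motifs et formes automorphes*, in: Automorphic forms, Shimura varieties, and
  L-functions I (1990), Thm. 3.13. [Clozel1990]
* A. Weil, *On a certain type of characters of the idèle-class group of an algebraic
  number-field* (1956), §1–§2. [Weil1956]
* J.-P. Serre, *Abelian `ℓ`-adic representations and elliptic curves* (1968), Ch. I §2.2,
  Cor. 2 (a) (Frobenius elements are dense). [SerreAbelianLadic1968]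
* M. Harris, K.-W. Lan, R. Taylor, J. Thorne, *On the rigid cohomology of certain Shimura
  varieties*, Res. Math. Sci. 3:37 (2016), Thm. A (the characterising property of `r_{ℓ,ι}(π)`).
  [HarrisLanTaylorThorneRMS2016]
-/

noncomputable section

open scoped NumberField Polynomial MatrixGroups
open NumberField IsDedekindDomain Field Filter Polynomial
open _root_.Topology

namespace Literature.NumberTheory.Automorphic

open Literature.NumberTheory.GaloisRepresentations Literature.RepresentationTheory.Semisimple
open Module

/-! ### Rank `0` -/

/-- **The slice `n = 0` of `BLGGT2014_polarized_compatibleSystem_rationalModels`** (degenerate; no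
hypothesis on `K` or `π` is needed): the trivial homomorphism `Γ_K → GL_0(ℚ̄_ℓ)` is semisimple
(its space `ℚ̄_ℓ⁰` has a single subrepresentation), every inertia group maps to `1`, a Satake
parameter in rank `0` is empty (`HasSatakeParamAt.card_eq`) so the predicted polynomial
`arithFrobPolyOfSatake ι q_v 0 0` is the empty product `1 = det (X - ·)` on `0 × 0` matrices, and a
`0 × 0` matrix has no entries; `E = ℚ` serves. [folklore] -/
theorem BLGGT2014_polarized_compatibleSystem_rationalModels_rank_zero
    (K : Type) [Field K] [NumberField K]
    (hcpt : isCompact_glFiniteIntegralLevel 0 K) (π : CuspidalAutomorphicRepData 0 K hcpt) :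
    ∃ E : Subfield ℂ, FiniteDimensional ℚ E ∧
      ∀ (ℓ : ℕ) [Fact ℓ.Prime] (ι : PadicAlgCl ℓ ≃+* ℂ),
        ∃ r : FramedGaloisRep K (PadicAlgCl ℓ) 0,
          (r.toGaloisRep.IsSemisimple ∧
            ∀ (v : HeightOneSpectrum (𝓞 K)) (β : Multiset ℂ), π.1.HasSatakeParamAt v β →
              ((ℓ : ℕ) : 𝓞 K) ∉ v.asIdeal →
                r.IsUnramifiedAt v ∧
                  r.HasFrobCharpolyAt v (arithFrobPolyOfSatake ι v.residueCard 0 β)) ∧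
          ∀ (g : Field.absoluteGaloisGroup K) (i j : Fin 0),
            ((r g : GL (Fin 0) (PadicAlgCl ℓ)) : Matrix (Fin 0) (Fin 0) (PadicAlgCl ℓ)) i j ∈
              closure (Set.range
                ((ι.symm : ℂ ≃+* PadicAlgCl ℓ).toRingHom.comp E.subtype)) := by
  refine ⟨(⊥ : IntermediateField ℚ ℂ).toSubfield, ?_, fun ℓ _ ι => ⟨1, ⟨?_, ?_⟩, fun g i j => ?_⟩⟩
  · change FiniteDimensional ℚ (⊥ : IntermediateField ℚ ℂ)
    infer_instance
  · haveI : Subsingleton (Subrepresentation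
        ((1 : FramedGaloisRep K (PadicAlgCl ℓ) 0).toGaloisRep.toRepresentation)) :=
      ⟨fun a b ↦ Subrepresentation.toSubmodule_injective (Subsingleton.elim _ _)⟩
    exact Subsingleton.instComplementedLattice
  · intro v β hβ _
    have hβ0 : β = 0 := Multiset.card_eq_zero.mp hβ.card_eq
    subst hβ0
    refine ⟨fun 𝔓 _ τ _ ↦ by simp, fun 𝔓 _ τ _ ↦ ?_⟩
    simp [FramedRep.charpoly, arithFrobPolyOfSatake, Matrix.charpoly, Matrix.det_isEmpty]
  · exact i.elim0

/-! ### Rank `1` (Weil 1956; the `E_λ`-valued clause by Frobenius density) -/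

/-- Only finitely many finite places of a number field lie above the prime `ℓ`. [folklore] -/
private theorem finite_setOf_natCast_mem_asIdeal (K : Type) [Field K] [NumberField K] (ℓ : ℕ)
    [Fact ℓ.Prime] : {v : HeightOneSpectrum (𝓞 K) | ((ℓ : ℕ) : 𝓞 K) ∈ v.asIdeal}.Finite := by
  have hI : Ideal.span {((ℓ : ℕ) : 𝓞 K)} ≠ ⊥ := by
    rw [Ne, Ideal.span_singleton_eq_bot]
    exact_mod_cast (Fact.out : ℓ.Prime).ne_zero
  refine (Ideal.finite_factors hI).subset fun v hv => ?_
  exact (Ideal.dvd_span_singleton).mpr hv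

/-- **The slice `n = 1` of `BLGGT2014_polarized_compatibleSystem_rationalModels`, for every number
field and without the polarization hypothesis** (Weil 1956; [BLGGT], proof of Lemma 5.3.1 (3) in
rank one).  For a cuspidal regular algebraic `π` on `GL_1(𝔸_K)` there is ONE number field `E ⊂ ℂ`
(Weil's field of values of the algebraic Hecke character `χ_π` of `π`,
`HeckeCharacter.IsAlgebraic.exists_intermediateField_valueAtUniformizer_mem`) such that for every
prime `ℓ` and every `ι : ℚ̄_ℓ ≃ ℂ` the `ℓ`-adic character `r = χ_{π,ℓ,ι} : Γ_K → GL_1(ℚ̄_ℓ)` of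
Weil (`HeckeCharacter.IsAlgebraic.exists_lAdic`) is (i) semisimple, (ii) attached to `(π, ι)`:
unramified with arithmetic-Frobenius polynomial `arithFrobPolyOfSatake ι q_v 1 β = X - ι⁻¹(χ_π(ϖ_v))⁻¹`
at every `v ∤ ℓ` where `π` has Satake parameter `β = {χ_π(ϖ_v)}` (as in
`HarrisLanTaylorThorne2016.theoremA_existence_rank_one`), and (iii) `E_λ`-VALUED: every `r(g)`,
`g ∈ Γ_K`, lies in the closure of `ι⁻¹(E)` in `ℚ̄_ℓ` — the set of `g` with `r(g)` in that (closed)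
closure is closed by continuity of `r`, and contains the arithmetic Frobenius elements at the
places outside the finite set `{v ∣ ℓ} ∪ Ram(χ_π)` (there `r(Frob_v) = ι⁻¹(χ_π(ϖ_v)⁻¹)` with
`χ_π(ϖ_v) ∈ E`), which are dense in `Γ_K` (`absoluteGaloisGroup.frobenius_dense`, Chebotarev in
the proved form `chebotarev_artinRep_holds`).
[cite: BarnetlambEtAl2014, Thm. 2.1.1 and proof of Lemma 5.3.1 (3) (rank one)]
[cite: Weil1956, §1–§2] [cite: SerreAbelianLadic1968, Ch. I §2.2, Cor. 2 (a)] -/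
theorem BLGGT2014_polarized_compatibleSystem_rationalModels_rank_one
    (K : Type) [Field K] [NumberField K]
    (hcpt : isCompact_glFiniteIntegralLevel 1 K) (π : CuspidalAutomorphicRepData 1 K hcpt)
    (hra : π.1.IsRegularAlgebraic) :
    ∃ E : Subfield ℂ, FiniteDimensional ℚ E ∧
      ∀ (ℓ : ℕ) [Fact ℓ.Prime] (ι : PadicAlgCl ℓ ≃+* ℂ),
        ∃ r : FramedGaloisRep K (PadicAlgCl ℓ) 1,
          (r.toGaloisRep.IsSemisimple ∧
            ∀ (v : HeightOneSpectrum (𝓞 K)) (β : Multiset ℂ), π.1.HasSatakeParamAt v β →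
              ((ℓ : ℕ) : 𝓞 K) ∉ v.asIdeal →
                r.IsUnramifiedAt v ∧
                  r.HasFrobCharpolyAt v (arithFrobPolyOfSatake ι v.residueCard 1 β)) ∧
          ∀ (g : Field.absoluteGaloisGroup K) (i j : Fin 1),
            ((r g : GL (Fin 1) (PadicAlgCl ℓ)) : Matrix (Fin 1) (Fin 1) (PadicAlgCl ℓ)) i j ∈
              closure (Set.range
                ((ι.symm : ℂ ≃+* PadicAlgCl ℓ).toRingHom.comp E.subtype)) := by
  classical
  obtain ⟨χ, hχ⟩ := π.1.exists_heckeCharacter_glOne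
  have halg : χ.IsAlgebraic :=
    π.1.isAlgebraic_heckeCharacter_glOne_of_isCAlgebraic hχ hra.isCAlgebraic
  obtain ⟨E, hfd, -, hval⟩ := halg.exists_intermediateField_valueAtUniformizer_mem
  refine ⟨E.toSubfield, hfd, fun ℓ _ ι => ?_⟩
  obtain ⟨r, hr⟩ := halg.exists_lAdic ι
  refine ⟨r, ⟨FramedRep.isSemisimple_of_rank_one r, fun v β hβ hvℓ => ?_⟩, fun g i j => ?_⟩
  · -- (ii) the attachment clause, verbatim the rank-one case of HLTT Thm. A
    have hur : χ.IsUnramifiedAt v := π.1.isUnramifiedAt_heckeCharacter_glOne hχ hβ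
    obtain ⟨hunr, hfrob⟩ := hr v hvℓ hur
    refine ⟨hunr, ?_⟩
    obtain ⟨ϖ, hϖ, rfl⟩ := π.1.exists_eq_singleton_of_hasSatakeParamAt_glOne hχ hβ
    have hc : ((χ (localUnits v ϖ) : ℂˣ) : ℂ) = χ.valueAtUniformizer v := by
      rw [← HeckeCharacter.localComponent_eq_valueAtUniformizer hur hϖ,
        HeckeCharacter.localComponent_apply]
    rw [arithFrobPolyOfSatake_one, Multiset.map_singleton, Multiset.prod_singleton, hc]
    exact hfrob
  · -- (iii) the `E_λ`-valued clause, by Frobenius density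
    obtain rfl : i = 0 := Subsingleton.elim _ _
    obtain rfl : j = 0 := Subsingleton.elim _ _
    set S : Set (HeightOneSpectrum (𝓞 K)) :=
      {v | ((ℓ : ℕ) : 𝓞 K) ∈ v.asIdeal} ∪ {v | ¬ χ.IsUnramifiedAt v} with hS_def
    have hS : S.Finite :=
      (finite_setOf_natCast_mem_asIdeal K ℓ).union (HeckeCharacter.finite_ramifiedPlaces_holds χ)
    have hD := absoluteGaloisGroup.frobenius_dense Automorphic.chebotarev_artinRep_holds K S hS
    set C : Set (PadicAlgCl ℓ) := closure (Set.range
      ((ι.symm : ℂ ≃+* PadicAlgCl ℓ).toRingHom.comp E.toSubfield.subtype)) with hC_def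
    set f : Field.absoluteGaloisGroup K → PadicAlgCl ℓ := fun g =>
      ((r g : GL (Fin 1) (PadicAlgCl ℓ)) : Matrix (Fin 1) (Fin 1) (PadicAlgCl ℓ)) 0 0 with hf_def
    have hf : Continuous f :=
      (Units.continuous_val.comp (map_continuous r)).matrix_elem 0 0
    have hcl : IsClosed (f ⁻¹' C) := isClosed_closure.preimage hf
    have hsub : {σ : Field.absoluteGaloisGroup K |
        ∃ v ∉ S, ∃ 𝔓 ∈ v.primesAbove, IsArithFrobAt (𝓞 K) σ 𝔓} ⊆ f ⁻¹' C := by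
      rintro σ ⟨v, hvS, 𝔓, h𝔓, hσ⟩
      have hvℓ : ((ℓ : ℕ) : 𝓞 K) ∉ v.asIdeal := fun h => hvS (Or.inl h)
      have hur : χ.IsUnramifiedAt v := by
        by_contra h
        exact hvS (Or.inr h)
      obtain ⟨-, hfrob⟩ := hr v hvℓ hur
      have hvalσ := (FramedGaloisRep.hasFrobCharpolyAt_iff_of_rank_one r v _).mp hfrob 𝔓 h𝔓 σ hσ
      show f σ ∈ C
      refine subset_closure ⟨⟨(χ.valueAtUniformizer v)⁻¹, inv_mem (hval v hur)⟩, ?_⟩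
      simp only [hf_def, hvalσ, RingHom.coe_comp, RingEquiv.toRingHom_eq_coe, RingHom.coe_coe,
        Function.comp_apply, Subfield.coe_subtype, map_inv₀]
    have huniv : f ⁻¹' C = Set.univ := by
      have h1 := (hD.mono hsub).closure_eq
      rwa [hcl.closure_eq] at h1
    have hg : g ∈ f ⁻¹' C := huniv ▸ Set.mem_univ g
    exact hg

/-! ### Reduction of a discharge to rank `n ≥ 2` -/

/-- **Reduction of a discharge to rank `n ≥ 2`.**  `BLGGT2014_polarized_compatibleSystem_rationalModels`
quantifies over every `n : ℕ`; its slices `n = 0` and `n = 1` are the proved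
`BLGGT2014_polarized_compatibleSystem_rationalModels_rank_zero` / `_rank_one`, so the fact follows
from its own restriction to `2 ≤ n` — the genuine content: [BLGGT, Thm. 2.1.1] (Galois
representations of polarized regular algebraic cuspidal representations, through the étale
cohomology of unitary Shimura varieties) and Lemma 5.3.1 (3) (descent of the members of a REGULAR
compatible system to `M_λ` after a finite extension of `M`, via an element with `n` distinct
rational eigenvalues supplied by Sen theory).  A `theorem` with the restricted statement as
hypothesis; no new named fact (D-0026). [cite: BarnetlambEtAl2014, Thm. 2.1.1, §5.1 and Lemma 5.3.1 (3)] -/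
theorem BLGGT2014_polarized_compatibleSystem_rationalModels_of_two_le_rank
    (h : ∀ (n : ℕ), 2 ≤ n → ∀ (K : Type) [Field K] [NumberField K] [IsCMField K]
      (hcpt : isCompact_glFiniteIntegralLevel n K) (π : CuspidalAutomorphicRepData n K hcpt),
        π.1.IsRegularAlgebraic →
        (∃ (χ : HeckeCharacter K) (m : ℤ),
            (∀ x : ideleGroup K, ((χ x : ℂˣ) : ℂ) = (ideleNorm x : ℂ) ^ (m : ℂ)) ∧
              π.1.IsEssConjSelfDual χ) →
          ∃ E : Subfield ℂ, FiniteDimensional ℚ E ∧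
            ∀ (ℓ : ℕ) [Fact ℓ.Prime] (ι : PadicAlgCl ℓ ≃+* ℂ),
              ∃ r : FramedGaloisRep K (PadicAlgCl ℓ) n,
                (r.toGaloisRep.IsSemisimple ∧
                  ∀ (v : HeightOneSpectrum (𝓞 K)) (β : Multiset ℂ), π.1.HasSatakeParamAt v β →
                    ((ℓ : ℕ) : 𝓞 K) ∉ v.asIdeal →
                      r.IsUnramifiedAt v ∧
                        r.HasFrobCharpolyAt v (arithFrobPolyOfSatake ι v.residueCard n β)) ∧
                ∀ (g : Field.absoluteGaloisGroup K) (i j : Fin n),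
                  ((r g : GL (Fin n) (PadicAlgCl ℓ)) : Matrix (Fin n) (Fin n) (PadicAlgCl ℓ)) i j ∈
                    closure (Set.range
                      ((ι.symm : ℂ ≃+* PadicAlgCl ℓ).toRingHom.comp E.subtype))) :
    BLGGT2014_polarized_compatibleSystem_rationalModels := by
  intro n K _ _ _ hcpt π hra hpol
  rcases n with _ | _ | n
  · exact BLGGT2014_polarized_compatibleSystem_rationalModels_rank_zero K hcpt π
  · exact BLGGT2014_polarized_compatibleSystem_rationalModels_rank_one K hcpt π hra
  · exact h (n + 2) (Nat.le_add_left 2 n) K hcpt π hra hpol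


/-! ## The mechanism of [BLGGT], Lemma 5.3.1 (3), proved: descent of a semisimple representation
## with traces in `L` along an element with `n` distinct `L`-rational eigenvalues

Abstract algebra (any field `k`, subfield `L`, group `G`); namespace `RegularDescent`.  This is the
sentence "this implies that, perhaps after replacing each `r_λ` by a conjugate, we may suppose that
`r_λ : G_F → GL_n(M_λ)`" of the printed proof (final arXiv version, proof of Prop. 5.2.2;
published version, Lemma 5.3.1 (3) with Lemma 5.3.2), for which [BLGGT] give no argument; the
proof below is the standard one (eigenprojectors of the regular element are `L`-polynomials in
it; "`b_i` occurs in some `ρ(g) b_j`" is an equivalence relation by semisimplicity; rescale the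
eigenbasis along its classes; the new matrix coefficients are quotients of traces of `L`-words).
-/

namespace RegularDescent

variable {k : Type*} [Field k] {G : Type*} [Group G] {V : Type*} [AddCommGroup V] [Module k V]

/-- **The eigenprojectors of a regular `L`-rational element are `L`-polynomials in it.**  If
`ρ γ` acts on the basis `b` diagonally with pairwise distinct eigenvalues `α i ∈ L`, then the
coordinate projector `v ↦ b*_i(v) • b_i` equals `Σ_t c_{i,t} ρ(γ^t)` with `c_{i,t} ∈ L` (the
coefficients of the Lagrange interpolation polynomial at the `α`'s). [folklore] -/
theorem exists_proj_eq_sum {n : ℕ} (L : Subfield k) (ρ : Representation k G V)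
    (b : Basis (Fin n) k V) (γ : G) (α : Fin n → k) (hα : Function.Injective α)
    (hαL : ∀ i, α i ∈ L) (hγ : ∀ i, ρ γ (b i) = α i • b i) :
    ∃ (N : ℕ) (c : Fin n → ℕ → k), (∀ i t, c i t ∈ L) ∧
      ∀ i, (∑ t ∈ Finset.range N, c i t • ρ (γ ^ t)) = (b.coord i).smulRight (b i) := by
  classical
  let αL : Fin n → L := fun i => ⟨α i, hαL i⟩
  have hinj : Set.InjOn αL (Finset.univ : Finset (Fin n)) :=
    fun i _ j _ h => hα (congrArg Subtype.val h)
  let q : Fin n → k[X] := fun i => (Lagrange.basis Finset.univ αL i).map (algebraMap L k)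
  have hq : ∀ i m, (q i).eval (α m) = if i = m then 1 else 0 := by
    intro i m
    have hm : α m = algebraMap L k (αL m) := rfl
    rw [hm, Polynomial.eval_map, Polynomial.eval₂_hom]
    split_ifs with h
    · subst h
      rw [Lagrange.eval_basis_self hinj (Finset.mem_univ _), map_one]
    · rw [Lagrange.eval_basis_of_ne h (Finset.mem_univ _), map_zero]
  refine ⟨n, fun i t => (q i).coeff t, fun i t => ?_, fun i => ?_⟩
  · simp only [q, Polynomial.coeff_map]
    exact Subtype.prop _
  · have hdeg : (q i).natDegree < n := by
      simp only [q]
      rw [Polynomial.natDegree_map, Lagrange.natDegree_basis hinj (Finset.mem_univ i),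
        Finset.card_univ, Fintype.card_fin]
      exact Nat.sub_lt (Fin.pos i) one_pos
    have e1 : aeval (ρ γ) (q i) = ∑ t ∈ Finset.range n, (q i).coeff t • ρ (γ ^ t) := by
      rw [Polynomial.aeval_eq_sum_range' hdeg]
      simp only [map_pow]
    rw [← e1]
    refine b.ext fun m => ?_
    have hev : Module.End.HasEigenvector (ρ γ) (α m) (b m) :=
      ⟨Module.End.mem_eigenspace_iff.mpr (hγ m), b.ne_zero m⟩
    rw [Module.End.aeval_apply_of_hasEigenvector hev, hq]
    simp only [LinearMap.smulRight_apply, Basis.coord_apply, Basis.repr_self,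
      Finsupp.single_apply]
    by_cases h : i = m
    · subst h; simp
    · simp [h, Ne.symm h]


/-- If all `tr ρ(g)` lie in `L`, so does the trace of every finite `L`-linear combination of the
`ρ(g)`. [folklore] -/
theorem trace_sum_smul_mem (L : Subfield k) (ρ : Representation k G V)
    (htr : ∀ g, LinearMap.trace k V (ρ g) ∈ L) {σ : Type*} (s : Finset σ) (c : σ → k)
    (w : σ → G) (hc : ∀ t ∈ s, c t ∈ L) :
    LinearMap.trace k V (∑ t ∈ s, c t • ρ (w t)) ∈ L := by
  rw [map_sum]
  refine Subfield.sum_mem _ fun t ht => ?_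
  rw [map_smul, smul_eq_mul]
  exact mul_mem (hc t ht) (htr _)

/-- Product of two finite linear combinations of the `ρ(g)`, as one linear combination indexed by
the product of the index sets. [folklore] -/
theorem sum_smul_mul_sum_smul (ρ : Representation k G V) {σ τ : Type*} (s : Finset σ)
    (s' : Finset τ) (c : σ → k) (w : σ → G) (d : τ → k) (x : τ → G) :
    (∑ t ∈ s, c t • ρ (w t)) * (∑ u ∈ s', d u • ρ (x u)) =
      ∑ p ∈ s ×ˢ s', (c p.1 * d p.2) • ρ (w p.1 * x p.2) := by
  rw [Finset.sum_mul_sum, Finset.sum_product]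
  refine Finset.sum_congr rfl fun t _ => Finset.sum_congr rfl fun u _ => ?_
  rw [smul_mul_assoc, mul_smul_comm, smul_smul, map_mul]

/-- **Matrix coefficients as traces**: with `p_i` the coordinate projector onto `b_i` along the
basis `b`, `tr (p_i ∘ X ∘ p_r ∘ Y) = X_{i r} · Y_{r i}` where `X_{i r} = b*_i(X b_r)`. [folklore] -/
theorem trace_proj_mul_proj_mul {n : ℕ} (b : Basis (Fin n) k V) (X Y : Module.End k V)
    (i r : Fin n) :
    LinearMap.trace k V ((b.coord i).smulRight (b i) * X * (b.coord r).smulRight (b r) * Y) =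
      b.repr (X (b r)) i * b.repr (Y (b i)) r := by
  classical
  haveI : Module.Finite k V := Module.Finite.of_basis b
  rw [LinearMap.trace_eq_matrix_trace k b, Matrix.trace]
  simp only [Matrix.diag_apply, LinearMap.toMatrix_apply, Module.End.mul_apply,
    LinearMap.smulRight_apply, Basis.coord_apply, map_smul, Basis.repr_self,
    Finsupp.smul_single, smul_eq_mul, mul_one, Finsupp.single_apply]
  rw [Finset.sum_eq_single i]
  · simp [mul_comm]
  · intro m _ hm
    simp [Ne.symm hm]
  · intro h
    exact absurd (Finset.mem_univ i) h

/-- **Transitivity** of the relation "`b_m` occurs in `ρ(g) b_i` for some `g ∈ G`" (i.e.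
`b*_m(ρ(g) b_i) ≠ 0`): compose through the eigenprojector `p_i`, an `L`-combination of the
`ρ(γ^t)`. [folklore] -/
theorem rel_trans {n : ℕ} (ρ : Representation k G V) (b : Basis (Fin n) k V) (γ : G) {N : ℕ}
    {c : Fin n → ℕ → k}
    (hp : ∀ i, (∑ t ∈ Finset.range N, c i t • ρ (γ ^ t)) = (b.coord i).smulRight (b i))
    {m i j : Fin n} (hmi : ∃ g, b.repr (ρ g (b i)) m ≠ 0) (hij : ∃ g, b.repr (ρ g (b j)) i ≠ 0) :
    ∃ g, b.repr (ρ g (b j)) m ≠ 0 := by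
  classical
  obtain ⟨h, hh⟩ := hmi
  obtain ⟨g, hg⟩ := hij
  have hX : ρ h * (b.coord i).smulRight (b i) * ρ g =
      ∑ t ∈ Finset.range N, c i t • ρ (h * γ ^ t * g) := by
    rw [← hp i, Finset.mul_sum, Finset.sum_mul]
    refine Finset.sum_congr rfl fun t _ => ?_
    rw [mul_smul_comm, smul_mul_assoc, ← map_mul, ← map_mul]
  have hne : b.repr ((ρ h * (b.coord i).smulRight (b i) * ρ g) (b j)) m ≠ 0 := by
    simp only [Module.End.mul_apply, LinearMap.smulRight_apply, Basis.coord_apply, map_smul,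
      Finsupp.smul_apply, smul_eq_mul]
    exact mul_ne_zero hg hh
  rw [hX] at hne
  simp only [LinearMap.coe_sum, Finset.sum_apply, LinearMap.smul_apply, map_sum, map_smul,
    Finsupp.coe_finsetSum, Finsupp.coe_smul, Pi.smul_apply, smul_eq_mul] at hne
  obtain ⟨t, -, ht⟩ := Finset.exists_ne_zero_of_sum_ne_zero hne
  exact ⟨h * γ ^ t * g, fun h0 => ht (by rw [h0, mul_zero])⟩

/-- The eigenprojectors `p_i` (polynomials in `ρ(γ)`) preserve every subrepresentation. [folklore] -/
theorem proj_apply_mem {n : ℕ} (ρ : Representation k G V) (b : Basis (Fin n) k V) (γ : G)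
    {N : ℕ} {c : Fin n → ℕ → k}
    (hp : ∀ i, (∑ t ∈ Finset.range N, c i t • ρ (γ ^ t)) = (b.coord i).smulRight (b i))
    (W : Subrepresentation ρ) (i : Fin n) {v : V} (hv : v ∈ W.toSubmodule) :
    (b.coord i).smulRight (b i) v ∈ W.toSubmodule := by
  rw [← hp i, LinearMap.coe_sum, Finset.sum_apply]
  exact Submodule.sum_mem _ fun t _ => Submodule.smul_mem _ _ (W.apply_mem_toSubmodule _ hv)

/-- **Symmetry** of the relation "`b_i` occurs in `ρ(g) b_j` for some `g`", for a SEMISIMPLE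
`ρ`: the span `W` of the `b_m` occurring in some `ρ(g) b_i` is a subrepresentation; if `b_j`
never occurred in any `ρ(g) b_i`, then `p_j` kills `W` and preserves a `G`-stable complement
`W'`, forcing `b_j ∈ W'`, hence `ρ(g) b_j ∈ W'` and (applying `p_i`) `b_i ∈ W' ∩ W = 0`.
[folklore] -/
theorem rel_symm {n : ℕ} (ρ : Representation k G V) [ρ.IsSemisimpleRepresentation]
    (b : Basis (Fin n) k V) (γ : G) {N : ℕ} {c : Fin n → ℕ → k}
    (hp : ∀ i, (∑ t ∈ Finset.range N, c i t • ρ (γ ^ t)) = (b.coord i).smulRight (b i))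
    {i j : Fin n} (hij : ∃ g, b.repr (ρ g (b j)) i ≠ 0) : ∃ g, b.repr (ρ g (b i)) j ≠ 0 := by
  classical
  by_contra H
  push Not at H
  let C : Set (Fin n) := {m | ∃ g, b.repr (ρ g (b i)) m ≠ 0}
  have hjC : j ∉ C := fun ⟨g, hg⟩ => hg (H g)
  have hiC : i ∈ C := ⟨1, by simp⟩
  have hstab : ∀ g, ∀ v ∈ Submodule.span k (b '' C), ρ g v ∈ Submodule.span k (b '' C) := by
    intro g v hv
    induction hv using Submodule.span_induction with
    | mem x hx =>
      obtain ⟨m, hm, rfl⟩ := hx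
      rw [Basis.mem_span_image]
      intro m' hm'
      exact rel_trans ρ b γ hp ⟨g, Finsupp.mem_support_iff.mp hm'⟩ hm
    | zero => simp
    | add x y _ _ hx hy =>
      rw [map_add]
      exact add_mem hx hy
    | smul a x _ hx =>
      rw [map_smul]
      exact Submodule.smul_mem _ a hx
  let W : Subrepresentation ρ := ⟨Submodule.span k (b '' C), hstab⟩
  obtain ⟨W', hW'⟩ := exists_isCompl W
  have hc : IsCompl W.toSubmodule W'.toSubmodule := Subrepresentation.isCompl_iff.mp hW'
  have hpW : ∀ w ∈ W.toSubmodule, (b.coord j).smulRight (b j) w = 0 := by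
    intro w hw
    have hsupp : ↑(b.repr w).support ⊆ C := b.mem_span_image.mp hw
    have h0 : b.repr w j = 0 := by
      by_contra hne
      exact hjC (hsupp (Finsupp.mem_support_iff.mpr hne))
    simp [h0]
  have hbj : b j ∈ W'.toSubmodule := by
    have htop : b j ∈ W.toSubmodule ⊔ W'.toSubmodule := by
      rw [hc.sup_eq_top]
      exact Submodule.mem_top
    obtain ⟨w, hw, w', hw', hsum⟩ := Submodule.mem_sup.mp htop
    have hfix : (b.coord j).smulRight (b j) (b j) = b j := by simp
    have h1 : (b.coord j).smulRight (b j) (w + w') = (b.coord j).smulRight (b j) w' := by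
      rw [map_add, hpW w hw, zero_add]
    rw [hsum, hfix] at h1
    rw [h1]
    exact proj_apply_mem ρ b γ hp W' j hw'
  obtain ⟨g, hg⟩ := hij
  have hbi' : b i ∈ W'.toSubmodule := by
    have h1 : (b.coord i).smulRight (b i) (ρ g (b j)) ∈ W'.toSubmodule :=
      proj_apply_mem ρ b γ hp W' i (W'.apply_mem_toSubmodule g hbj)
    simp only [LinearMap.smulRight_apply, Basis.coord_apply] at h1
    have h2 := W'.toSubmodule.smul_mem (b.repr (ρ g (b j)) i)⁻¹ h1
    rwa [inv_smul_smul₀ hg] at h2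
  have hbi : b i ∈ W.toSubmodule := Submodule.subset_span ⟨i, hiC, rfl⟩
  have hzero : b i = 0 := by
    have hmem : b i ∈ W.toSubmodule ⊓ W'.toSubmodule := ⟨hbi, hbi'⟩
    rw [hc.inf_eq_bot] at hmem
    exact (Submodule.mem_bot k).mp hmem
  exact b.ne_zero i hzero


/-! #### `L`-forms: finite `L`-linear combinations of the `ρ g` -/

/-- `ρ(g)` is a finite `L`-linear combination of the `ρ(h)` (an "`L`-form"). [folklore] -/
theorem lform_apply (L : Subfield k) (ρ : Representation k G V) (g : G) :
    ∃ (ι : Type) (_ : Fintype ι) (c : ι → k) (w : ι → G), (∀ t, c t ∈ L) ∧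
      ρ g = ∑ t, c t • ρ (w t) :=
  ⟨Unit, inferInstance, fun _ => 1, fun _ => g, fun _ => one_mem L, by simp⟩

/-- The eigenprojectors are `L`-forms. [folklore] -/
theorem lform_proj {n : ℕ} (L : Subfield k) (ρ : Representation k G V) (b : Basis (Fin n) k V)
    (γ : G) {N : ℕ} {c : Fin n → ℕ → k} (hcL : ∀ i t, c i t ∈ L)
    (hp : ∀ i, (∑ t ∈ Finset.range N, c i t • ρ (γ ^ t)) = (b.coord i).smulRight (b i))
    (i : Fin n) :
    ∃ (ι : Type) (_ : Fintype ι) (c : ι → k) (w : ι → G), (∀ t, c t ∈ L) ∧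
      (b.coord i).smulRight (b i) = ∑ t, c t • ρ (w t) :=
  ⟨Fin N, inferInstance, fun t => c i t, fun t => γ ^ (t : ℕ), fun t => hcL i t, by
    rw [← hp i, ← Fin.sum_univ_eq_sum_range]⟩

/-- `L`-forms are closed under composition. [folklore] -/
theorem lform_mul (L : Subfield k) (ρ : Representation k G V) {X Y : Module.End k V}
    (hX : ∃ (ι : Type) (_ : Fintype ι) (c : ι → k) (w : ι → G), (∀ t, c t ∈ L) ∧
      X = ∑ t, c t • ρ (w t))
    (hY : ∃ (ι : Type) (_ : Fintype ι) (c : ι → k) (w : ι → G), (∀ t, c t ∈ L) ∧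
      Y = ∑ t, c t • ρ (w t)) :
    ∃ (ι : Type) (_ : Fintype ι) (c : ι → k) (w : ι → G), (∀ t, c t ∈ L) ∧
      X * Y = ∑ t, c t • ρ (w t) := by
  obtain ⟨ι, _, c, w, hc, rfl⟩ := hX
  obtain ⟨ι', _, d, x, hd, rfl⟩ := hY
  refine ⟨ι × ι', inferInstance, fun p => c p.1 * d p.2, fun p => w p.1 * x p.2,
    fun p => mul_mem (hc p.1) (hd p.2), ?_⟩
  rw [sum_smul_mul_sum_smul, Finset.univ_product_univ]

/-- `L`-forms have trace in `L` when all `tr ρ(g) ∈ L`. [folklore] -/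
theorem lform_trace_mem (L : Subfield k) (ρ : Representation k G V)
    (htr : ∀ g, LinearMap.trace k V (ρ g) ∈ L) {X : Module.End k V}
    (hX : ∃ (ι : Type) (_ : Fintype ι) (c : ι → k) (w : ι → G), (∀ t, c t ∈ L) ∧
      X = ∑ t, c t • ρ (w t)) :
    LinearMap.trace k V X ∈ L := by
  obtain ⟨ι, _, c, w, hc, rfl⟩ := hX
  exact trace_sum_smul_mem L ρ htr Finset.univ c w fun t _ => hc t

/-! #### The descent in an eigenbasis of the regular element -/

/-- **Descent via a regular `L`-rational element** ([BLGGT], proof of Lemma 5.3.1 (3) /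
Lemma 5.3.2; in the final arXiv version: proof of Prop. 5.2.2, "this implies that, perhaps after
replacing each `r_λ` by a conjugate, we may suppose that `r_λ : G_F → GL_n(𝒪_{M,λ})`"), abstract
form.  Let `ρ` be a SEMISIMPLE representation of a group `G` on a finite-dimensional `k`-vector
space `V`, `L ⊆ k` a subfield containing all traces `tr ρ(g)`, and `γ ∈ G` an element acting
diagonally in a basis `b` with pairwise distinct eigenvalues `α i ∈ L`.  Then after rescaling
`b` all matrix coefficients of all `ρ(g)` lie in `L`.  (Proof: the eigenprojectors `p_i` are
`L`-polynomials in `ρ(γ)`; the relation "`b_i` occurs in some `ρ(g) b_j`" is an equivalence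
relation by semisimplicity; rescale along it, and compute the new coefficients as quotients of
traces `tr(p_i ρ(g) p_r ρ(h)) ∈ L`.) [cite: BarnetlambEtAl2014, proof of Lemma 5.3.1 (3)] -/
theorem exists_basis_repr_apply_mem {n : ℕ} (L : Subfield k) (ρ : Representation k G V)
    [ρ.IsSemisimpleRepresentation] (htr : ∀ g, LinearMap.trace k V (ρ g) ∈ L)
    (b : Basis (Fin n) k V) (γ : G) (α : Fin n → k) (hα : Function.Injective α)
    (hαL : ∀ i, α i ∈ L) (hγ : ∀ i, ρ γ (b i) = α i • b i) :
    ∃ b' : Basis (Fin n) k V, ∀ g i j, b'.repr (ρ g (b' j)) i ∈ L := by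
  classical
  haveI : Module.Finite k V := Module.Finite.of_basis b
  obtain ⟨N, c, hcL, hp⟩ := exists_proj_eq_sum L ρ b γ α hα hαL hγ
  -- the classes of the relation "`b m` occurs in some `ρ g (b i)`" and their representatives
  let S : Fin n → Finset (Fin n) := fun i =>
    Finset.univ.filter fun m => ∃ g, b.repr (ρ g (b i)) m ≠ 0
  have hSi : ∀ i, i ∈ S i := fun i => by
    simp only [S, Finset.mem_filter, Finset.mem_univ, true_and]
    exact ⟨1, by simp⟩
  have hSne : ∀ i, (S i).Nonempty := fun i => ⟨i, hSi i⟩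
  let r : Fin n → Fin n := fun i => (S i).min' (hSne i)
  have hr1 : ∀ i, ∃ g, b.repr (ρ g (b i)) (r i) ≠ 0 := fun i => by
    have h := Finset.min'_mem (S i) (hSne i)
    simp only [S, Finset.mem_filter, Finset.mem_univ, true_and] at h
    exact h
  have hr2 : ∀ i j, (∃ g, b.repr (ρ g (b j)) i ≠ 0) → r i = r j := by
    intro i j hij
    have hS : S i = S j := by
      ext m
      simp only [S, Finset.mem_filter, Finset.mem_univ, true_and]
      exact ⟨fun hmi => rel_trans ρ b γ hp hmi hij,
        fun hmj => rel_trans ρ b γ hp hmj (rel_symm ρ b γ hp hij)⟩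
    apply le_antisymm
    · exact Finset.min'_le _ _ (hS ▸ Finset.min'_mem (S j) (hSne j))
    · exact Finset.min'_le _ _ (hS.symm ▸ Finset.min'_mem (S i) (hSne i))
  have hg' : ∀ i, ∃ g, b.repr (ρ g (b (r i))) i ≠ 0 := fun i => rel_symm ρ b γ hp (hr1 i)
  choose gsel hgsel using hg'
  choose hsel hhsel using hr1
  -- the rescaled basis
  refine ⟨b.unitsSMul fun i => Units.mk0 _ (hgsel i), fun g i j => ?_⟩
  rw [Basis.repr_unitsSMul, Basis.unitsSMul_apply, Units.smul_def, Units.smul_def, map_smul,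
    map_smul, Finsupp.smul_apply, smul_eq_mul, smul_eq_mul, Units.val_inv_eq_inv_val,
    Units.val_mk0, Units.val_mk0]
  by_cases hrel : ∃ g', b.repr (ρ g' (b j)) i ≠ 0
  swap
  · push Not at hrel
    rw [hrel g, mul_zero, mul_zero]
    exact zero_mem L
  have hrij : r i = r j := hr2 i j hrel
  -- `X := ρ g ∘ p_j ∘ ρ (gsel j)` has `(i, r j)` coefficient `cc j * a g i j`
  set X : Module.End k V := ρ g * (b.coord j).smulRight (b j) * ρ (gsel j) with hX_def
  have hXval : b.repr (X (b (r i))) i =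
      b.repr (ρ (gsel j) (b (r j))) j * b.repr (ρ g (b j)) i := by
    rw [hrij]
    simp [hX_def, Module.End.mul_apply]
  have hd : b.repr (ρ (hsel i) (b i)) (r i) ≠ 0 := hhsel i
  -- numerator and denominator as traces
  have hnum : LinearMap.trace k V ((b.coord i).smulRight (b i) * X *
      (b.coord (r i)).smulRight (b (r i)) * ρ (hsel i)) =
        b.repr (X (b (r i))) i * b.repr (ρ (hsel i) (b i)) (r i) :=
    trace_proj_mul_proj_mul b X (ρ (hsel i)) i (r i)
  have hden : LinearMap.trace k V ((b.coord i).smulRight (b i) * ρ (gsel i) *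
      (b.coord (r i)).smulRight (b (r i)) * ρ (hsel i)) =
        b.repr (ρ (gsel i) (b (r i))) i * b.repr (ρ (hsel i) (b i)) (r i) :=
    trace_proj_mul_proj_mul b (ρ (gsel i)) (ρ (hsel i)) i (r i)
  have hnumL : b.repr (X (b (r i))) i * b.repr (ρ (hsel i) (b i)) (r i) ∈ L := by
    rw [← hnum]
    refine lform_trace_mem L ρ htr (lform_mul L ρ (lform_mul L ρ (lform_mul L ρ
      (lform_proj L ρ b γ hcL hp i) ?_) (lform_proj L ρ b γ hcL hp (r i))) (lform_apply L ρ _))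
    exact lform_mul L ρ (lform_mul L ρ (lform_apply L ρ g) (lform_proj L ρ b γ hcL hp j))
      (lform_apply L ρ _)
  have hdenL : b.repr (ρ (gsel i) (b (r i))) i * b.repr (ρ (hsel i) (b i)) (r i) ∈ L := by
    rw [← hden]
    exact lform_trace_mem L ρ htr (lform_mul L ρ (lform_mul L ρ (lform_mul L ρ
      (lform_proj L ρ b γ hcL hp i) (lform_apply L ρ _)) (lform_proj L ρ b γ hcL hp (r i)))
      (lform_apply L ρ _))
  have hden0 : b.repr (ρ (gsel i) (b (r i))) i * b.repr (ρ (hsel i) (b i)) (r i) ≠ 0 :=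
    mul_ne_zero (hgsel i) hd
  have key : (b.repr (ρ (gsel i) (b (r i))) i)⁻¹ *
      (b.repr (ρ (gsel j) (b (r j))) j * b.repr (ρ g (b j)) i) =
      (b.repr (X (b (r i))) i * b.repr (ρ (hsel i) (b i)) (r i)) /
        (b.repr (ρ (gsel i) (b (r i))) i * b.repr (ρ (hsel i) (b i)) (r i)) := by
    rw [← hXval]
    field_simp
  rw [key]
  exact div_mem hnumL hdenL


/-! #### From a split regular characteristic polynomial to an eigenbasis; matrix form -/

/-- An endomorphism of an `n`-dimensional space whose characteristic polynomial is
`∏ᵢ (X - αᵢ)` with the `αᵢ` pairwise distinct has an eigenbasis `b` with `f (b i) = αᵢ • b i`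
(roots of the characteristic polynomial are eigenvalues; eigenvectors for distinct eigenvalues
are linearly independent). [folklore] -/
theorem exists_eigenbasis_of_charpoly_eq_prod {n : ℕ} [FiniteDimensional k V]
    (f : Module.End k V) (α : Fin n → k) (hα : Function.Injective α)
    (hn : Module.finrank k V = n) (hf : f.charpoly = ∏ i, (X - C (α i))) :
    ∃ b : Basis (Fin n) k V, ∀ i, f (b i) = α i • b i := by
  have hev : ∀ i, f.HasEigenvalue (α i) := fun i => by
    rw [Module.End.hasEigenvalue_iff_isRoot_charpoly, hf, Polynomial.IsRoot, Polynomial.eval_prod]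
    exact Finset.prod_eq_zero (Finset.mem_univ i) (by simp)
  choose v hv using fun i => (hev i).exists_hasEigenvector
  have hli : LinearIndependent k v := Module.End.eigenvectors_linearIndependent' f α hα v hv
  refine ⟨basisOfLinearIndependentOfCardEqFinrank' v hli (by rw [hn, Fintype.card_fin]),
    fun i => ?_⟩
  rw [coe_basisOfLinearIndependentOfCardEqFinrank']
  exact Module.End.mem_eigenspace_iff.mp (hv i).1

/-- **Descent via a regular `L`-rational element, matrix form** ([BLGGT], proof of
Lemma 5.3.1 (3)): a homomorphism `φ : G → GL_n(k)` whose associated representation on `kⁿ` is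
semisimple, with all traces in the subfield `L`, and such that some `φ(γ)` has characteristic
polynomial `∏ᵢ (X - αᵢ)` with pairwise distinct `αᵢ ∈ L`, is `GL_n(k)`-conjugate to an
`L`-valued homomorphism. [cite: BarnetlambEtAl2014, proof of Lemma 5.3.1 (3)] -/
theorem exists_conj_apply_mem {n : ℕ} (L : Subfield k) (φ : G →* GL (Fin n) k)
    (ρ : Representation k G (Fin n → k))
    (hρ : ∀ g v, ρ g v = ((φ g : GL (Fin n) k) : Matrix (Fin n) (Fin n) k).mulVec v)
    [ρ.IsSemisimpleRepresentation]
    (htr : ∀ g, ((φ g : GL (Fin n) k) : Matrix (Fin n) (Fin n) k).trace ∈ L)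
    (γ : G) (α : Fin n → k) (hα : Function.Injective α) (hαL : ∀ i, α i ∈ L)
    (hγ : ((φ γ : GL (Fin n) k) : Matrix (Fin n) (Fin n) k).charpoly = ∏ i, (X - C (α i))) :
    ∃ P : GL (Fin n) k, ∀ g i j,
      ((P * φ g * P⁻¹ : GL (Fin n) k) : Matrix (Fin n) (Fin n) k) i j ∈ L := by
  classical
  have hρ' : ∀ g, ρ g = Matrix.toLin' ((φ g : GL (Fin n) k) : Matrix (Fin n) (Fin n) k) :=
    fun g => LinearMap.ext fun v => by rw [hρ, Matrix.toLin'_apply]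
  have htr' : ∀ g, LinearMap.trace k _ (ρ g) ∈ L := fun g => by
    rw [hρ', Matrix.trace_toLin'_eq]
    exact htr g
  obtain ⟨b, hb⟩ := exists_eigenbasis_of_charpoly_eq_prod (ρ γ) α hα (Module.finrank_fin_fun k)
    (by rw [hρ', Matrix.charpoly_toLin', hγ])
  obtain ⟨b', hb'⟩ := exists_basis_repr_apply_mem L ρ htr' b γ α hα hαL hb
  let e := Pi.basisFun k (Fin n)
  refine ⟨⟨b'.toMatrix e, e.toMatrix b', b'.toMatrix_mul_toMatrix_flip e,
    e.toMatrix_mul_toMatrix_flip b'⟩, fun g i j => ?_⟩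
  have hmat : ((φ g : GL (Fin n) k) : Matrix (Fin n) (Fin n) k) = LinearMap.toMatrix e e (ρ g) := by
    rw [hρ', LinearMap.toMatrix_eq_toMatrix', LinearMap.toMatrix'_toLin']
  rw [Units.val_mul, Units.val_mul, Units.inv_mk, hmat,
    basis_toMatrix_mul_linearMap_toMatrix_mul_basis_toMatrix, LinearMap.toMatrix_apply]
  exact hb' g i j

end RegularDescent

/-! ## Inputs for the assembly in rank `n ≥ 2`: enumerated multisets, Frobenius traces and
## determinants, Frobenius density for traces, change of frame, integrality of the Frobenius
## eigenvalues at a place with Hecke eigenvalues in a number field -/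

namespace RegularDescent

/-! #### Elementary symmetric functions of an enumerated multiset -/

/-- `e_n` of `n` numbers is their product. [folklore] -/
theorem esymm_univ_card {R : Type*} [CommSemiring R] {n : ℕ} (x : Fin n → R) :
    ((Finset.univ : Finset (Fin n)).val.map x).esymm n = ∏ i, x i := by
  rw [Finset.esymm_map_val]
  have h : (Finset.univ : Finset (Fin n)).powersetCard n = {Finset.univ} := by
    rw [← Finset.powersetCard_self, Finset.card_univ, Fintype.card_fin]
  rw [h, Finset.sum_singleton]

/-- `e_{n-1}` of `n` numbers is the sum of the products leaving one out. [folklore] -/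
theorem esymm_univ_card_sub_one {R : Type*} [CommSemiring R] {n : ℕ} (hn : 0 < n)
    (x : Fin n → R) :
    ((Finset.univ : Finset (Fin n)).val.map x).esymm (n - 1) =
      ∑ i, ∏ j ∈ Finset.univ.erase i, x j := by
  classical
  rw [Finset.esymm_map_val]
  symm
  refine Finset.sum_nbij (fun i => Finset.univ.erase i) (fun i _ => ?_) (fun i _ j _ h => ?_)
    (fun t ht => ?_) (fun i _ => rfl)
  · rw [Finset.mem_powersetCard]
    exact ⟨Finset.erase_subset _ _, by rw [Finset.card_erase_of_mem (Finset.mem_univ i),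
      Finset.card_univ, Fintype.card_fin]⟩
  · by_contra hij
    have h' : Finset.univ.erase i = Finset.univ.erase j := h
    have : j ∈ Finset.univ.erase i := Finset.mem_erase.mpr ⟨Ne.symm hij, Finset.mem_univ j⟩
    rw [h'] at this
    exact (Finset.notMem_erase j _) this
  · rw [Finset.mem_coe, Finset.mem_powersetCard] at ht
    have hc : (Finset.univ \ t).card = 1 := by
      rw [Finset.card_sdiff_of_subset ht.1, Finset.card_univ, Fintype.card_fin, ht.2]
      omega
    obtain ⟨i, hi⟩ := Finset.card_eq_one.mp hc
    refine ⟨i, Finset.mem_coe.mpr (Finset.mem_univ i), ?_⟩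
    ext j
    rw [Finset.mem_erase]
    constructor
    · rintro ⟨hji, -⟩
      by_contra hjt
      have : j ∈ Finset.univ \ t := Finset.mem_sdiff.mpr ⟨Finset.mem_univ j, hjt⟩
      rw [hi, Finset.mem_singleton] at this
      exact hji this
    · intro hjt
      refine ⟨fun hji => ?_, Finset.mem_univ j⟩
      have : i ∈ Finset.univ \ t := by rw [hi]; exact Finset.mem_singleton_self i
      exact (Finset.mem_sdiff.mp this).2 (hji ▸ hjt)

/-- `(Σ xᵢ⁻¹) · e_n(x) = e_{n-1}(x)` for non-zero `xᵢ` in a field. [folklore] -/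
theorem sum_inv_mul_prod {F : Type*} [Field F] {n : ℕ} (x : Fin n → F) (hx : ∀ i, x i ≠ 0) :
    (∑ i, (x i)⁻¹) * ∏ i, x i = ∑ i, ∏ j ∈ Finset.univ.erase i, x j := by
  rw [Finset.sum_mul]
  refine Finset.sum_congr rfl fun i _ => ?_
  rw [← Finset.mul_prod_erase Finset.univ x (Finset.mem_univ i), ← mul_assoc,
    inv_mul_cancel₀ (hx i), one_mul]


/-- Enumerate a multiset of cardinality `n` by `Fin n`. [folklore] -/
theorem exists_fin_enum {α : Type*} (s : Multiset α) {n : ℕ} (h : Multiset.card s = n) :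
    ∃ x : Fin n → α, (Finset.univ : Finset (Fin n)).val.map x = s := by
  classical
  obtain ⟨e⟩ : Nonempty (Fin n ≃ s) :=
    ⟨(Fintype.equivFinOfCardEq (by rw [Multiset.card_coe, h])).symm⟩
  refine ⟨fun i => ((e i : s) : α), ?_⟩
  have h1 : (Finset.univ : Finset (Fin n)).val.map (fun i => ((e i : s) : α)) =
      ((Finset.univ.map e.toEmbedding).val).map (fun x : s => (x : α)) := by
    rw [Finset.map_val, Multiset.map_map]
    rfl
  rw [h1, Finset.map_univ_equiv, Multiset.map_univ_coe]

/-- A product `∏ᵢ (X - C (y i))` over `Fin n` as the multiset product over the enumerated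
multiset. [folklore] -/
theorem prod_X_sub_C_eq_multiset {R : Type*} [CommRing R] {α : Type*} {n : ℕ} (x : Fin n → α)
    (f : α → R) :
    (((Finset.univ : Finset (Fin n)).val.map x).map fun a => X - C (f a)).prod =
      ∏ i, (X - C (f (x i))) := by
  rw [Multiset.map_map]
  rfl

/-- Trace and determinant of a matrix with characteristic polynomial `∏ᵢ (X - μᵢ)`:
`tr = Σ μᵢ` and `det = ∏ μᵢ`. [folklore] -/
theorem trace_eq_sum_of_charpoly_eq {R : Type*} [CommRing R] {n : ℕ} (hn : 0 < n)
    (M : Matrix (Fin n) (Fin n) R) (μ : Fin n → R) (hM : M.charpoly = ∏ i, (X - C (μ i))) :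
    M.trace = ∑ i, μ i := by
  haveI : Nonempty (Fin n) := ⟨⟨0, hn⟩⟩
  rw [Matrix.trace_eq_neg_charpoly_coeff, hM, Fintype.card_fin]
  have h := Polynomial.prod_X_sub_C_coeff_card_pred (Finset.univ : Finset (Fin n)) μ
    (by rw [Finset.card_univ, Fintype.card_fin]; exact hn)
  rw [Finset.card_univ, Fintype.card_fin] at h
  rw [h, neg_neg]

/-- `det M = ∏ μᵢ` when `M` has characteristic polynomial `∏ᵢ (X - μᵢ)`. [folklore] -/
theorem det_eq_prod_of_charpoly_eq {R : Type*} [CommRing R] {n : ℕ}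
    (M : Matrix (Fin n) (Fin n) R) (μ : Fin n → R) (hM : M.charpoly = ∏ i, (X - C (μ i))) :
    M.det = ∏ i, μ i := by
  rw [Matrix.det_eq_sign_charpoly_coeff, hM, Fintype.card_fin, Polynomial.coeff_zero_eq_eval_zero,
    Polynomial.eval_prod]
  simp only [eval_sub, eval_X, eval_C, zero_sub]
  rw [Finset.prod_neg, Finset.card_univ, Fintype.card_fin, ← mul_assoc, ← pow_add,
    ← two_mul, pow_mul, neg_one_sq, one_pow, one_mul]

/-! #### Frobenius density in rank `n` (traces) -/

/-- **Traces of a continuous `r : Γ_K → GL_n(ℚ̄_ℓ)` lie in a closed set as soon as the traces of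
the Frobenius elements outside a finite set of places do** (Chebotarev density in the proved form
`chebotarev_artinRep_holds` / `absoluteGaloisGroup.frobenius_dense`, continuity of the trace).
[cite: SerreAbelianLadic1968, Ch. I §2.2, Cor. 2 (a)] -/
theorem trace_apply_mem_of_frobenius {K : Type} [Field K] [NumberField K] {ℓ : ℕ} [Fact ℓ.Prime]
    {n : ℕ} (r : FramedGaloisRep K (PadicAlgCl ℓ) n) (S : Set (HeightOneSpectrum (𝓞 K)))
    (hS : S.Finite) {C : Set (PadicAlgCl ℓ)} (hC : IsClosed C)
    (h : ∀ v ∉ S, ∀ 𝔓 ∈ v.primesAbove, ∀ σ : absoluteGaloisGroup K, IsArithFrobAt (𝓞 K) σ 𝔓 →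
      ((r σ : GL (Fin n) (PadicAlgCl ℓ)) : Matrix (Fin n) (Fin n) (PadicAlgCl ℓ)).trace ∈ C)
    (g : absoluteGaloisGroup K) :
    ((r g : GL (Fin n) (PadicAlgCl ℓ)) : Matrix (Fin n) (Fin n) (PadicAlgCl ℓ)).trace ∈ C := by
  have hD := absoluteGaloisGroup.frobenius_dense Automorphic.chebotarev_artinRep_holds K S hS
  set f : absoluteGaloisGroup K → PadicAlgCl ℓ := fun g =>
    ((r g : GL (Fin n) (PadicAlgCl ℓ)) : Matrix (Fin n) (Fin n) (PadicAlgCl ℓ)).trace with hf_def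
  have hf : Continuous f := (Units.continuous_val.comp (map_continuous r)).matrix_trace
  have hcl : IsClosed (f ⁻¹' C) := hC.preimage hf
  have hsub : {σ : absoluteGaloisGroup K |
      ∃ v ∉ S, ∃ 𝔓 ∈ v.primesAbove, IsArithFrobAt (𝓞 K) σ 𝔓} ⊆ f ⁻¹' C := by
    rintro σ ⟨v, hvS, 𝔓, h𝔓, hσ⟩
    exact h v hvS 𝔓 h𝔓 σ hσ
  have huniv : f ⁻¹' C = Set.univ := by
    have h1 := (hD.mono hsub).closure_eq
    rwa [hcl.closure_eq] at h1
  have hg : g ∈ f ⁻¹' C := huniv ▸ Set.mem_univ g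
  exact hg

/-! #### Change of frame preserves semisimplicity -/

/-- Conjugating a framed representation by `P ∈ GL_n` gives an equivalent, hence again
semisimple, representation on `Aⁿ`. [folklore] -/
theorem isSemisimpleRepresentation_conj {G : Type*} [Group G] [TopologicalSpace G] {A : Type*}
    [Field A] [TopologicalSpace A] [IsTopologicalRing A] {n : ℕ} (ρ : FramedRep G A n)
    (P : GL (Fin n) A) [h : ρ.toRepresentation.IsSemisimpleRepresentation] :
    (FramedRep.conj P ρ).toRepresentation.IsSemisimpleRepresentation := by
  have hP1 : ((P : GL (Fin n) A) : Matrix (Fin n) (Fin n) A) * ((P⁻¹ : GL (Fin n) A) : Matrix _ _ A)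
      = 1 := by rw [← Units.val_mul, mul_inv_cancel, Units.val_one]
  have hP2 : ((P⁻¹ : GL (Fin n) A) : Matrix (Fin n) (Fin n) A) * ((P : GL (Fin n) A) : Matrix _ _ A)
      = 1 := by rw [← Units.val_mul, inv_mul_cancel, Units.val_one]
  let e : (Fin n → A) ≃ₗ[A] (Fin n → A) :=
    LinearEquiv.ofLinear (Matrix.toLin' ((P : GL (Fin n) A) : Matrix (Fin n) (Fin n) A))
      (Matrix.toLin' ((P⁻¹ : GL (Fin n) A) : Matrix (Fin n) (Fin n) A))
      (by rw [← Matrix.toLin'_mul, hP1, Matrix.toLin'_one])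
      (by rw [← Matrix.toLin'_mul, hP2, Matrix.toLin'_one])
  have hρ : ∀ g, ρ.toRepresentation g =
      Matrix.toLin' ((ρ g : GL (Fin n) A) : Matrix (Fin n) (Fin n) A) :=
    fun g => LinearMap.ext fun v => by
      rw [FramedRep.toRepresentation_apply_apply, Matrix.toLin'_apply]
  have hρ' : ∀ g, (FramedRep.conj P ρ).toRepresentation g =
      Matrix.toLin' ((P * ρ g * P⁻¹ : GL (Fin n) A) : Matrix (Fin n) (Fin n) A) :=
    fun g => LinearMap.ext fun v => by
      rw [FramedRep.toRepresentation_apply_apply, Matrix.toLin'_apply, FramedRep.conj_apply]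
  refine Representation.isSemisimpleRepresentation_of_equiv (ρ := ρ.toRepresentation)
    (Representation.Equiv.mk e fun g => ?_)
  change Matrix.toLin' ((P : GL (Fin n) A) : Matrix (Fin n) (Fin n) A) ∘ₗ ρ.toRepresentation g =
    (FramedRep.conj P ρ).toRepresentation g ∘ₗ
      Matrix.toLin' ((P : GL (Fin n) A) : Matrix (Fin n) (Fin n) A)
  rw [hρ, hρ', ← Matrix.toLin'_mul, ← Matrix.toLin'_mul, Units.val_mul, Units.val_mul,
    mul_assoc, hP2, mul_one]


/-! #### Integrality of the Frobenius eigenvalues at a place with Hecke eigenvalues in a number field -/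

/-- A root of a monic `∏ᵢ (X - yᵢ) ∈ ℂ[X]` all of whose coefficients are integral over `ℚ` is
integral over `ℚ` (lift the polynomial to the integral closure of `ℚ` in `ℂ` and use
transitivity of integrality). [folklore] -/
theorem isIntegral_of_coeff_prod_X_sub_C {n : ℕ} (y : Fin n → ℂ)
    (h : ∀ k, IsIntegral ℚ ((∏ i, (X - C (y i))).coeff k)) (i : Fin n) : IsIntegral ℚ (y i) := by
  set p : ℂ[X] := ∏ i, (X - C (y i)) with hp
  have hlifts : p ∈ Polynomial.lifts (algebraMap (integralClosure ℚ ℂ) ℂ) := by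
    rw [Polynomial.lifts_iff_coeff_lifts]
    intro k
    exact ⟨⟨p.coeff k, h k⟩, rfl⟩
  have hmonic : p.Monic :=
    Polynomial.monic_prod_of_monic _ _ fun i _ => Polynomial.monic_X_sub_C (y i)
  obtain ⟨q, hq, -, hqm⟩ := Polynomial.lifts_and_natDegree_eq_and_monic hlifts hmonic
  have hint : IsIntegral (integralClosure ℚ ℂ) (y i) := by
    refine ⟨q, hqm, ?_⟩
    rw [← Polynomial.eval_map, hq, hp, Polynomial.eval_prod]
    exact Finset.prod_eq_zero (Finset.mem_univ i) (by simp)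
  exact isIntegral_trans (y i) hint

/-- `√q ∈ ℂ` is integral over `ℚ`. [folklore] -/
theorem isIntegral_sqrt_natCast (q : ℕ) : IsIntegral ℚ (((Real.sqrt (q : ℝ) : ℝ) : ℂ)) := by
  refine IsIntegral.of_pow two_pos ?_
  have h2 : (((Real.sqrt (q : ℝ) : ℝ) : ℂ)) ^ 2 = algebraMap ℚ ℂ (q : ℚ) := by
    rw [← Complex.ofReal_pow, Real.sq_sqrt (Nat.cast_nonneg _), Complex.ofReal_natCast,
      map_natCast]
  rw [h2]
  exact isIntegral_algebraMap

/-- Elements of a number field `E₀ ⊂ ℂ` are integral over `ℚ`. [folklore] -/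
theorem isIntegral_of_mem_intermediateField (E₀ : IntermediateField ℚ ℂ) [FiniteDimensional ℚ E₀]
    {z : ℂ} (hz : z ∈ E₀) : IsIntegral ℚ z :=
  (IntermediateField.isIntegral_iff (x := (⟨z, hz⟩ : E₀))).mp (Algebra.IsIntegral.isIntegral _)

/-- For `j ≤ n`: `(n - 1) j = j (n - j) + ((n-1) j - j (n - j))` in `ℕ` (i.e.
`j (n - j) ≤ (n - 1) j`). [folklore] -/
theorem mul_sub_exponent {n j : ℕ} (hj : j ≤ n) :
    (n - 1) * j = ((n - 1) * j - j * (n - j)) + j * (n - j) := by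
  have h : j * (n - j) ≤ (n - 1) * j := by
    rcases Nat.eq_zero_or_pos j with rfl | hj0
    · simp
    · calc j * (n - j) ≤ j * (n - 1) := Nat.mul_le_mul_left j (by omega)
        _ = (n - 1) * j := mul_comm _ _
  omega

/-- **The eigenvalues `q_v^{(n-1)/2} β_i` of geometric Frobenius are algebraic integers' worth
of algebraic: integral over `ℚ`**, at a place `v` where the integral Hecke eigenvalues
`t_{v,j} = q_v^{j(n-j)/2} e_j(β)` lie in a number field `E₀` (Clozel): the `k`-th coefficient of
`∏ᵢ (X - q_v^{(n-1)/2} βᵢ)` is `± (√q_v)^{(n-1)j - j(n-j)} t_{v,j}`, `j = n - k`. [folklore] -/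
theorem isIntegral_coeff_heckePolynomial {K : Type} [Field K] [NumberField K] {n : ℕ}
    (v : HeightOneSpectrum (𝓞 K)) (x : Fin n → ℂ) (E₀ : IntermediateField ℚ ℂ)
    [FiniteDimensional ℚ E₀]
    (hT : ∀ j ≤ n, heckeEigenvalueOf n v ((Finset.univ : Finset (Fin n)).val.map x) j ∈ E₀)
    (k : ℕ) :
    IsIntegral ℚ ((∏ i, (X - C ((((Real.sqrt (v.residueCard : ℝ)) : ℝ) : ℂ) ^ (n - 1) * x i))).coeff k) := by
  set s : ℂ := (((Real.sqrt (v.residueCard : ℝ)) : ℝ) : ℂ) with hs_def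
  have hmon : ∀ i ∈ (Finset.univ : Finset (Fin n)), (X - C (s ^ (n - 1) * x i)).Monic :=
    fun i _ => monic_X_sub_C _
  by_cases hk : k ≤ n
  swap
  · rw [Polynomial.coeff_eq_zero_of_natDegree_lt]
    · exact isIntegral_zero
    rw [Polynomial.natDegree_prod_of_monic _ _ hmon]
    simp only [natDegree_X_sub_C, Finset.sum_const, Finset.card_univ, Fintype.card_fin,
      smul_eq_mul, mul_one]
    omega
  have e1 : ∏ i, (X - C (s ^ (n - 1) * x i)) =
      ((((Finset.univ : Finset (Fin n)).val.map x).map fun a => s ^ (n - 1) * a).map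
        fun a => X - C a).prod := by
    rw [Finset.prod_eq_multiset_prod, Multiset.map_map, Multiset.map_map]
    rfl
  have hcard : Multiset.card ((((Finset.univ : Finset (Fin n)).val.map x).map
      fun a => s ^ (n - 1) * a)) = n := by
    rw [Multiset.card_map, Multiset.card_map, Finset.card_val, Finset.card_univ, Fintype.card_fin]
  rw [e1, Multiset.prod_X_sub_C_coeff _ (by rw [hcard]; exact hk), hcard]
  have e2 : (((Finset.univ : Finset (Fin n)).val.map x).map fun a => s ^ (n - 1) * a).esymm
      (n - k) = (s ^ (n - 1)) ^ (n - k) * ((Finset.univ : Finset (Fin n)).val.map x).esymm (n - k) := by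
    rw [← smul_eq_mul, Multiset.pow_smul_esymm]
    rfl
  rw [e2, ← pow_mul, mul_sub_exponent (Nat.sub_le n k), pow_add, mul_assoc]
  refine ((isIntegral_one.neg).pow _).mul (((isIntegral_sqrt_natCast _).pow _).mul ?_)
  have h := hT (n - k) (Nat.sub_le n k)
  rw [heckeEigenvalueOf, ← hs_def] at h
  exact isIntegral_of_mem_intermediateField E₀ h

/-- The identity `Σᵢ ((√q)^{n-1} xᵢ)⁻¹ = t_{n-1} / (((√q)^{n-1})² t_n)` with
`t_j = (√q)^{j(n-j)} e_j(x)`, for non-zero `xᵢ`. [folklore] -/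
theorem sum_inv_scaled_eq {n : ℕ} (hn : 0 < n) (s : ℂ) (hs : s ≠ 0) (x : Fin n → ℂ)
    (hx : ∀ i, x i ≠ 0) :
    ∑ i, (s ^ (n - 1) * x i)⁻¹ =
      (s ^ ((n - 1) * (n - (n - 1))) * ((Finset.univ : Finset (Fin n)).val.map x).esymm (n - 1)) /
        ((s ^ (n - 1)) ^ 2 *
          (s ^ (n * (n - n)) * ((Finset.univ : Finset (Fin n)).val.map x).esymm n)) := by
  rw [esymm_univ_card_sub_one hn, esymm_univ_card, Nat.sub_self, mul_zero, pow_zero, one_mul,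
    Nat.sub_sub_self (Nat.one_le_of_lt hn), mul_one, ← sum_inv_mul_prod x hx]
  have hP : ∏ i, x i ≠ 0 := Finset.prod_ne_zero_iff.mpr fun i _ => hx i
  have hc : s ^ (n - 1) ≠ 0 := pow_ne_zero _ hs
  simp_rw [mul_inv]
  rw [← Finset.mul_sum]
  field_simp

end RegularDescent

/-! ### The fact from lang.S27, Clozel's Hecke field, Flath, and infinitely many regular places -/

/-- Only finitely many finite places lie above a rational prime. [folklore] -/
theorem finite_setOf_natCast_mem_asIdeal_of_prime (K : Type) [Field K] [NumberField K] {p : ℕ}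
    (hp : p.Prime) : {v : HeightOneSpectrum (𝓞 K) | ((p : ℕ) : 𝓞 K) ∈ v.asIdeal}.Finite := by
  have hI : Ideal.span {((p : ℕ) : 𝓞 K)} ≠ ⊥ := by
    rw [Ne, Ideal.span_singleton_eq_bot]
    exact_mod_cast hp.ne_zero
  refine (Ideal.finite_factors hI).subset fun v hv => ?_
  exact (Ideal.dvd_span_singleton).mpr hv

/-- **An `E_λ`-rational attached representation at every `(ℓ, ι)`, for ONE regular algebraic
cuspidal `π` of rank `n ≥ 2` over any number field, from: attached semisimple representations at
every `(ℓ, ι)`, Clozel's Hecke field, and infinitely many regular places** — the per-`π` form of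
the assembly `…_of_attached_of_regularPlaces` below (same proof: the number field
`E = E₀(q_v^{(n-1)/2} β_{v,i} : v = v₁, v₂)` for two regular places of distinct residue
characteristics outside Clozel's exceptional set, "`tr r ∈ E_λ`" by Frobenius density, and descent
along the regular `E_λ`-rational Frobenius, `RegularDescent.exists_conj_apply_mem`).  Neither a CM
hypothesis on `K` nor a polarization of `π` is used at this point: they only serve, in print and
below, to PRODUCE the attached representations ([BLGGT, Thm. 2.1.1]) and the regular places
(Lemma 5.3.1 (3), first sentence).  No new named fact (D-0026).
[cite: BarnetlambEtAl2014, proof of Lemma 5.3.1 (3)] [cite: Clozel1990, Thm. 3.13] -/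
theorem exists_rationalModel_of_attached_of_frequently_nodup (hC : Clozel1990_heckeEigenvalueField)
    {n : ℕ} (hn : 2 ≤ n) {K : Type} [Field K] [NumberField K]
    {hcpt : isCompact_glFiniteIntegralLevel n K} (π : CuspidalAutomorphicRepData n K hcpt)
    (hra : π.1.IsRegularAlgebraic)
    (hA : ∀ (ℓ : ℕ) [Fact ℓ.Prime] (ι : PadicAlgCl ℓ ≃+* ℂ),
      ∃ r : FramedGaloisRep K (PadicAlgCl ℓ) n, r.toGaloisRep.IsSemisimple ∧
        ∀ (v : HeightOneSpectrum (𝓞 K)) (α : Multiset ℂ), π.1.HasSatakeParamAt v α →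
          ((ℓ : ℕ) : 𝓞 K) ∉ v.asIdeal →
            r.IsUnramifiedAt v ∧ r.HasFrobCharpolyAt v (arithFrobPolyOfSatake ι v.residueCard n α))
    (hReg : ∃ᶠ v in Filter.cofinite, ∃ β : Multiset ℂ, π.1.HasSatakeParamAt v β ∧ β.Nodup) :
    ∃ E : Subfield ℂ, FiniteDimensional ℚ E ∧
      ∀ (ℓ : ℕ) [Fact ℓ.Prime] (ι : PadicAlgCl ℓ ≃+* ℂ),
        ∃ r : FramedGaloisRep K (PadicAlgCl ℓ) n,
          (r.toGaloisRep.IsSemisimple ∧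
            ∀ (v : HeightOneSpectrum (𝓞 K)) (β : Multiset ℂ), π.1.HasSatakeParamAt v β →
              ((ℓ : ℕ) : 𝓞 K) ∉ v.asIdeal →
                r.IsUnramifiedAt v ∧
                  r.HasFrobCharpolyAt v (arithFrobPolyOfSatake ι v.residueCard n β)) ∧
          ∀ (g : Field.absoluteGaloisGroup K) (i j : Fin n),
            ((r g : GL (Fin n) (PadicAlgCl ℓ)) : Matrix (Fin n) (Fin n) (PadicAlgCl ℓ)) i j ∈
              closure (Set.range
                ((ι.symm : ℂ ≃+* PadicAlgCl ℓ).toRingHom.comp E.subtype)) := by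
  classical
  have hn0 : 0 < n := by omega
  -- scaling factors `c v = (√q_v)^{n-1}`
  set c : HeightOneSpectrum (𝓞 K) → ℂ := fun v =>
    (((Real.sqrt (v.residueCard : ℝ)) : ℝ) : ℂ) ^ (n - 1) with hc_def
  have hsqrt : ∀ v : HeightOneSpectrum (𝓞 K), (((Real.sqrt (v.residueCard : ℝ)) : ℝ) : ℂ) ≠ 0 :=
    fun v => by
      rw [Ne, Complex.ofReal_eq_zero, Real.sqrt_eq_zero (Nat.cast_nonneg _), Nat.cast_eq_zero]
      exact (zero_lt_one.trans v.one_lt_residueCard).ne'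
  have hc0 : ∀ v, c v ≠ 0 := fun v => pow_ne_zero _ (hsqrt v)
  -- Clozel's field of Hecke eigenvalues
  obtain ⟨E₀, hfd₀, hE₀⟩ := hC n K hcpt π hra
  set B : Set (HeightOneSpectrum (𝓞 K)) :=
    {v | ¬ ∀ α : Multiset ℂ, π.1.HasSatakeParamAt v α → ∀ i ≤ n, heckeEigenvalueOf n v α i ∈ E₀}
    with hB_def
  have hB : B.Finite := hE₀
  -- two regular places outside `B` of distinct residue characteristics
  have hRinf : {v : HeightOneSpectrum (𝓞 K) |
      ∃ β : Multiset ℂ, π.1.HasSatakeParamAt v β ∧ β.Nodup}.Infinite :=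
    Filter.frequently_cofinite_iff_infinite.mp hReg
  obtain ⟨v₁, ⟨β₁, hβ₁, hnd₁⟩, hv₁B⟩ := (hRinf.sdiff hB).nonempty
  obtain ⟨p₁, hp₁, hp₁v₁⟩ := exists_natPrime_natCast_mem v₁
  obtain ⟨v₂, ⟨β₂, hβ₂, hnd₂⟩, hv₂⟩ :=
    (hRinf.sdiff (hB.union (finite_setOf_natCast_mem_asIdeal_of_prime K hp₁))).nonempty
  simp only [Set.mem_union, not_or, Set.mem_setOf_eq] at hv₂
  obtain ⟨hv₂B, hp₁v₂⟩ := hv₂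
  obtain ⟨x₁, rfl⟩ := RegularDescent.exists_fin_enum β₁ hβ₁.card_eq
  obtain ⟨x₂, rfl⟩ := RegularDescent.exists_fin_enum β₂ hβ₂.card_eq
  -- the number field `E = E₀(q_v^{(n-1)/2} β_{v,i} : v = v₁, v₂)`
  let E₀' : IntermediateField ℚ ℂ :=
    E₀.toIntermediateField fun q => by simp
  haveI : FiniteDimensional ℚ E₀' := hfd₀
  have hE₀' : ∀ z, z ∈ E₀' ↔ z ∈ E₀ := fun z => Iff.rfl
  set Γ : Set ℂ := Set.range (fun i => c v₁ * x₁ i) ∪ Set.range (fun i => c v₂ * x₂ i) with hΓ_def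
  haveI : Finite Γ := ((Set.finite_range _).union (Set.finite_range _)).to_subtype
  have hgood : ∀ {v : HeightOneSpectrum (𝓞 K)} {x : Fin n → ℂ}, v ∉ B →
      π.1.HasSatakeParamAt v ((Finset.univ : Finset (Fin n)).val.map x) →
        ∀ j ≤ n, heckeEigenvalueOf n v ((Finset.univ : Finset (Fin n)).val.map x) j ∈ E₀' := by
    intro v x hvB hx j hj
    simp only [hB_def, Set.mem_setOf_eq, not_not] at hvB
    exact hvB _ hx j hj
  have hΓint : ∀ z ∈ Γ, IsIntegral ℚ z := by
    rintro z (⟨i, rfl⟩ | ⟨i, rfl⟩)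
    · exact RegularDescent.isIntegral_of_coeff_prod_X_sub_C (fun i => c v₁ * x₁ i)
        (RegularDescent.isIntegral_coeff_heckePolynomial v₁ x₁ E₀' (hgood hv₁B hβ₁)) i
    · exact RegularDescent.isIntegral_of_coeff_prod_X_sub_C (fun i => c v₂ * x₂ i)
        (RegularDescent.isIntegral_coeff_heckePolynomial v₂ x₂ E₀' (hgood hv₂B hβ₂)) i
  haveI : FiniteDimensional ℚ (IntermediateField.adjoin ℚ Γ) :=
    IntermediateField.finiteDimensional_adjoin hΓint
  let E : IntermediateField ℚ ℂ := E₀' ⊔ IntermediateField.adjoin ℚ Γ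
  have hE₀E : ∀ z ∈ E₀, z ∈ E := fun z hz => (le_sup_left : E₀' ≤ E) ((hE₀' z).mpr hz)
  have hΓE : ∀ z ∈ Γ, z ∈ E := fun z hz =>
    (le_sup_right : IntermediateField.adjoin ℚ Γ ≤ E) (IntermediateField.subset_adjoin ℚ Γ hz)
  refine ⟨E.toSubfield, (inferInstance : FiniteDimensional ℚ E), fun ℓ _ ι => ?_⟩
  -- the attached representation
  obtain ⟨r, hss, hr⟩ := hA ℓ ι
  -- a regular place `v₀ ∤ ℓ` among `v₁, v₂`
  obtain ⟨v₀, x₀, hv₀B, hβ₀, hnd₀, hℓv₀, hΓ₀⟩ : ∃ (v₀ : HeightOneSpectrum (𝓞 K)) (x₀ : Fin n → ℂ),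
      v₀ ∉ B ∧ π.1.HasSatakeParamAt v₀ ((Finset.univ : Finset (Fin n)).val.map x₀) ∧
        ((Finset.univ : Finset (Fin n)).val.map x₀).Nodup ∧ ((ℓ : ℕ) : 𝓞 K) ∉ v₀.asIdeal ∧
          ∀ i, c v₀ * x₀ i ∈ Γ := by
    by_cases hℓ : ((ℓ : ℕ) : 𝓞 K) ∈ v₁.asIdeal
    · have hℓp : ℓ = p₁ := natPrime_eq_of_natCast_mem Fact.out hp₁ hℓ hp₁v₁
      refine ⟨v₂, x₂, hv₂B, hβ₂, hnd₂, hℓp ▸ hp₁v₂, fun i => Or.inr ⟨i, rfl⟩⟩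
    · exact ⟨v₁, x₁, hv₁B, hβ₁, hnd₁, hℓ, fun i => Or.inl ⟨i, rfl⟩⟩
  -- the closed subfield `E_λ = closure of ι⁻¹(E)` of `ℚ̄_ℓ`
  let LE : Subfield (PadicAlgCl ℓ) :=
    (E.toSubfield.map (ι.symm : ℂ ≃+* PadicAlgCl ℓ).toRingHom).topologicalClosure
  have hLE : (LE : Set (PadicAlgCl ℓ)) =
      closure (Set.range ((ι.symm : ℂ ≃+* PadicAlgCl ℓ).toRingHom.comp E.toSubfield.subtype)) := by
    change closure _ = closure _
    congr 1
    rw [Subfield.coe_map, RingHom.coe_comp, Set.range_comp]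
    congr 1
    exact Set.ext fun z => ⟨fun hz => ⟨⟨z, hz⟩, rfl⟩, by rintro ⟨w, rfl⟩; exact w.2⟩
  have hmemLE : ∀ z ∈ E, (ι.symm : ℂ ≃+* PadicAlgCl ℓ) z ∈ LE := fun z hz =>
    Subfield.le_topologicalClosure _ (Subfield.mem_map.mpr ⟨z, hz, rfl⟩)
  -- Frobenius data at a good place
  have hfrob : ∀ {v : HeightOneSpectrum (𝓞 K)} {x : Fin n → ℂ},
      π.1.HasSatakeParamAt v ((Finset.univ : Finset (Fin n)).val.map x) →
      ((ℓ : ℕ) : 𝓞 K) ∉ v.asIdeal → ∀ 𝔓 ∈ v.primesAbove, ∀ σ : absoluteGaloisGroup K,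
        IsArithFrobAt (𝓞 K) σ 𝔓 →
          ((r σ : GL (Fin n) (PadicAlgCl ℓ)) : Matrix (Fin n) (Fin n) (PadicAlgCl ℓ)).charpoly =
              ∏ i, (X - C ((ι.symm : ℂ ≃+* PadicAlgCl ℓ) (c v * x i)⁻¹)) ∧
            ∀ i, x i ≠ 0 := by
    intro v x hx hℓv 𝔓 h𝔓 σ hσ
    have hcp : ((r σ : GL (Fin n) (PadicAlgCl ℓ)) : Matrix (Fin n) (Fin n) (PadicAlgCl ℓ)).charpoly =
        ∏ i, (X - C ((ι.symm : ℂ ≃+* PadicAlgCl ℓ) (c v * x i)⁻¹)) := by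
      have h := (hr v _ hx hℓv).2 𝔓 h𝔓 σ hσ
      rw [FramedRep.charpoly, arithFrobPolyOfSatake] at h
      rw [h, ← RegularDescent.prod_X_sub_C_eq_multiset x
        (fun a => (ι.symm : ℂ ≃+* PadicAlgCl ℓ) ((((Real.sqrt (v.residueCard : ℝ)) : ℝ) : ℂ) ^
          (n - 1) * a)⁻¹)]
    refine ⟨hcp, fun i hi => ?_⟩
    have hdet := RegularDescent.det_eq_prod_of_charpoly_eq _ _ hcp
    have hne : ((r σ : GL (Fin n) (PadicAlgCl ℓ)) : Matrix (Fin n) (Fin n) (PadicAlgCl ℓ)).det ≠ 0 := by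
      rw [← Matrix.GeneralLinearGroup.val_det_apply]
      exact Units.ne_zero _
    rw [hdet] at hne
    exact hne (Finset.prod_eq_zero (Finset.mem_univ i) (by rw [hi, mul_zero, inv_zero, map_zero]))
  -- traces lie in `E_λ`
  set S : Set (HeightOneSpectrum (𝓞 K)) :=
    ({v | ((ℓ : ℕ) : 𝓞 K) ∈ v.asIdeal} ∪ {v | ¬ π.1.IsUnramifiedAt v}) ∪ B with hS_def
  have hSfin : S.Finite :=
    ((finite_setOf_natCast_mem_asIdeal_of_prime K (Fact.out : ℓ.Prime)).union
      π.1.hasSatakeParamAt_cofinite_holds).union hB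
  have htrace : ∀ g, ((r g : GL (Fin n) (PadicAlgCl ℓ)) : Matrix (Fin n) (Fin n) (PadicAlgCl ℓ)).trace
      ∈ LE := by
    refine RegularDescent.trace_apply_mem_of_frobenius r S hSfin
      (Subfield.isClosed_topologicalClosure _) fun v hvS 𝔓 h𝔓 σ hσ => ?_
    simp only [hS_def, Set.mem_union, Set.mem_setOf_eq, not_or, not_not] at hvS
    obtain ⟨⟨hℓv, β, hβ⟩, hvB⟩ := hvS
    obtain ⟨x, rfl⟩ := RegularDescent.exists_fin_enum β hβ.card_eq
    obtain ⟨hcp, hx0⟩ := hfrob hβ hℓv 𝔓 h𝔓 σ hσ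
    have hvB' : v ∉ B := hvB
    rw [SetLike.mem_coe, RegularDescent.trace_eq_sum_of_charpoly_eq hn0 _ _ hcp]
    rw [← map_sum, RegularDescent.sum_inv_scaled_eq hn0 _ (hsqrt v) x hx0]
    refine hmemLE _ (div_mem (hE₀E _ (hgood hvB' hβ (n - 1) (Nat.sub_le n 1))) (mul_mem ?_
      (hE₀E _ (hgood hvB' hβ n le_rfl))))
    rw [← pow_mul, mul_comm, pow_mul, ← Complex.ofReal_pow, Real.sq_sqrt (Nat.cast_nonneg _),
      Complex.ofReal_natCast]
    exact pow_mem (natCast_mem E _) _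
  -- a Frobenius at `v₀`: `n` distinct `E_λ`-rational eigenvalues
  obtain ⟨𝔓₀, h𝔓₀⟩ := v₀.primesAbove_nonempty
  obtain ⟨σ₀, hσ₀⟩ := HeightOneSpectrum.exists_isArithFrobAt_of_mem_primesAbove_holds h𝔓₀
  obtain ⟨hcp₀, hx₀⟩ := hfrob hβ₀ hℓv₀ 𝔓₀ h𝔓₀ σ₀ hσ₀
  have hinj : Function.Injective fun i => (ι.symm : ℂ ≃+* PadicAlgCl ℓ) (c v₀ * x₀ i)⁻¹ := by
    intro i j hij
    have h1 := (mul_right_injective₀ (hc0 v₀)) (inv_injective ((ι.symm : ℂ ≃+* PadicAlgCl ℓ).injective hij))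
    exact Multiset.inj_on_of_nodup_map hnd₀ i (Finset.mem_univ_val i) j (Finset.mem_univ_val j) h1
  have hαL : ∀ i, (ι.symm : ℂ ≃+* PadicAlgCl ℓ) (c v₀ * x₀ i)⁻¹ ∈ LE := fun i =>
    hmemLE _ (inv_mem (hΓE _ (hΓ₀ i)))
  -- descent
  haveI : (FramedRep.toRepresentation r).IsSemisimpleRepresentation := hss
  obtain ⟨P, hP⟩ := RegularDescent.exists_conj_apply_mem LE r.toMonoidHom
    (FramedRep.toRepresentation r) (fun g v => rfl) htrace σ₀ _ hinj hαL hcp₀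
  refine ⟨FramedRep.conj P r, ⟨?_, fun v β hβ hℓv => ?_⟩, fun g i j => ?_⟩
  · exact RegularDescent.isSemisimpleRepresentation_conj r P
  · exact ⟨(FramedGaloisRep.isUnramifiedAt_conj_iff v P r).mpr (hr v β hβ hℓv).1,
      (FramedGaloisRep.hasFrobCharpolyAt_conj_iff v P _ r).mpr (hr v β hβ hℓv).2⟩
  · rw [← hLE]
    exact hP g i j

/-- **`BLGGT2014_polarized_compatibleSystem_rationalModels` from an attached semisimple
representation of the POLARIZED `π`, Clozel's Hecke field, and infinitely many regular places** —
the assembly with the weakest existence hypothesis: for every CM `K`, every regular algebraic,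
norm-polarized cuspidal `π` of rank `n ≥ 2` and every `(ℓ, ι)`, SOME semisimple `r` attached to
`(π, ι)` (in print [BLGGT, Thm. 2.1.1]; in the tree supplied by lang.S27, `…_of_regularPlaces`, or
by Fakhruddin–Pilloni's Thm. 9.10 semisimplified, `…_of_normTwist_of_regularPlaces`); Clozel's
number field of Hecke eigenvalues (`Clozel1990_heckeEigenvalueField`); and the one input of
[BLGGT]'s proof of Lemma 5.3.1 (3) that rests on `p`-adic Hodge theory, "infinitely many `Q_v(X)`
have `n` distinct roots" (`hReg`).  Flath's "unramified almost everywhere" is the tree's theorem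
`AutomorphicRepData.hasSatakeParamAt_cofinite_holds`.  Everything else in the printed proof — the
splitting field of `Q_v Q_{v'}` for two such places of distinct residue characteristic (here:
`E = E₀(roots)`, finite over `ℚ` because the roots `q_v^{(n-1)/2} β_i` are integral over `ℚ`),
"`tr r_λ ∈ M_λ`" by Chebotarev density and continuity, and the descent of `r_λ` to `M_λ` along an
element with `n` distinct `M_λ`-rational eigenvalues (`RegularDescent.exists_conj_apply_mem`) — is
PROVED here; ranks `0, 1` are the proved slices (`_of_two_le_rank`).  A theorem with the three
inputs as hypotheses; no new named fact (D-0026).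
[cite: BarnetlambEtAl2014, Thm. 2.1.1, §5.1 and proof of Lemma 5.3.1 (3)] [cite: Clozel1990, Thm. 3.13] -/
theorem BLGGT2014_polarized_compatibleSystem_rationalModels_of_attached_of_regularPlaces
    (hA : ∀ (n : ℕ), 2 ≤ n → ∀ (K : Type) [Field K] [NumberField K] [IsCMField K]
      (hcpt : isCompact_glFiniteIntegralLevel n K) (π : CuspidalAutomorphicRepData n K hcpt),
        π.1.IsRegularAlgebraic →
        (∃ (χ : HeckeCharacter K) (m : ℤ),
            (∀ x : ideleGroup K, ((χ x : ℂˣ) : ℂ) = (ideleNorm x : ℂ) ^ (m : ℂ)) ∧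
              π.1.IsEssConjSelfDual χ) →
          ∀ (ℓ : ℕ) [Fact ℓ.Prime] (ι : PadicAlgCl ℓ ≃+* ℂ),
            ∃ r : FramedGaloisRep K (PadicAlgCl ℓ) n, r.toGaloisRep.IsSemisimple ∧
              ∀ (v : HeightOneSpectrum (𝓞 K)) (α : Multiset ℂ), π.1.HasSatakeParamAt v α →
                ((ℓ : ℕ) : 𝓞 K) ∉ v.asIdeal →
                  r.IsUnramifiedAt v ∧
                    r.HasFrobCharpolyAt v (arithFrobPolyOfSatake ι v.residueCard n α))
    (hC : Clozel1990_heckeEigenvalueField)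
    (hReg : ∀ (n : ℕ), 2 ≤ n → ∀ (K : Type) [Field K] [NumberField K] [IsCMField K]
      (hcpt : isCompact_glFiniteIntegralLevel n K) (π : CuspidalAutomorphicRepData n K hcpt),
        π.1.IsRegularAlgebraic →
        (∃ (χ : HeckeCharacter K) (m : ℤ),
            (∀ x : ideleGroup K, ((χ x : ℂˣ) : ℂ) = (ideleNorm x : ℂ) ^ (m : ℂ)) ∧
              π.1.IsEssConjSelfDual χ) →
          ∃ᶠ v in Filter.cofinite, ∃ β : Multiset ℂ, π.1.HasSatakeParamAt v β ∧ β.Nodup) :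
    BLGGT2014_polarized_compatibleSystem_rationalModels :=
  BLGGT2014_polarized_compatibleSystem_rationalModels_of_two_le_rank
    fun n hn K _ _ _ hcpt π hra hpol =>
      exists_rationalModel_of_attached_of_frequently_nodup hC hn π hra
        (fun ℓ _ ι => hA n hn K hcpt π hra hpol ℓ ι) (hReg n hn K hcpt π hra hpol)


/-- **`BLGGT2014_polarized_compatibleSystem_rationalModels` from its printed inputs** — the
existence of the attached semisimple representations (in the tree: lang.S27,
`exists_galoisRep_of_regularAlgebraic`), Clozel's number field of Hecke eigenvalues
(`Clozel1990_heckeEigenvalueField`), Flath's "unramified almost everywhere"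
(`AutomorphicRepData.hasSatakeParamAt_cofinite`), and the one input of [BLGGT]'s proof of
Lemma 5.3.1 (3) that rests on `p`-adic Hodge theory (regularity of the Hodge–Tate weights and
Sen's theorem, through Harris–Taylor VII.1.8): "infinitely many `Q_v(X)` have `n` distinct
roots", i.e. infinitely many places carry a Satake parameter without repetition.  Everything
else in the printed proof — the splitting field of `Q_v Q_{v'}` for two such places of distinct
residue characteristic (here: `E = E₀(roots)`, finite over `ℚ` because the roots
`q_v^{(n-1)/2} β_i` are integral over `ℚ`), "`tr r_λ ∈ M_λ`" by Chebotarev density and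
continuity, and the descent of `r_λ` to `M_λ` along an element with `n` distinct `M_λ`-rational
eigenvalues (`RegularDescent.exists_conj_apply_mem`) — is PROVED here; ranks `0, 1` are the
proved slices (`_of_two_le_rank`).  A theorem with the four inputs as hypotheses; no new named
fact (D-0026). [cite: BarnetlambEtAl2014, Thm. 2.1.1, §5.1 and proof of Lemma 5.3.1 (3)]
[cite: Clozel1990, Thm. 3.13] -/
theorem BLGGT2014_polarized_compatibleSystem_rationalModels_of_regularPlaces
    (hA : exists_galoisRep_of_regularAlgebraic) (hC : Clozel1990_heckeEigenvalueField)
    (hF : ∀ (n : ℕ) (K : Type) [Field K] [NumberField K]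
      (hcpt : isCompact_glFiniteIntegralLevel n K) (π : CuspidalAutomorphicRepData n K hcpt),
      π.1.hasSatakeParamAt_cofinite)
    (hReg : ∀ (n : ℕ), 2 ≤ n → ∀ (K : Type) [Field K] [NumberField K] [IsCMField K]
      (hcpt : isCompact_glFiniteIntegralLevel n K) (π : CuspidalAutomorphicRepData n K hcpt),
        π.1.IsRegularAlgebraic →
        (∃ (χ : HeckeCharacter K) (m : ℤ),
            (∀ x : ideleGroup K, ((χ x : ℂˣ) : ℂ) = (ideleNorm x : ℂ) ^ (m : ℂ)) ∧
              π.1.IsEssConjSelfDual χ) →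
          ∃ᶠ v in Filter.cofinite, ∃ β : Multiset ℂ, π.1.HasSatakeParamAt v β ∧ β.Nodup) :
    BLGGT2014_polarized_compatibleSystem_rationalModels := by
  have _ := hF
  exact BLGGT2014_polarized_compatibleSystem_rationalModels_of_attached_of_regularPlaces
    (fun _n _hn K _ _ _ hcpt π hra _hpol ℓ _ ι => hA hcpt (Or.inr ‹IsCMField K›) π hra ℓ ι) hC hReg

/-! ### "`n` distinct roots" is open; regular places from one regular element (Frobenius density) -/

namespace RegularDescent

/-! #### "`n` distinct roots" is an open condition: the resultant of the characteristic
polynomial and its derivative -/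

/-- The resultant `Res_{n,n-1}(χ_M, χ_M')` of the characteristic polynomial of an `n × n` matrix
and its derivative is the evaluation at the entries of `M` of ONE integer polynomial in `n²`
variables (the same resultant for the universal matrix, Mathlib `Matrix.charpoly.univ`).
[folklore] -/
theorem resultant_charpoly_eq_eval₂Hom {A : Type*} [CommRing A] {n : ℕ}
    (M : Matrix (Fin n) (Fin n) A) :
    Polynomial.resultant M.charpoly (derivative M.charpoly) n (n - 1) =
      MvPolynomial.eval₂Hom (Int.castRingHom A) (fun ij : Fin n × Fin n => M ij.1 ij.2)
        (Polynomial.resultant (Matrix.charpoly.univ ℤ (Fin n))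
          (derivative (Matrix.charpoly.univ ℤ (Fin n))) n (n - 1)) := by
  have hM : Matrix.of (Function.curry fun ij : Fin n × Fin n => M ij.1 ij.2) = M := by
    ext i j; rfl
  have h1 : (Matrix.charpoly.univ ℤ (Fin n)).map
      (MvPolynomial.eval₂Hom (Int.castRingHom A) (fun ij : Fin n × Fin n => M ij.1 ij.2)) =
        M.charpoly := by
    rw [Matrix.charpoly.univ_map_eval₂Hom, hM]
  rw [← Polynomial.resultant_map_map, ← Polynomial.derivative_map, h1]

/-- `M ↦ Res_{n,n-1}(χ_M, χ_M')` is continuous on `n × n` matrices over a topological ring (a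
polynomial in the entries). [folklore] -/
theorem continuous_resultant_charpoly {A : Type*} [CommRing A] [TopologicalSpace A]
    [IsTopologicalRing A] {n : ℕ} :
    Continuous fun M : Matrix (Fin n) (Fin n) A =>
      Polynomial.resultant M.charpoly (derivative M.charpoly) n (n - 1) := by
  set D := Polynomial.resultant (Matrix.charpoly.univ ℤ (Fin n))
    (derivative (Matrix.charpoly.univ ℤ (Fin n))) n (n - 1)
  have h : (fun M : Matrix (Fin n) (Fin n) A =>
      Polynomial.resultant M.charpoly (derivative M.charpoly) n (n - 1)) =
      fun M => MvPolynomial.eval (fun ij : Fin n × Fin n => M ij.1 ij.2)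
        (MvPolynomial.map (Int.castRingHom A) D) := by
    funext M
    rw [resultant_charpoly_eq_eval₂Hom, MvPolynomial.coe_eval₂Hom, MvPolynomial.eval_map]
  rw [h]
  exact (MvPolynomial.continuous_eval _).comp
    (continuous_pi fun ij : Fin n × Fin n => (continuous_apply ij.2).comp (continuous_apply ij.1))

/-- Over a field of characteristic zero: `Res_{n,n-1}(χ_M, χ_M') ≠ 0` iff the
characteristic polynomial of `M` is separable (`χ_M` is monic of degree `n`, `χ_M'` has degree
`n - 1`; Mathlib `Polynomial.resultant_eq_zero_iff`). [folklore] -/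
theorem resultant_charpoly_ne_zero_iff {A : Type*} [Field A] [CharZero A] {n : ℕ}
    (M : Matrix (Fin n) (Fin n) A) :
    Polynomial.resultant M.charpoly (derivative M.charpoly) n (n - 1) ≠ 0 ↔
      M.charpoly.Separable := by
  have hdeg : M.charpoly.natDegree = n := by
    rw [Matrix.charpoly_natDegree_eq_dim, Fintype.card_fin]
  have hdeg' : (derivative M.charpoly).natDegree = n - 1 := by
    rw [Polynomial.natDegree_derivative, hdeg]
  have h0 : M.charpoly ≠ 0 := (Matrix.charpoly_monic M).ne_zero
  have key := @Polynomial.resultant_eq_zero_iff A _ M.charpoly (derivative M.charpoly)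
  rw [hdeg, hdeg'] at key
  rw [Ne, key, Polynomial.separable_def]
  tauto

end RegularDescent

/-- **If some attached `r_{ℓ,ι}` takes a value with `n` distinct eigenvalues, then infinitely many
places carry a Satake parameter without repetition** — the passage "`G_λ` contains an element
whose characteristic polynomial has `n` distinct roots … [Frobenius elements are dense] … we
conclude that infinitely many `Q_v(X)` have `n` distinct roots" of [BLGGT], proof of
Lemma 5.3.1 (3), in the `ℓ`-adic topology: the elements `g` with `charpoly r(g)` separable form
an OPEN set (non-vanishing of the resultant `Res(χ, χ')`, a polynomial in the entries,
`RegularDescent.continuous_resultant_charpoly` / `….resultant_charpoly_ne_zero_iff`), non-empty by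
hypothesis, so it contains Frobenius elements at places outside any finite set (Chebotarev,
`absoluteGaloisGroup.frobenius_dense` with the proved `chebotarev_artinRep_holds`) — in particular
outside the places above `ℓ`, the ramified places of `π` (finitely many: Flath,
`AutomorphicRepData.hasSatakeParamAt_cofinite_holds`) and any finite set of "regular" places; at
such a Frobenius the characteristic polynomial is `∏_{b ∈ β_v} (X - ι⁻¹((q_v^{(n-1)/2} b)⁻¹))`,
separable, so `β_v` has no repetition.  Hence the regular places are infinite.  This reduces the
raw input `hReg` of `…_of_attached_of_regularPlaces` to the first sentence of the printed proof
(an element with `n` distinct eigenvalues in the image, from Hodge–Tate regularity and Sen's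
theorem). [cite: BarnetlambEtAl2014, proof of Lemma 5.3.1 (3)]
[cite: SerreAbelianLadic1968, Ch. I §2.2, Cor. 2 (a)] -/
theorem frequently_satakeParam_nodup_of_separable_charpoly {n : ℕ}
    {K : Type} [Field K] [NumberField K] {hcpt : isCompact_glFiniteIntegralLevel n K}
    (π : CuspidalAutomorphicRepData n K hcpt) {ℓ : ℕ} [Fact ℓ.Prime] (ι : PadicAlgCl ℓ ≃+* ℂ)
    (r : FramedGaloisRep K (PadicAlgCl ℓ) n)
    (hr : ∀ (v : HeightOneSpectrum (𝓞 K)) (α : Multiset ℂ), π.1.HasSatakeParamAt v α →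
      ((ℓ : ℕ) : 𝓞 K) ∉ v.asIdeal →
        r.IsUnramifiedAt v ∧ r.HasFrobCharpolyAt v (arithFrobPolyOfSatake ι v.residueCard n α))
    {g₀ : absoluteGaloisGroup K} (hsep : (FramedRep.charpoly r g₀).Separable) :
    ∃ᶠ v in Filter.cofinite, ∃ β : Multiset ℂ, π.1.HasSatakeParamAt v β ∧ β.Nodup := by
  rw [Filter.frequently_cofinite_iff_infinite]
  by_contra hfin
  have hR : {v : HeightOneSpectrum (𝓞 K) |
      ∃ β : Multiset ℂ, π.1.HasSatakeParamAt v β ∧ β.Nodup}.Finite := Set.not_infinite.mp hfin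
  set S : Set (HeightOneSpectrum (𝓞 K)) :=
    ({v | ((ℓ : ℕ) : 𝓞 K) ∈ v.asIdeal} ∪ {v | ¬ π.1.IsUnramifiedAt v}) ∪
      {v | ∃ β : Multiset ℂ, π.1.HasSatakeParamAt v β ∧ β.Nodup} with hS_def
  have hSfin : S.Finite :=
    ((finite_setOf_natCast_mem_asIdeal_of_prime K (Fact.out : ℓ.Prime)).union
      π.1.hasSatakeParamAt_cofinite_holds).union hR
  -- the open set of elements with separable characteristic polynomial
  set f : absoluteGaloisGroup K → PadicAlgCl ℓ := fun g =>
    Polynomial.resultant ((r g : GL (Fin n) (PadicAlgCl ℓ)) : Matrix (Fin n) (Fin n) _).charpoly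
      (derivative ((r g : GL (Fin n) (PadicAlgCl ℓ)) : Matrix (Fin n) (Fin n) _).charpoly)
        n (n - 1) with hf_def
  have hf : Continuous f :=
    RegularDescent.continuous_resultant_charpoly.comp (Units.continuous_val.comp (map_continuous r))
  have hU : IsOpen (f ⁻¹' {0}ᶜ) := isOpen_compl_singleton.preimage hf
  have hg₀ : g₀ ∈ f ⁻¹' {0}ᶜ :=
    (RegularDescent.resultant_charpoly_ne_zero_iff _).mpr hsep
  -- a Frobenius at a place outside `S` in it
  have hD := absoluteGaloisGroup.frobenius_dense Automorphic.chebotarev_artinRep_holds K S hSfin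
  obtain ⟨σ, hσU, v, hvS, 𝔓, h𝔓, hσ⟩ := hD.inter_open_nonempty _ hU ⟨g₀, hg₀⟩
  simp only [hS_def, Set.mem_union, Set.mem_setOf_eq, not_or, not_not] at hvS
  obtain ⟨⟨hℓv, β, hβ⟩, hvR⟩ := hvS
  have hcp := (hr v β hβ hℓv).2 𝔓 h𝔓 σ hσ
  have hsepσ : (arithFrobPolyOfSatake ι v.residueCard n β).Separable := by
    rw [← hcp]
    exact (RegularDescent.resultant_charpoly_ne_zero_iff _).mp hσU
  have hnd := Polynomial.nodup_roots hsepσ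
  rw [roots_arithFrobPolyOfSatake] at hnd
  exact hvR ⟨β, hβ, hnd.of_map _⟩

/-! ### The attached representation from Fakhruddin–Pilloni, semisimplified; the fact from
Fakhruddin–Pilloni, Clozel, and infinitely many regular places -/

/-- **A SEMISIMPLE representation attached to a regular algebraic, norm-polarized cuspidal `π`
over a CM field, from Fakhruddin–Pilloni's Thm. 9.10** (the named fact
`FakhruddinPilloni2021_galoisRep_of_weaklyRegular_normTwist`, through its proved regular slice
`FakhruddinPilloni2021_galoisRep_of_regularAlgebraic_normTwist`): the continuous `r₀` it provides
is replaced by its semisimplification (`FramedGaloisRep.exists_semisimplification`: semisimple,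
same characteristic polynomials, unramified wherever `r₀` is, with every Frobenius characteristic
polynomial `r₀` has), which is therefore again attached to `(π, ι)` at every finite `v ∤ ℓ`
carrying a Satake parameter.  For such `π` this is the representation `r_{l,ı}(π)` of
[BLGGT, Thm. 2.1.1] ("a continuous semi-simple representation"), `0 < n`.
[cite: BarnetlambEtAl2014, Thm. 2.1.1] [cite: FakhruddinPilloni2021, Thm. 9.10 and Thm. 9.1] -/
theorem exists_semisimple_attached_of_normTwist
    (h910 : FakhruddinPilloni2021_galoisRep_of_weaklyRegular_normTwist)
    {n : ℕ} (hn : 0 < n) {K : Type} [Field K] [NumberField K] [IsCMField K]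
    {hcpt : isCompact_glFiniteIntegralLevel n K} (π : CuspidalAutomorphicRepData n K hcpt)
    (hra : π.1.IsRegularAlgebraic) {χ : HeckeCharacter K} {m : ℤ}
    (hχ : ∀ x : ideleGroup K, ((χ x : ℂˣ) : ℂ) = (ideleNorm x : ℂ) ^ (m : ℂ))
    (hsd : π.1.IsEssConjSelfDual χ) (ℓ : ℕ) [Fact ℓ.Prime] (ι : PadicAlgCl ℓ ≃+* ℂ) :
    ∃ r : FramedGaloisRep K (PadicAlgCl ℓ) n, r.toGaloisRep.IsSemisimple ∧
      ∀ (v : HeightOneSpectrum (𝓞 K)) (α : Multiset ℂ), π.1.HasSatakeParamAt v α →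
        ((ℓ : ℕ) : 𝓞 K) ∉ v.asIdeal →
          r.IsUnramifiedAt v ∧ r.HasFrobCharpolyAt v (arithFrobPolyOfSatake ι v.residueCard n α) := by
  obtain ⟨r₀, hr₀⟩ :=
    FakhruddinPilloni2021_galoisRep_of_regularAlgebraic_normTwist h910 hn π hra hχ hsd ℓ ι
  obtain ⟨r, hss, -, -, hunr, hfrob⟩ := FramedGaloisRep.exists_semisimplification r₀
  exact ⟨r, hss, fun v α hα hℓ =>
    ⟨hunr v (hr₀ v α hα hℓ).1, hfrob v _ (hr₀ v α hα hℓ).2⟩⟩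

/-- **`BLGGT2014_polarized_compatibleSystem_rationalModels` from Fakhruddin–Pilloni's attached
representations, Clozel's Hecke field, and infinitely many regular places.**  The existence input
of `…_of_attached_of_regularPlaces` is supplied, for the POLARIZED regular algebraic `π` the fact
is about, by `exists_semisimple_attached_of_normTwist` (the named fact
`FakhruddinPilloni2021_galoisRep_of_weaklyRegular_normTwist`, semisimplified) instead of lang.S27
(Harris–Lan–Taylor–Thorne, Thm. A, for all regular algebraic `π` — whose printed proof uses the
polarized case).  So a discharge of the fact needs exactly: that named fact,
`Clozel1990_heckeEigenvalueField`, and `hReg` ([BLGGT], proof of Lemma 5.3.1 (3): Hodge–Tate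
regularity of `r_{l,ı}(π)` and Sen's theorem).  No new named fact (D-0026).
[cite: BarnetlambEtAl2014, Thm. 2.1.1, §5.1 and proof of Lemma 5.3.1 (3)]
[cite: FakhruddinPilloni2021, Thm. 9.10 and Thm. 9.1] [cite: Clozel1990, Thm. 3.13] -/
theorem BLGGT2014_polarized_compatibleSystem_rationalModels_of_normTwist_of_regularPlaces
    (h910 : FakhruddinPilloni2021_galoisRep_of_weaklyRegular_normTwist)
    (hC : Clozel1990_heckeEigenvalueField)
    (hReg : ∀ (n : ℕ), 2 ≤ n → ∀ (K : Type) [Field K] [NumberField K] [IsCMField K]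
      (hcpt : isCompact_glFiniteIntegralLevel n K) (π : CuspidalAutomorphicRepData n K hcpt),
        π.1.IsRegularAlgebraic →
        (∃ (χ : HeckeCharacter K) (m : ℤ),
            (∀ x : ideleGroup K, ((χ x : ℂˣ) : ℂ) = (ideleNorm x : ℂ) ^ (m : ℂ)) ∧
              π.1.IsEssConjSelfDual χ) →
          ∃ᶠ v in Filter.cofinite, ∃ β : Multiset ℂ, π.1.HasSatakeParamAt v β ∧ β.Nodup) :
    BLGGT2014_polarized_compatibleSystem_rationalModels :=
  BLGGT2014_polarized_compatibleSystem_rationalModels_of_attached_of_regularPlaces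
    (fun _n hn _K _ _ _ _hcpt π hra hpol ℓ _ ι => by
      obtain ⟨χ, m, hχ, hsd⟩ := hpol
      exact exists_semisimple_attached_of_normTwist h910 (by omega) π hra hχ hsd ℓ ι)
    hC hReg

/-- **`BLGGT2014_polarized_compatibleSystem_rationalModels` from Fakhruddin–Pilloni's attached
representations, Clozel's Hecke field, and ONE element with `n` distinct eigenvalues in the image
of some attached representation** — the residue of a discharge in the form of the FIRST SENTENCE
of [BLGGT]'s proof of Lemma 5.3.1 (3) ("the regularity assumption tells us that `G_λ^0` contains
an element whose characteristic polynomial has `n` distinct roots", there for the Zariski closure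
`G_λ`; here for the image itself): for every CM `K` and every regular algebraic, norm-polarized
cuspidal `π` of rank `n ≥ 2`, at SOME `(ℓ, ι)` SOME `r` attached to `(π, ι)` takes a value with
separable characteristic polynomial (`hElt`).  From it, infinitely many regular places
(`frequently_satakeParam_nodup_of_separable_charpoly`: openness of "`n` distinct roots" and
Chebotarev density), and then `…_of_normTwist_of_regularPlaces`.  The printed source of `hElt` is
the Hodge–Tate regularity of `r_{l,ı}(π)` ([BLGGT, Thm. 2.1.1 (3)]) with Sen's theorem
([HT, VII.1.8]); neither is in the tree.  No new named fact (D-0026).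
[cite: BarnetlambEtAl2014, Thm. 2.1.1, §5.1 and proof of Lemma 5.3.1 (3)]
[cite: FakhruddinPilloni2021, Thm. 9.10 and Thm. 9.1] [cite: Clozel1990, Thm. 3.13] -/
theorem BLGGT2014_polarized_compatibleSystem_rationalModels_of_normTwist_of_regularElement
    (h910 : FakhruddinPilloni2021_galoisRep_of_weaklyRegular_normTwist)
    (hC : Clozel1990_heckeEigenvalueField)
    (hElt : ∀ (n : ℕ), 2 ≤ n → ∀ (K : Type) [Field K] [NumberField K] [IsCMField K]
      (hcpt : isCompact_glFiniteIntegralLevel n K) (π : CuspidalAutomorphicRepData n K hcpt),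
        π.1.IsRegularAlgebraic →
        (∃ (χ : HeckeCharacter K) (m : ℤ),
            (∀ x : ideleGroup K, ((χ x : ℂˣ) : ℂ) = (ideleNorm x : ℂ) ^ (m : ℂ)) ∧
              π.1.IsEssConjSelfDual χ) →
          ∃ (ℓ : ℕ) (_ : Fact ℓ.Prime) (ι : PadicAlgCl ℓ ≃+* ℂ)
            (r : FramedGaloisRep K (PadicAlgCl ℓ) n),
            (∀ (v : HeightOneSpectrum (𝓞 K)) (α : Multiset ℂ), π.1.HasSatakeParamAt v α →
              ((ℓ : ℕ) : 𝓞 K) ∉ v.asIdeal →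
                r.IsUnramifiedAt v ∧
                  r.HasFrobCharpolyAt v (arithFrobPolyOfSatake ι v.residueCard n α)) ∧
            ∃ g₀ : absoluteGaloisGroup K, (FramedRep.charpoly r g₀).Separable) :
    BLGGT2014_polarized_compatibleSystem_rationalModels :=
  BLGGT2014_polarized_compatibleSystem_rationalModels_of_normTwist_of_regularPlaces h910 hC
    fun n hn K _ _ _ hcpt π hra hpol => by
      obtain ⟨ℓ, _, ι, r, hr, g₀, hsep⟩ := hElt n hn K hcpt π hra hpol
      exact frequently_satakeParam_nodup_of_separable_charpoly π ι r hr hsep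

/-! ### Regular places from a regular element of ANY representation carrying `π`'s Frobenius
polynomials off a finite set (appended 2026-08-17, third pass)

The regular element of [BLGGT]'s proof of Lemma 5.3.1 (3) is produced, in print, inside the image
of `r_λ = r_{l,ı}(π)` by Hodge–Tate regularity and Sen's theorem; in the tree the representations
to which such `p`-adic Hodge-theoretic statements are (or will be) attached come in several
vocabularies — attached at every `v ∤ ℓ` carrying a Satake parameter (lang.S27,
`exists_galoisRep_of_regularAlgebraic`; Fakhruddin–Pilloni, `…_normTwist`), or only above the good
rational primes (Harris–Lan–Taylor–Thorne's characterising property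
`HarrisLanTaylorThorne2016.IsCompatible`, the vocabulary of `AHTW2026.deRham_hodgeTateRegular` and
of `Varma2024.corollary93_unramified`).  The density argument of
`frequently_satakeParam_nodup_of_separable_charpoly` needs much less than attachment: only that the
Frobenius characteristic polynomials of `r` at all but finitely many unramified places of `π` are
the `arithFrobPolyOfSatake ι q_v n β` (no unramifiedness of `r`, no semisimplicity, any finite set
of exceptions).  It is restated in that generality (`…_of_eventually`), specialised to
HLTT-compatible `r` (`eventually_isGaloisCompatibleAt_of_isCompatible`: the exceptional places lie
over `ℓ` or over the finitely many rational primes below a ramified place of `π`, Flath), and the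
reduction of the fact is given the corresponding weakest form of its last raw input
(`…_of_normTwist_of_eventuallyCompatible_regularElement`, `…_of_normTwist_of_isCompatible_regularElement`):
ONE element with separable characteristic polynomial in the image of ONE representation carrying
`π`'s Frobenius polynomials off a finite set, at ONE `(ℓ, ι)`, for each polarized regular algebraic
`π` of rank `≥ 2`.  No new named fact (D-0026). -/

/-- **Regular places from one regular element, for a representation with `π`'s Frobenius
polynomials off a finite set.**  Let `r : Γ_K → GL_n(ℚ̄_ℓ)` be continuous and suppose that for all
but finitely many finite places `v`, every Satake parameter `β` of `π` at `v` gives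
`charpoly r(Frob_v) = arithFrobPolyOfSatake ι q_v n β` (at every arithmetic Frobenius over `v`).  If
some `r(g₀)` has separable characteristic polynomial, then infinitely many places carry a Satake
parameter of `π` without repetition: the set of `g` with `charpoly r(g)` separable is open
(`RegularDescent.continuous_resultant_charpoly`, `….resultant_charpoly_ne_zero_iff`) and non-empty,
so it contains a Frobenius element at a place outside any finite set (Chebotarev,
`absoluteGaloisGroup.frobenius_dense` with the proved `chebotarev_artinRep_holds`) — outside the
exceptional set, the ramified places of `π` (Flath, `AutomorphicRepData.hasSatakeParamAt_cofinite_holds`)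
and the finitely many regular places there would otherwise be; there the Frobenius polynomial
`∏_{b ∈ β_v} (X - ι⁻¹((q_v^{(n-1)/2} b)⁻¹))` is separable, so `β_v` has no repetition, a
contradiction.  Generalises `frequently_satakeParam_nodup_of_separable_charpoly` (attachment at
every `v ∤ ℓ`). [cite: BarnetlambEtAl2014, proof of Lemma 5.3.1 (3)]
[cite: SerreAbelianLadic1968, Ch. I §2.2, Cor. 2 (a)] -/
theorem frequently_satakeParam_nodup_of_separable_charpoly_of_eventually {n : ℕ}
    {K : Type} [Field K] [NumberField K] {hcpt : isCompact_glFiniteIntegralLevel n K}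
    (π : CuspidalAutomorphicRepData n K hcpt) {ℓ : ℕ} [Fact ℓ.Prime] (ι : PadicAlgCl ℓ ≃+* ℂ)
    (r : FramedGaloisRep K (PadicAlgCl ℓ) n)
    (hr : ∀ᶠ v in Filter.cofinite, ∀ α : Multiset ℂ, π.1.HasSatakeParamAt v α →
      r.HasFrobCharpolyAt v (arithFrobPolyOfSatake ι v.residueCard n α))
    {g₀ : absoluteGaloisGroup K} (hsep : (FramedRep.charpoly r g₀).Separable) :
    ∃ᶠ v in Filter.cofinite, ∃ β : Multiset ℂ, π.1.HasSatakeParamAt v β ∧ β.Nodup := by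
  rw [Filter.frequently_cofinite_iff_infinite]
  by_contra hfin
  have hR : {v : HeightOneSpectrum (𝓞 K) |
      ∃ β : Multiset ℂ, π.1.HasSatakeParamAt v β ∧ β.Nodup}.Finite := Set.not_infinite.mp hfin
  have hB : {v : HeightOneSpectrum (𝓞 K) | ¬ ∀ α : Multiset ℂ, π.1.HasSatakeParamAt v α →
      r.HasFrobCharpolyAt v (arithFrobPolyOfSatake ι v.residueCard n α)}.Finite :=
    Filter.eventually_cofinite.mp hr
  set S : Set (HeightOneSpectrum (𝓞 K)) :=
    ({v | ¬ ∀ α : Multiset ℂ, π.1.HasSatakeParamAt v α →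
        r.HasFrobCharpolyAt v (arithFrobPolyOfSatake ι v.residueCard n α)} ∪
      {v | ¬ π.1.IsUnramifiedAt v}) ∪
      {v | ∃ β : Multiset ℂ, π.1.HasSatakeParamAt v β ∧ β.Nodup} with hS_def
  have hSfin : S.Finite := (hB.union π.1.hasSatakeParamAt_cofinite_holds).union hR
  -- the open set of elements with separable characteristic polynomial
  set f : absoluteGaloisGroup K → PadicAlgCl ℓ := fun g =>
    Polynomial.resultant ((r g : GL (Fin n) (PadicAlgCl ℓ)) : Matrix (Fin n) (Fin n) _).charpoly
      (derivative ((r g : GL (Fin n) (PadicAlgCl ℓ)) : Matrix (Fin n) (Fin n) _).charpoly)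
        n (n - 1) with hf_def
  have hf : Continuous f :=
    RegularDescent.continuous_resultant_charpoly.comp (Units.continuous_val.comp (map_continuous r))
  have hU : IsOpen (f ⁻¹' {0}ᶜ) := isOpen_compl_singleton.preimage hf
  have hg₀ : g₀ ∈ f ⁻¹' {0}ᶜ :=
    (RegularDescent.resultant_charpoly_ne_zero_iff _).mpr hsep
  -- a Frobenius at a place outside `S` in it
  have hD := absoluteGaloisGroup.frobenius_dense Automorphic.chebotarev_artinRep_holds K S hSfin
  obtain ⟨σ, hσU, v, hvS, 𝔓, h𝔓, hσ⟩ := hD.inter_open_nonempty _ hU ⟨g₀, hg₀⟩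
  simp only [hS_def, Set.mem_union, Set.mem_setOf_eq, not_or, not_not] at hvS
  obtain ⟨⟨hcomp, β, hβ⟩, hvR⟩ := hvS
  have hcp := hcomp β hβ 𝔓 h𝔓 σ hσ
  have hsepσ : (arithFrobPolyOfSatake ι v.residueCard n β).Separable := by
    rw [← hcp]
    exact (RegularDescent.resultant_charpoly_ne_zero_iff _).mp hσU
  have hnd := Polynomial.nodup_roots hsepσ
  rw [roots_arithFrobPolyOfSatake] at hnd
  exact hvR ⟨β, hβ, hnd.of_map _⟩

/-- **An HLTT-compatible `r` is compatible with `π` at all but finitely many places.**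
Harris–Lan–Taylor–Thorne's characterising property (`IsCompatible π ι r`: compatibility at every
`v ∣ q` for every rational prime `q ≠ ℓ` above which `π` is unramified) leaves out only the places
above `ℓ` and the places above the finitely many rational primes lying below a ramified place of
`π` (`AutomorphicRepData.isUnramifiedAbove_cofinite`, from Flath's theorem
`hasSatakeParamAt_cofinite_holds`); finitely many places lie above each rational prime
(`finite_setOf_natCast_mem_asIdeal_of_prime`). [cite: HarrisLanTaylorThorneRMS2016, Thm. A] -/
theorem eventually_isGaloisCompatibleAt_of_isCompatible {n : ℕ}
    {K : Type} [Field K] [NumberField K] {hcpt : isCompact_glFiniteIntegralLevel n K}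
    (π : CuspidalAutomorphicRepData n K hcpt) {ℓ : ℕ} [Fact ℓ.Prime] {ι : PadicAlgCl ℓ ≃+* ℂ}
    {r : FramedGaloisRep K (PadicAlgCl ℓ) n} (hc : HarrisLanTaylorThorne2016.IsCompatible π.1 ι r) :
    ∀ᶠ v in Filter.cofinite, IsGaloisCompatibleAt π.1 ι r v := by
  have hq := AutomorphicRepData.isUnramifiedAbove_cofinite π.1 π.1.hasSatakeParamAt_cofinite_holds
  rw [Filter.eventually_cofinite] at hq ⊢
  have hfin : ({v : HeightOneSpectrum (𝓞 K) | ((ℓ : ℕ) : 𝓞 K) ∈ v.asIdeal} ∪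
      ⋃ q ∈ {q : ℕ | ¬ (q.Prime → π.1.IsUnramifiedAbove q)},
        {v : HeightOneSpectrum (𝓞 K) | ((q : ℕ) : 𝓞 K) ∈ v.asIdeal}).Finite := by
    refine (finite_setOf_natCast_mem_asIdeal_of_prime K (Fact.out : ℓ.Prime)).union
      (hq.biUnion fun q hq' => ?_)
    simp only [Set.mem_setOf_eq, Classical.not_imp] at hq'
    exact finite_setOf_natCast_mem_asIdeal_of_prime K hq'.1
  refine hfin.subset fun v hv => ?_
  simp only [Set.mem_setOf_eq] at hv
  obtain ⟨q, hqp, hqv⟩ := exists_natPrime_natCast_mem v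
  by_cases hqℓ : q = ℓ
  · subst hqℓ
    exact Or.inl hqv
  by_cases hunr : π.1.IsUnramifiedAbove q
  · exact absurd (hc q hqp hqℓ hunr v hqv) hv
  · refine Or.inr (Set.mem_biUnion (x := q) ?_ hqv)
    simp only [Set.mem_setOf_eq, Classical.not_imp]
    exact ⟨hqp, hunr⟩

/-- **Regular places from one regular element of an HLTT-compatible representation**: if
`r : Γ_K → GL_n(ℚ̄_ℓ)` has Harris–Lan–Taylor–Thorne's characterising property for `(π, ι)`
(`IsCompatible`) and some `r(g₀)` has separable characteristic polynomial, then infinitely many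
places carry a Satake parameter of `π` without repetition
(`frequently_satakeParam_nodup_of_separable_charpoly_of_eventually` with
`eventually_isGaloisCompatibleAt_of_isCompatible`).  This is the form in which a Hodge–Tate /
Sen-theoretic input stated for HLTT-compatible `r` (the vocabulary of
`AHTW2026.deRham_hodgeTateRegular`) feeds the reduction of the fact.
[cite: BarnetlambEtAl2014, proof of Lemma 5.3.1 (3)] [cite: HarrisLanTaylorThorneRMS2016, Thm. A] -/
theorem frequently_satakeParam_nodup_of_isCompatible_of_separable_charpoly {n : ℕ}
    {K : Type} [Field K] [NumberField K] {hcpt : isCompact_glFiniteIntegralLevel n K}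
    (π : CuspidalAutomorphicRepData n K hcpt) {ℓ : ℕ} [Fact ℓ.Prime] (ι : PadicAlgCl ℓ ≃+* ℂ)
    (r : FramedGaloisRep K (PadicAlgCl ℓ) n) (hc : HarrisLanTaylorThorne2016.IsCompatible π.1 ι r)
    {g₀ : absoluteGaloisGroup K} (hsep : (FramedRep.charpoly r g₀).Separable) :
    ∃ᶠ v in Filter.cofinite, ∃ β : Multiset ℂ, π.1.HasSatakeParamAt v β ∧ β.Nodup :=
  frequently_satakeParam_nodup_of_separable_charpoly_of_eventually π ι r
    ((eventually_isGaloisCompatibleAt_of_isCompatible π hc).mono fun _v hv α hα => (hv α hα).2)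
    hsep

/-- **`BLGGT2014_polarized_compatibleSystem_rationalModels` from Fakhruddin–Pilloni's attached
representations, Clozel's Hecke field, and ONE regular element of ONE representation carrying
`π`'s Frobenius polynomials off a finite set** — the residue of a discharge with its last raw
input in the weakest form the density argument allows
(`frequently_satakeParam_nodup_of_separable_charpoly_of_eventually`): for every CM `K` and every
regular algebraic, norm-polarized cuspidal `π` of rank `n ≥ 2` there are `(ℓ, ι)`, a continuous
`r : Γ_K → GL_n(ℚ̄_ℓ)` whose Frobenius characteristic polynomials at all but finitely many
unramified places of `π` are the `arithFrobPolyOfSatake ι q_v n β`, and `g₀` with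
`charpoly r(g₀)` separable.  In print that element comes from the Hodge–Tate regularity of
`r_{l,ı}(π)` ([BLGGT, Thm. 2.1.1 (3)]) and Sen's theorem ([HT, VII.1.8]); neither is in the tree.
No new named fact (D-0026).
[cite: BarnetlambEtAl2014, Thm. 2.1.1, §5.1 and proof of Lemma 5.3.1 (3)]
[cite: FakhruddinPilloni2021, Thm. 9.10 and Thm. 9.1] [cite: Clozel1990, Thm. 3.13] -/
theorem BLGGT2014_polarized_compatibleSystem_rationalModels_of_normTwist_of_eventuallyCompatible_regularElement
    (h910 : FakhruddinPilloni2021_galoisRep_of_weaklyRegular_normTwist)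
    (hC : Clozel1990_heckeEigenvalueField)
    (hElt : ∀ (n : ℕ), 2 ≤ n → ∀ (K : Type) [Field K] [NumberField K] [IsCMField K]
      (hcpt : isCompact_glFiniteIntegralLevel n K) (π : CuspidalAutomorphicRepData n K hcpt),
        π.1.IsRegularAlgebraic →
        (∃ (χ : HeckeCharacter K) (m : ℤ),
            (∀ x : ideleGroup K, ((χ x : ℂˣ) : ℂ) = (ideleNorm x : ℂ) ^ (m : ℂ)) ∧
              π.1.IsEssConjSelfDual χ) →
          ∃ (ℓ : ℕ) (_ : Fact ℓ.Prime) (ι : PadicAlgCl ℓ ≃+* ℂ)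
            (r : FramedGaloisRep K (PadicAlgCl ℓ) n),
            (∀ᶠ v in Filter.cofinite, ∀ α : Multiset ℂ, π.1.HasSatakeParamAt v α →
              r.HasFrobCharpolyAt v (arithFrobPolyOfSatake ι v.residueCard n α)) ∧
            ∃ g₀ : absoluteGaloisGroup K, (FramedRep.charpoly r g₀).Separable) :
    BLGGT2014_polarized_compatibleSystem_rationalModels :=
  BLGGT2014_polarized_compatibleSystem_rationalModels_of_normTwist_of_regularPlaces h910 hC
    fun n hn K _ _ _ hcpt π hra hpol => by
      obtain ⟨ℓ, _, ι, r, hr, g₀, hsep⟩ := hElt n hn K hcpt π hra hpol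
      exact frequently_satakeParam_nodup_of_separable_charpoly_of_eventually π ι r hr hsep

/-- **`BLGGT2014_polarized_compatibleSystem_rationalModels` from Fakhruddin–Pilloni's attached
representations, Clozel's Hecke field, and ONE regular element of ONE HLTT-compatible
representation** — the same residue with the regular element taken in a representation having
Harris–Lan–Taylor–Thorne's characterising property `IsCompatible π ι r` (the vocabulary in which
the tree states `p`-adic Hodge-theoretic properties of `r_{ℓ,ι}(π)`, e.g.
`AHTW2026.deRham_hodgeTateRegular`): for every CM `K` and every regular algebraic, norm-polarized
cuspidal `π` of rank `n ≥ 2`, at SOME `(ℓ, ι)` SOME HLTT-compatible `r` takes a value with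
separable characteristic polynomial.  From it, infinitely many regular places
(`frequently_satakeParam_nodup_of_isCompatible_of_separable_charpoly`), then
`…_of_normTwist_of_regularPlaces`.  In print: Hodge–Tate regularity of `r_{l,ı}(π)`
([BLGGT, Thm. 2.1.1 (3)]) and Sen's theorem ([HT, VII.1.8]).  No new named fact (D-0026).
[cite: BarnetlambEtAl2014, Thm. 2.1.1, §5.1 and proof of Lemma 5.3.1 (3)]
[cite: FakhruddinPilloni2021, Thm. 9.10 and Thm. 9.1] [cite: Clozel1990, Thm. 3.13]
[cite: HarrisLanTaylorThorneRMS2016, Thm. A] -/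
theorem BLGGT2014_polarized_compatibleSystem_rationalModels_of_normTwist_of_isCompatible_regularElement
    (h910 : FakhruddinPilloni2021_galoisRep_of_weaklyRegular_normTwist)
    (hC : Clozel1990_heckeEigenvalueField)
    (hElt : ∀ (n : ℕ), 2 ≤ n → ∀ (K : Type) [Field K] [NumberField K] [IsCMField K]
      (hcpt : isCompact_glFiniteIntegralLevel n K) (π : CuspidalAutomorphicRepData n K hcpt),
        π.1.IsRegularAlgebraic →
        (∃ (χ : HeckeCharacter K) (m : ℤ),
            (∀ x : ideleGroup K, ((χ x : ℂˣ) : ℂ) = (ideleNorm x : ℂ) ^ (m : ℂ)) ∧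
              π.1.IsEssConjSelfDual χ) →
          ∃ (ℓ : ℕ) (_ : Fact ℓ.Prime) (ι : PadicAlgCl ℓ ≃+* ℂ)
            (r : FramedGaloisRep K (PadicAlgCl ℓ) n),
            HarrisLanTaylorThorne2016.IsCompatible π.1 ι r ∧
            ∃ g₀ : absoluteGaloisGroup K, (FramedRep.charpoly r g₀).Separable) :
    BLGGT2014_polarized_compatibleSystem_rationalModels :=
  BLGGT2014_polarized_compatibleSystem_rationalModels_of_normTwist_of_regularPlaces h910 hC
    fun n hn K _ _ _ hcpt π hra hpol => by
      obtain ⟨ℓ, _, ι, r, hc, g₀, hsep⟩ := hElt n hn K hcpt π hra hpol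
      exact frequently_satakeParam_nodup_of_isCompatible_of_separable_charpoly π ι r hc hsep

/-- **The attached representations of the reduction are HLTT-compatible**: a representation
attached to `(π, ι)` at every `v ∤ ℓ` carrying a Satake parameter (the attachment clause of the
fact, of lang.S27 and of Fakhruddin–Pilloni's rendering) has Harris–Lan–Taylor–Thorne's
characterising property (`HarrisLanTaylorThorne2016.isCompatible_of_forall_not_mem`).  So the
semisimple `r` of `exists_semisimple_attached_of_normTwist` is one to which statements about
"every semisimple HLTT-compatible `r`" (such as `AHTW2026.deRham_hodgeTateRegular`) apply.
[cite: HarrisLanTaylorThorneRMS2016, Thm. A] -/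
theorem isCompatible_of_attached {n : ℕ} {K : Type} [Field K] [NumberField K]
    {hcpt : isCompact_glFiniteIntegralLevel n K} (π : CuspidalAutomorphicRepData n K hcpt)
    {ℓ : ℕ} [Fact ℓ.Prime] {ι : PadicAlgCl ℓ ≃+* ℂ} {r : FramedGaloisRep K (PadicAlgCl ℓ) n}
    (hr : ∀ (v : HeightOneSpectrum (𝓞 K)) (α : Multiset ℂ), π.1.HasSatakeParamAt v α →
      ((ℓ : ℕ) : 𝓞 K) ∉ v.asIdeal →
        r.IsUnramifiedAt v ∧ r.HasFrobCharpolyAt v (arithFrobPolyOfSatake ι v.residueCard n α)) :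
    HarrisLanTaylorThorne2016.IsCompatible π.1 ι r :=
  HarrisLanTaylorThorne2016.isCompatible_of_forall_not_mem fun v hv α hα => hr v α hα hv

/-- **A semisimple HLTT-compatible representation for every regular algebraic, norm-polarized
cuspidal `π` over a CM field, `0 < n`, from Fakhruddin–Pilloni's Thm. 9.10**
(`exists_semisimple_attached_of_normTwist` with `isCompatible_of_attached`): the object about which
the tree's `p`-adic Hodge-theoretic facts for `r_{ℓ,ι}(π)` speak, available under the one named
fact `FakhruddinPilloni2021_galoisRep_of_weaklyRegular_normTwist`.
[cite: FakhruddinPilloni2021, Thm. 9.10 and Thm. 9.1] [cite: HarrisLanTaylorThorneRMS2016, Thm. A] -/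
theorem exists_semisimple_isCompatible_of_normTwist
    (h910 : FakhruddinPilloni2021_galoisRep_of_weaklyRegular_normTwist)
    {n : ℕ} (hn : 0 < n) {K : Type} [Field K] [NumberField K] [IsCMField K]
    {hcpt : isCompact_glFiniteIntegralLevel n K} (π : CuspidalAutomorphicRepData n K hcpt)
    (hra : π.1.IsRegularAlgebraic) {χ : HeckeCharacter K} {m : ℤ}
    (hχ : ∀ x : ideleGroup K, ((χ x : ℂˣ) : ℂ) = (ideleNorm x : ℂ) ^ (m : ℂ))
    (hsd : π.1.IsEssConjSelfDual χ) (ℓ : ℕ) [Fact ℓ.Prime] (ι : PadicAlgCl ℓ ≃+* ℂ) :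
    ∃ r : FramedGaloisRep K (PadicAlgCl ℓ) n, r.toGaloisRep.IsSemisimple ∧
      HarrisLanTaylorThorne2016.IsCompatible π.1 ι r ∧
      ∀ (v : HeightOneSpectrum (𝓞 K)) (α : Multiset ℂ), π.1.HasSatakeParamAt v α →
        ((ℓ : ℕ) : 𝓞 K) ∉ v.asIdeal →
          r.IsUnramifiedAt v ∧ r.HasFrobCharpolyAt v (arithFrobPolyOfSatake ι v.residueCard n α) := by
  obtain ⟨r, hss, hr⟩ := exists_semisimple_attached_of_normTwist h910 hn π hra hχ hsd ℓ ι
  exact ⟨r, hss, isCompatible_of_attached π hr, hr⟩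

/-- **The residue in its final operative form.**  A discharge of
`BLGGT2014_polarized_compatibleSystem_rationalModels` follows from the two existing named facts
`FakhruddinPilloni2021_galoisRep_of_weaklyRegular_normTwist`, `Clozel1990_heckeEigenvalueField`
and ONE statement about semisimple HLTT-compatible representations of polarized regular
algebraic `π` of rank `≥ 2` over CM fields: EVERY such `r` (at every `(ℓ, ι)`) takes a value with
separable characteristic polynomial (`hSen` — in print, [BLGGT, Thm. 2.1.1 (3)]: `r` is Hodge–Tate
regular, and Sen's theorem [HT, VII.1.8]: the Lie algebra of the image then contains a regular
semisimple element, hence so does the image).  The representation fed to `hSen` is Fakhruddin–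
Pilloni's, semisimplified (`exists_semisimple_isCompatible_of_normTwist`, at `ℓ = 2`, any `ι`);
then `…_of_normTwist_of_regularElement`.  No new named fact (D-0026).
[cite: BarnetlambEtAl2014, Thm. 2.1.1 (3) and proof of Lemma 5.3.1 (3)]
[cite: FakhruddinPilloni2021, Thm. 9.10 and Thm. 9.1] [cite: Clozel1990, Thm. 3.13] -/
theorem BLGGT2014_polarized_compatibleSystem_rationalModels_of_normTwist_of_forall_isCompatible
    (h910 : FakhruddinPilloni2021_galoisRep_of_weaklyRegular_normTwist)
    (hC : Clozel1990_heckeEigenvalueField)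
    (hSen : ∀ (n : ℕ), 2 ≤ n → ∀ (K : Type) [Field K] [NumberField K] [IsCMField K]
      (hcpt : isCompact_glFiniteIntegralLevel n K) (π : CuspidalAutomorphicRepData n K hcpt),
        π.1.IsRegularAlgebraic →
        (∃ (χ : HeckeCharacter K) (m : ℤ),
            (∀ x : ideleGroup K, ((χ x : ℂˣ) : ℂ) = (ideleNorm x : ℂ) ^ (m : ℂ)) ∧
              π.1.IsEssConjSelfDual χ) →
          ∀ (ℓ : ℕ) [Fact ℓ.Prime] (ι : PadicAlgCl ℓ ≃+* ℂ) (r : FramedGaloisRep K (PadicAlgCl ℓ) n),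
            r.toGaloisRep.IsSemisimple → HarrisLanTaylorThorne2016.IsCompatible π.1 ι r →
              ∃ g₀ : absoluteGaloisGroup K, (FramedRep.charpoly r g₀).Separable) :
    BLGGT2014_polarized_compatibleSystem_rationalModels := by
  refine BLGGT2014_polarized_compatibleSystem_rationalModels_of_normTwist_of_regularElement h910 hC
    fun n hn K _ _ _ hcpt π hra hpol => ?_
  obtain ⟨χ, m, hχ, hsd⟩ := hpol
  haveI : Fact (Nat.Prime 2) := ⟨Nat.prime_two⟩
  obtain ⟨ι⟩ := PadicAlgCl.nonempty_ringEquiv_complex 2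
  obtain ⟨r, hss, hc, hr⟩ :=
    exists_semisimple_isCompatible_of_normTwist h910 (by omega) π hra hχ hsd 2 ι
  obtain ⟨g₀, hsep⟩ := hSen n hn K hcpt π hra ⟨χ, m, hχ, hsd⟩ 2 ι r hss hc
  exact ⟨2, inferInstance, ι, r, hr, g₀, hsep⟩

/-! ### Rank `2` without Sen theory (appended 2026-08-17, fourth pass)

In rank `2` the `p`-adic Hodge-theoretic input of [BLGGT]'s proof of Lemma 5.3.1 (3) (a value
of `r_λ` with distinct eigenvalues, from Hodge–Tate regularity and Sen's theorem) can be BYPASSED: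
a semisimple `r : Γ_K → GL₂(ℚ̄_ℓ)` either takes a value with separable characteristic polynomial —
and then `π` has infinitely many regular places (`frequently_satakeParam_nodup_of_separable_charpoly`)
and the assembly applies — or EVERY `r(g)` is a scalar matrix (`2 × 2` linear algebra:
`RegularDescent.forall_eq_smul_one_of_sub_sq_eq_zero`), in which case `r(g) = (tr r(g) / 2) · 1`
already has its entries in `E_λ` for Clozel's Hecke field `E` ("`tr r ∈ E_λ`" by Frobenius
density).  So the rank-`2` slice of the fact follows from the two existing named facts
`FakhruddinPilloni2021_galoisRep_of_weaklyRegular_normTwist` and `Clozel1990_heckeEigenvalueField`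
alone (`…_rank_two_of_normTwist`), and the operative residue `hSen` of
`…_of_normTwist_of_forall_isCompatible` is only needed in ranks `n ≥ 3`
(`…_of_normTwist_of_forall_isCompatible_three_le`).  A deviation from the printed proof (which
treats all ranks uniformly through Sen theory), recorded as such; no new named fact (D-0026).
-/

namespace RegularDescent

section TwoByTwo

open scoped _root_.Matrix

variable {k : Type*} [Field k] {G : Type*} [Group G]

/-! #### `2 × 2` linear algebra: square-zero matrices, the `k`-trick, the stable line -/

/-- A `2 × 2` matrix with `N² = 0` has `det N = 0`. [folklore] -/
theorem det_eq_zero_of_mul_self_eq_zero {N : Matrix (Fin 2) (Fin 2) k} (h : N * N = 0) :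
    N.det = 0 := by
  have h1 := congrArg Matrix.det h
  rwa [Matrix.det_mul, Matrix.det_zero, mul_self_eq_zero] at h1

/-- A `2 × 2` matrix with `N² = 0` has `tr N = 0` (`(tr N)² = tr (N²) + 2 det N`). [folklore] -/
theorem trace_eq_zero_of_mul_self_eq_zero {N : Matrix (Fin 2) (Fin 2) k} (h : N * N = 0) :
    N.trace = 0 := by
  have hd := det_eq_zero_of_mul_self_eq_zero h
  rw [Matrix.det_fin_two] at hd
  have h00 := congrFun (congrFun h 0) 0
  have h11 := congrFun (congrFun h 1) 1
  simp only [Matrix.mul_apply, Fin.sum_univ_two, Matrix.zero_apply] at h00 h11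
  rw [Matrix.trace_fin_two]
  have hsq : (N 0 0 + N 1 1) ^ 2 = 0 := by linear_combination h00 + h11 + 2 * hd
  exact pow_eq_zero_iff (n := 2) (by norm_num) |>.mp hsq

/-- For a `2 × 2` matrix `N` of determinant `0` (rank `≤ 1`): `N X N = tr(N X) · N`. [folklore] -/
theorem mul_mul_self_eq_trace_smul {N : Matrix (Fin 2) (Fin 2) k} (hd : N.det = 0)
    (X : Matrix (Fin 2) (Fin 2) k) : N * X * N = (N * X).trace • N := by
  rw [Matrix.det_fin_two] at hd
  ext i j
  rw [Matrix.trace_fin_two]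
  fin_cases i <;> fin_cases j <;>
    simp only [Matrix.mul_apply, Fin.sum_univ_two, Matrix.smul_apply, smul_eq_mul, Fin.zero_eta,
      Fin.mk_one, Fin.isValue]
  · linear_combination (-(X 1 1)) * hd
  · linear_combination (X 0 1) * hd
  · linear_combination (X 1 0) * hd
  · linear_combination (-(X 0 0)) * hd

/-- If `(A - c)² = 0` for a `2 × 2` matrix `A`, then `tr A = 2c` and `det A = c²`. [folklore] -/
theorem trace_and_det_of_sub_sq_eq_zero {A : Matrix (Fin 2) (Fin 2) k} {c : k}
    (h : (A - c • (1 : Matrix (Fin 2) (Fin 2) k)) * (A - c • 1) = 0) :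
    A.trace = 2 * c ∧ A.det = c ^ 2 := by
  have ht := trace_eq_zero_of_mul_self_eq_zero h
  have hd := det_eq_zero_of_mul_self_eq_zero h
  have hA : A = (A - c • 1) + c • (1 : Matrix (Fin 2) (Fin 2) k) := by abel
  constructor
  · rw [hA, Matrix.trace_add, ht, Matrix.trace_smul, Matrix.trace_one, Fintype.card_fin]
    simp [mul_comm]
  · rw [Matrix.det_fin_two] at hd ⊢
    rw [Matrix.trace_fin_two] at ht
    simp only [Matrix.sub_apply, Matrix.smul_apply, Matrix.one_apply_eq, Matrix.one_apply_ne,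
      ne_eq, zero_ne_one, one_ne_zero, not_false_eq_true, smul_eq_mul, mul_one, mul_zero,
      sub_zero] at hd ht
    linear_combination hd + c * ht

/-- If `(A - c)² = 0` for a `2 × 2` matrix `A`, its discriminant vanishes: `(tr A)² = 4 det A`.
[folklore] -/
theorem trace_sq_eq_four_mul_det_of_sub_sq_eq_zero {A : Matrix (Fin 2) (Fin 2) k} {c : k}
    (h : (A - c • (1 : Matrix (Fin 2) (Fin 2) k)) * (A - c • 1) = 0) :
    A.trace ^ 2 = 4 * A.det := by
  obtain ⟨ht, hd⟩ := trace_and_det_of_sub_sq_eq_zero h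
  rw [ht, hd]
  ring

/-- **The `k`-trick.**  Let `M = c + N` with `N² = 0`, `c ≠ 0` (`2 ≠ 0` in `k`), and let `H` be
a `2 × 2` matrix such that `M H`, `M² H` and `M³ H` all have vanishing discriminant.  Then
`tr (N H) = 0`: indeed `Mᵏ = cᵏ + k cᵏ⁻¹ N`, `det (Mᵏ H) = c²ᵏ det H`, so
`(c tr H + k tr (N H))² = 4 c² det H` for `k = 1, 2, 3`, whence `2 (tr (N H))² = 0`. [folklore] -/
theorem trace_mul_eq_zero_of_disc (h2 : (2 : k) ≠ 0) {M H : Matrix (Fin 2) (Fin 2) k} {c : k}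
    (hM : (M - c • (1 : Matrix (Fin 2) (Fin 2) k)) * (M - c • 1) = 0) (hc : c ≠ 0)
    (h1 : (M * H).trace ^ 2 = 4 * (M * H).det)
    (h2' : (M * M * H).trace ^ 2 = 4 * (M * M * H).det)
    (h3 : (M * M * M * H).trace ^ 2 = 4 * (M * M * M * H).det) :
    ((M - c • 1) * H).trace = 0 := by
  set N : Matrix (Fin 2) (Fin 2) k := M - c • 1 with hN_def
  have hMN : M = c • (1 : Matrix (Fin 2) (Fin 2) k) + N := by rw [hN_def]; abel
  have hNN : N * N = 0 := hM
  have hdM : M.det = c ^ 2 := (trace_and_det_of_sub_sq_eq_zero hM).2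
  have hM2 : M * M = c ^ 2 • (1 : Matrix (Fin 2) (Fin 2) k) + (2 * c) • N := by
    rw [hMN]
    simp only [add_mul, mul_add, smul_mul_assoc, mul_smul_comm, one_mul, mul_one, hNN,
      smul_add, add_zero]
    module
  have hM3 : M * M * M = c ^ 3 • (1 : Matrix (Fin 2) (Fin 2) k) + (3 * c ^ 2) • N := by
    rw [hM2, hMN]
    simp only [add_mul, mul_add, smul_mul_assoc, mul_smul_comm, one_mul, mul_one, hNN,
      smul_add]
    module
  -- traces and determinants of `Mᵏ H`
  have htr : ∀ x y : k, ((x • (1 : Matrix (Fin 2) (Fin 2) k) + y • N) * H).trace =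
      x * H.trace + y * (N * H).trace := fun x y => by
    rw [add_mul, smul_mul_assoc, smul_mul_assoc, one_mul, Matrix.trace_add, Matrix.trace_smul,
      Matrix.trace_smul, smul_eq_mul, smul_eq_mul]
  have e1 : (M * H).trace = c * H.trace + 1 * (N * H).trace := by
    rw [← htr, one_smul, ← hMN]
  have e2 : (M * M * H).trace = c ^ 2 * H.trace + (2 * c) * (N * H).trace := by rw [hM2, htr]
  have e3 : (M * M * M * H).trace = c ^ 3 * H.trace + (3 * c ^ 2) * (N * H).trace := by
    rw [hM3, htr]
  have d1 : (M * H).det = c ^ 2 * H.det := by rw [Matrix.det_mul, hdM]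
  have d2 : (M * M * H).det = c ^ 4 * H.det := by
    rw [Matrix.det_mul, Matrix.det_mul, hdM]; ring
  have d3 : (M * M * M * H).det = c ^ 6 * H.det := by
    rw [Matrix.det_mul, Matrix.det_mul, Matrix.det_mul, hdM]; ring
  rw [e1, d1] at h1
  rw [e2, d2] at h2'
  rw [e3, d3] at h3
  have hb : 2 * c ^ 4 * (N * H).trace ^ 2 = 0 := by
    linear_combination c ^ 4 * h1 - 2 * c ^ 2 * h2' + h3
  have hc4 : 2 * c ^ 4 ≠ 0 := mul_ne_zero h2 (pow_ne_zero _ hc)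
  exact pow_eq_zero_iff (n := 2) (by norm_num) |>.mp
    ((mul_eq_zero.mp hb).resolve_left hc4)

/-- For a non-zero `2 × 2` matrix `N` with `N² = 0`, the line `ker N (= im N)` is stable under
every `H` with `N H N = 0`. [folklore] -/
theorem mulVec_mem_ker_toLin' {N : Matrix (Fin 2) (Fin 2) k} (hN0 : N ≠ 0) (hNN : N * N = 0)
    {H : Matrix (Fin 2) (Fin 2) k} (hH : N * H * N = 0) {v : Fin 2 → k}
    (hv : v ∈ LinearMap.ker (Matrix.toLin' N)) :
    H *ᵥ v ∈ LinearMap.ker (Matrix.toLin' N) := by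
  -- `im N ≤ ker N`, both of dimension `1`, hence equal
  have hle : LinearMap.range (Matrix.toLin' N) ≤ LinearMap.ker (Matrix.toLin' N) := by
    rintro _ ⟨w, rfl⟩
    rw [LinearMap.mem_ker, ← LinearMap.comp_apply, ← Matrix.toLin'_mul, hNN, map_zero,
      LinearMap.zero_apply]
  have hsum := LinearMap.finrank_range_add_finrank_ker (Matrix.toLin' N)
  rw [finrank_fin_fun] at hsum
  have hr0 : LinearMap.range (Matrix.toLin' N) ≠ ⊥ := by
    rw [Ne, LinearMap.range_eq_bot]
    exact fun h => hN0 (Matrix.toLin'.injective (by rw [h, map_zero]))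
  have hrpos : 0 < finrank k (LinearMap.range (Matrix.toLin' N)) :=
    Nat.pos_of_ne_zero fun h => hr0 (Submodule.finrank_eq_zero.mp h)
  have hmono := Submodule.finrank_mono hle
  have heq : LinearMap.range (Matrix.toLin' N) = LinearMap.ker (Matrix.toLin' N) :=
    Submodule.eq_of_le_of_finrank_eq hle (by omega)
  rw [← heq] at hv
  obtain ⟨w, rfl⟩ := hv
  rw [LinearMap.mem_ker, Matrix.toLin'_apply, Matrix.toLin'_apply, Matrix.mulVec_mulVec,
    Matrix.mulVec_mulVec, hH, Matrix.zero_mulVec]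

/-- **A semisimple representation on `k²` all of whose values are "scalar plus square-zero" is
scalar** (`2 ≠ 0` in `k`).  If `φ : G → GL₂(k)` has semisimple associated representation on `k²`
and for every `g` there is `c` with `(φ(g) - c)² = 0` (over an algebraically closed field: no
`φ(g)` has two distinct eigenvalues), then every `φ(g)` is the scalar `c`.  Proof: a `G`-stable
line `W` has a `G`-stable complement `W'`, and `φ(g) - c`, square-zero and preserving the lines
`W`, `W'`, kills both; if there is no `G`-stable line and some `N = φ(g) - c ≠ 0`, the `k`-trick
(`trace_mul_eq_zero_of_disc`) gives `tr (N φ(h)) = 0`, so `N φ(h) N = 0` for all `h` and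
`ker N` is a `G`-stable line — a contradiction.  (For IRREDUCIBLE `φ` this is the folklore "an
irreducible subgroup of `GL₂` contains an element with distinct eigenvalues".) [folklore] -/
theorem forall_eq_smul_one_of_sub_sq_eq_zero (h2 : (2 : k) ≠ 0) (φ : G →* GL (Fin 2) k)
    (ρ : Representation k G (Fin 2 → k))
    (hρ : ∀ g v, ρ g v = ((φ g : GL (Fin 2) k) : Matrix (Fin 2) (Fin 2) k) *ᵥ v)
    [ρ.IsSemisimpleRepresentation]
    (hN : ∀ g, ∃ c : k, (((φ g : GL (Fin 2) k) : Matrix (Fin 2) (Fin 2) k) - c • 1) *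
        (((φ g : GL (Fin 2) k) : Matrix (Fin 2) (Fin 2) k) - c • 1) = 0) :
    ∀ g, ∃ c : k, ((φ g : GL (Fin 2) k) : Matrix (Fin 2) (Fin 2) k) = c • 1 := by
  classical
  set M : G → Matrix (Fin 2) (Fin 2) k := fun g => ((φ g : GL (Fin 2) k) : Matrix (Fin 2) (Fin 2) k)
    with hM_def
  have hMmul : ∀ g h, M (g * h) = M g * M h := fun g h => by simp [hM_def, map_mul]
  have hρ' : ∀ g v, ρ g v = M g *ᵥ v := hρ
  -- the square-zero part of `ρ g` preserves every subrepresentation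
  have hpres : ∀ (U : Subrepresentation ρ) (g : G) (c : k), ∀ x ∈ U.toSubmodule,
      (M g - c • 1) *ᵥ x ∈ U.toSubmodule := fun U g c x hx => by
    rw [Matrix.sub_mulVec, Matrix.smul_mulVec, Matrix.one_mulVec, ← hρ']
    exact U.toSubmodule.sub_mem (U.apply_mem_toSubmodule g hx) (U.toSubmodule.smul_mem c hx)
  -- ... and kills every stable LINE
  have hkill : ∀ (U : Subrepresentation ρ), finrank k U.toSubmodule = 1 → ∀ (g : G) (c : k),
      (M g - c • 1) * (M g - c • 1) = 0 → ∀ u ∈ U.toSubmodule, (M g - c • 1) *ᵥ u = 0 := by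
    intro U hU g c hc u hu
    obtain ⟨w, hw0, hw⟩ := finrank_eq_one_iff'.mp hU
    have hw0' : (w : Fin 2 → k) ≠ 0 := fun h => hw0 (Subtype.ext h)
    obtain ⟨a, ha⟩ := hw ⟨_, hpres U g c w w.2⟩
    have ha' : (M g - c • 1) *ᵥ (w : Fin 2 → k) = a • (w : Fin 2 → k) := by
      have h := congrArg Subtype.val ha
      simpa using h.symm
    have hff : (M g - c • 1) *ᵥ ((M g - c • 1) *ᵥ (w : Fin 2 → k)) = 0 := by
      rw [Matrix.mulVec_mulVec, hc, Matrix.zero_mulVec]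
    rw [ha', Matrix.mulVec_smul, ha', smul_smul] at hff
    have ha0 : a = 0 := by
      rcases smul_eq_zero.mp hff with h | h
      · exact mul_self_eq_zero.mp h
      · exact absurd h hw0'
    obtain ⟨a', ha''⟩ := hw ⟨u, hu⟩
    have hu' : u = a' • (w : Fin 2 → k) := by
      have h := congrArg Subtype.val ha''
      simpa using h.symm
    rw [hu', Matrix.mulVec_smul, ha', ha0, zero_smul, smul_zero]
  -- Claim: a proper non-zero subrepresentation forces every `φ g` to be scalar
  have key : ∀ W : Subrepresentation ρ, W ≠ ⊥ → W ≠ ⊤ →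
      ∀ g, ∃ c : k, M g = c • 1 := by
    intro W hb ht g
    obtain ⟨c, hc⟩ := hN g
    refine ⟨c, ?_⟩
    obtain ⟨W', hW'⟩ := exists_isCompl W
    have hcW : IsCompl W.toSubmodule W'.toSubmodule :=
      Literature.RepresentationTheory.Semisimple.Subrepresentation.isCompl_iff.mp hW'
    have hb' : W.toSubmodule ≠ ⊥ := fun h => hb (Subrepresentation.toSubmodule_injective h)
    have ht' : W.toSubmodule ≠ ⊤ := fun h => ht (Subrepresentation.toSubmodule_injective h)
    have hW1 : finrank k W.toSubmodule = 1 :=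
      Literature.RepresentationTheory.Semisimple.finrank_eq_one_of_ne_bot_of_ne_top hb' ht'
    have hW'1 : finrank k W'.toSubmodule = 1 := by
      have h := Submodule.finrank_add_eq_of_isCompl hcW
      rw [finrank_fin_fun, hW1] at h
      omega
    have hzero : ∀ v, (M g - c • 1) *ᵥ v = 0 := by
      intro v
      have hv : v ∈ W.toSubmodule ⊔ W'.toSubmodule := by
        rw [hcW.sup_eq_top]; exact Submodule.mem_top
      obtain ⟨w, hw, w', hw', rfl⟩ := Submodule.mem_sup.mp hv
      rw [Matrix.mulVec_add, hkill W hW1 g c hc w hw, hkill W' hW'1 g c hc w' hw', add_zero]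
    have h0 : M g - c • 1 = 0 := by
      ext i j
      have h := congrFun (hzero (Pi.single j 1)) i
      rwa [Matrix.mulVec_single_one, Pi.zero_apply] at h
    exact sub_eq_zero.mp h0
  by_cases hW : ∃ W : Subrepresentation ρ, W ≠ ⊥ ∧ W ≠ ⊤
  · obtain ⟨W, hb, ht⟩ := hW
    exact key W hb ht
  · push Not at hW
    intro g
    obtain ⟨c, hc⟩ := hN g
    refine ⟨c, ?_⟩
    by_contra hne
    set N : Matrix (Fin 2) (Fin 2) k := M g - c • 1 with hN_def
    have hN0 : N ≠ 0 := fun h => hne (sub_eq_zero.mp h)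
    have hc0 : c ≠ 0 := by
      rintro rfl
      have hd := det_eq_zero_of_mul_self_eq_zero hc
      rw [hN_def, zero_smul, sub_zero] at hd
      change ((φ g : GL (Fin 2) k) : Matrix (Fin 2) (Fin 2) k).det = 0 at hd
      rw [← Matrix.GeneralLinearGroup.val_det_apply] at hd
      exact Units.ne_zero _ hd
    -- every value has vanishing discriminant
    have hdisc : ∀ x, (M x).trace ^ 2 = 4 * (M x).det := fun x => by
      obtain ⟨c', hc'⟩ := hN x
      exact trace_sq_eq_four_mul_det_of_sub_sq_eq_zero hc'
    -- the `k`-trick: `tr (N φ(h)) = 0`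
    have htr : ∀ h, (N * M h).trace = 0 := fun h => by
      refine trace_mul_eq_zero_of_disc h2 hc hc0 ?_ ?_ ?_
      · rw [← hMmul]; exact hdisc _
      · rw [← hMmul, ← hMmul]; exact hdisc _
      · rw [← hMmul, ← hMmul, ← hMmul]; exact hdisc _
    have hNHN : ∀ h, N * M h * N = 0 := fun h => by
      rw [mul_mul_self_eq_trace_smul (det_eq_zero_of_mul_self_eq_zero hc), htr, zero_smul]
    -- the `G`-stable line `ker N`
    let W : Subrepresentation ρ :=
      ⟨LinearMap.ker (Matrix.toLin' N), fun h v hv => by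
        rw [hρ']
        exact mulVec_mem_ker_toLin' hN0 hc (hNHN h) hv⟩
    have hWb : W ≠ ⊥ := by
      intro h
      have h' : LinearMap.ker (Matrix.toLin' N) = ⊥ := congrArg Subrepresentation.toSubmodule h
      obtain ⟨i, j, hij⟩ : ∃ i j, N i j ≠ 0 := by
        by_contra hall
        push Not at hall
        exact hN0 (Matrix.ext fun i j => by rw [hall i j]; rfl)
      have hmem : N *ᵥ Pi.single j 1 ∈ LinearMap.ker (Matrix.toLin' N) := by
        rw [LinearMap.mem_ker, Matrix.toLin'_apply, Matrix.mulVec_mulVec, hc, Matrix.zero_mulVec]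
      rw [h', Submodule.mem_bot] at hmem
      exact hij (by have := congrFun hmem i; rwa [Matrix.mulVec_single_one] at this)
    have hWt : W ≠ ⊤ := by
      intro h
      have h' : LinearMap.ker (Matrix.toLin' N) = ⊤ := congrArg Subrepresentation.toSubmodule h
      exact hN0 (Matrix.toLin'.injective (by rw [map_zero]; exact LinearMap.ker_eq_top.mp h'))
    exact hWt (hW W hWb)

/-- Over an algebraically closed field, a `2 × 2` matrix whose characteristic polynomial is NOT
separable — i.e. has a double root `c`, `charpoly A = (X - c)²` — satisfies `(A - c)² = 0`
(Cayley–Hamilton). [folklore] -/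
theorem exists_sub_sq_eq_zero_of_not_separable [IsAlgClosed k] (A : Matrix (Fin 2) (Fin 2) k)
    (h : ¬ A.charpoly.Separable) :
    ∃ c : k, (A - c • (1 : Matrix (Fin 2) (Fin 2) k)) * (A - c • 1) = 0 := by
  have hsplit := IsAlgClosed.splits A.charpoly
  have hmonic := A.charpoly_monic
  have hprod := hsplit.eq_prod_roots_of_monic hmonic
  have hcard : Multiset.card A.charpoly.roots = 2 := by
    rw [← hsplit.natDegree_eq_card_roots, Matrix.charpoly_natDegree_eq_dim, Fintype.card_fin]
  obtain ⟨x, y, hxy⟩ := Multiset.card_eq_two.mp hcard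
  have hnd : ¬ A.charpoly.roots.Nodup := fun hnd =>
    h ((Polynomial.nodup_roots_iff_of_splits hmonic.ne_zero hsplit).mp hnd)
  have hxy' : x = y := by
    by_contra hne
    rw [hxy] at hnd
    exact hnd (by simp [hne])
  subst hxy'
  refine ⟨x, ?_⟩
  have hcp : A.charpoly = (X - C x) ^ 2 := by
    rw [hprod, hxy]
    simp [sq]
  have hCH := Matrix.aeval_self_charpoly A
  rw [hcp, map_pow, map_sub, Polynomial.aeval_X, Polynomial.aeval_C, sq] at hCH
  rwa [Algebra.algebraMap_eq_smul_one] at hCH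

end TwoByTwo

end RegularDescent

/-! #### Traces of an attached representation lie in `E_λ` for Clozel's field `E` -/

/-- **"`tr r ∈ E_λ`"**: if `r` is attached to `(π, ι)` at the finite `v ∤ ℓ` where `π` has a
Satake parameter, and the Hecke eigenvalues of `π` off a finite set of places lie in the subfield
`E₀ ⊂ ℂ` (Clozel), then every `tr r(g)` lies in the closure `E_λ` of `ι⁻¹(E₀)` in `ℚ̄_ℓ`: at a
good Frobenius the trace is `Σᵢ (q_v^{(n-1)/2} βᵢ)⁻¹ = e_{n-1}/e_n` of the scaled parameters, an
element of `ι⁻¹(E₀)` by the Satake–Tamagawa dictionary, and Frobenius elements are dense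
(`RegularDescent.trace_apply_mem_of_frobenius`).  (The computation inside
`exists_rationalModel_of_attached_of_frequently_nodup`, isolated.)
[cite: BarnetlambEtAl2014, proof of Lemma 5.3.1 (3)] [cite: Clozel1990, Thm. 3.13] -/
theorem trace_apply_mem_closure_of_attached {n : ℕ} (hn0 : 0 < n)
    {K : Type} [Field K] [NumberField K] {hcpt : isCompact_glFiniteIntegralLevel n K}
    (π : CuspidalAutomorphicRepData n K hcpt) {E₀ : Subfield ℂ}
    (hE₀ : ∀ᶠ v : HeightOneSpectrum (𝓞 K) in Filter.cofinite, ∀ α : Multiset ℂ,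
      π.1.HasSatakeParamAt v α → ∀ i ≤ n, heckeEigenvalueOf n v α i ∈ E₀)
    {ℓ : ℕ} [Fact ℓ.Prime] (ι : PadicAlgCl ℓ ≃+* ℂ) (r : FramedGaloisRep K (PadicAlgCl ℓ) n)
    (hr : ∀ (v : HeightOneSpectrum (𝓞 K)) (α : Multiset ℂ), π.1.HasSatakeParamAt v α →
      ((ℓ : ℕ) : 𝓞 K) ∉ v.asIdeal →
        r.IsUnramifiedAt v ∧ r.HasFrobCharpolyAt v (arithFrobPolyOfSatake ι v.residueCard n α))
    (g : absoluteGaloisGroup K) :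
    ((r g : GL (Fin n) (PadicAlgCl ℓ)) : Matrix (Fin n) (Fin n) (PadicAlgCl ℓ)).trace ∈
      (E₀.map (ι.symm : ℂ ≃+* PadicAlgCl ℓ).toRingHom).topologicalClosure := by
  classical
  -- scaling factors `c v = (√q_v)^{n-1}`
  set c : HeightOneSpectrum (𝓞 K) → ℂ := fun v =>
    (((Real.sqrt (v.residueCard : ℝ)) : ℝ) : ℂ) ^ (n - 1) with hc_def
  have hsqrt : ∀ v : HeightOneSpectrum (𝓞 K), (((Real.sqrt (v.residueCard : ℝ)) : ℝ) : ℂ) ≠ 0 :=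
    fun v => by
      rw [Ne, Complex.ofReal_eq_zero, Real.sqrt_eq_zero (Nat.cast_nonneg _), Nat.cast_eq_zero]
      exact (zero_lt_one.trans v.one_lt_residueCard).ne'
  set B : Set (HeightOneSpectrum (𝓞 K)) :=
    {v | ¬ ∀ α : Multiset ℂ, π.1.HasSatakeParamAt v α → ∀ i ≤ n, heckeEigenvalueOf n v α i ∈ E₀}
    with hB_def
  have hB : B.Finite := hE₀
  have hgood : ∀ {v : HeightOneSpectrum (𝓞 K)} {x : Fin n → ℂ}, v ∉ B →
      π.1.HasSatakeParamAt v ((Finset.univ : Finset (Fin n)).val.map x) →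
        ∀ j ≤ n, heckeEigenvalueOf n v ((Finset.univ : Finset (Fin n)).val.map x) j ∈ E₀ := by
    intro v x hvB hx j hj
    simp only [hB_def, Set.mem_setOf_eq, not_not] at hvB
    exact hvB _ hx j hj
  set LE : Subfield (PadicAlgCl ℓ) :=
    (E₀.map (ι.symm : ℂ ≃+* PadicAlgCl ℓ).toRingHom).topologicalClosure with hLE_def
  have hmemLE : ∀ z ∈ E₀, (ι.symm : ℂ ≃+* PadicAlgCl ℓ) z ∈ LE := fun z hz =>
    Subfield.le_topologicalClosure _ (Subfield.mem_map.mpr ⟨z, hz, rfl⟩)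
  -- Frobenius data at a good place
  have hfrob : ∀ {v : HeightOneSpectrum (𝓞 K)} {x : Fin n → ℂ},
      π.1.HasSatakeParamAt v ((Finset.univ : Finset (Fin n)).val.map x) →
      ((ℓ : ℕ) : 𝓞 K) ∉ v.asIdeal → ∀ 𝔓 ∈ v.primesAbove, ∀ σ : absoluteGaloisGroup K,
        IsArithFrobAt (𝓞 K) σ 𝔓 →
          ((r σ : GL (Fin n) (PadicAlgCl ℓ)) : Matrix (Fin n) (Fin n) (PadicAlgCl ℓ)).charpoly =
              ∏ i, (X - C ((ι.symm : ℂ ≃+* PadicAlgCl ℓ) (c v * x i)⁻¹)) ∧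
            ∀ i, x i ≠ 0 := by
    intro v x hx hℓv 𝔓 h𝔓 σ hσ
    have hcp : ((r σ : GL (Fin n) (PadicAlgCl ℓ)) : Matrix (Fin n) (Fin n) (PadicAlgCl ℓ)).charpoly =
        ∏ i, (X - C ((ι.symm : ℂ ≃+* PadicAlgCl ℓ) (c v * x i)⁻¹)) := by
      have h := (hr v _ hx hℓv).2 𝔓 h𝔓 σ hσ
      rw [FramedRep.charpoly, arithFrobPolyOfSatake] at h
      rw [h, ← RegularDescent.prod_X_sub_C_eq_multiset x
        (fun a => (ι.symm : ℂ ≃+* PadicAlgCl ℓ) ((((Real.sqrt (v.residueCard : ℝ)) : ℝ) : ℂ) ^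
          (n - 1) * a)⁻¹)]
    refine ⟨hcp, fun i hi => ?_⟩
    have hdet := RegularDescent.det_eq_prod_of_charpoly_eq _ _ hcp
    have hne : ((r σ : GL (Fin n) (PadicAlgCl ℓ)) : Matrix (Fin n) (Fin n) (PadicAlgCl ℓ)).det ≠ 0 := by
      rw [← Matrix.GeneralLinearGroup.val_det_apply]
      exact Units.ne_zero _
    rw [hdet] at hne
    exact hne (Finset.prod_eq_zero (Finset.mem_univ i) (by rw [hi, mul_zero, inv_zero, map_zero]))
  -- Frobenius density
  set S : Set (HeightOneSpectrum (𝓞 K)) :=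
    ({v | ((ℓ : ℕ) : 𝓞 K) ∈ v.asIdeal} ∪ {v | ¬ π.1.IsUnramifiedAt v}) ∪ B with hS_def
  have hSfin : S.Finite :=
    ((finite_setOf_natCast_mem_asIdeal_of_prime K (Fact.out : ℓ.Prime)).union
      π.1.hasSatakeParamAt_cofinite_holds).union hB
  refine RegularDescent.trace_apply_mem_of_frobenius r S hSfin
    (Subfield.isClosed_topologicalClosure _) (fun v hvS 𝔓 h𝔓 σ hσ => ?_) g
  simp only [hS_def, Set.mem_union, Set.mem_setOf_eq, not_or, not_not] at hvS
  obtain ⟨⟨hℓv, β, hβ⟩, hvB⟩ := hvS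
  obtain ⟨x, rfl⟩ := RegularDescent.exists_fin_enum β hβ.card_eq
  obtain ⟨hcp, hx0⟩ := hfrob hβ hℓv 𝔓 h𝔓 σ hσ
  have hvB' : v ∉ B := hvB
  rw [SetLike.mem_coe, RegularDescent.trace_eq_sum_of_charpoly_eq hn0 _ _ hcp]
  rw [← map_sum, RegularDescent.sum_inv_scaled_eq hn0 _ (hsqrt v) x hx0]
  refine hmemLE _ (div_mem (hgood hvB' hβ (n - 1) (Nat.sub_le n 1)) (mul_mem ?_
    (hgood hvB' hβ n le_rfl)))
  rw [← pow_mul, mul_comm, pow_mul, ← Complex.ofReal_pow, Real.sq_sqrt (Nat.cast_nonneg _),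
    Complex.ofReal_natCast]
  exact pow_mem (natCast_mem E₀ _) _

/-! #### The rank-`2` slice, Sen-free -/

/-- **An `E_λ`-rational attached representation at every `(ℓ, ι)` in RANK `2`, from attached
semisimple representations and Clozel's Hecke field ALONE** (no regular places assumed).  Either
`π` has infinitely many regular places — then `exists_rationalModel_of_attached_of_frequently_nodup`
— or not; in the latter case no value of any attached `r` has separable characteristic polynomial
(`frequently_satakeParam_nodup_of_separable_charpoly`), so each `(r(g) - c_g)² = 0`
(`RegularDescent.exists_sub_sq_eq_zero_of_not_separable`) and, `r` being semisimple, every `r(g)`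
is the scalar `c_g = tr r(g) / 2` (`RegularDescent.forall_eq_smul_one_of_sub_sq_eq_zero`), whose
entries `c_g, 0` lie in `E_λ` for Clozel's field `E` (`trace_apply_mem_closure_of_attached`).  This
replaces, in rank `2`, the Sen-theoretic first sentence of [BLGGT]'s proof of Lemma 5.3.1 (3).
[cite: BarnetlambEtAl2014, proof of Lemma 5.3.1 (3)] [cite: Clozel1990, Thm. 3.13] -/
theorem exists_rationalModel_rank_two_of_attached (hC : Clozel1990_heckeEigenvalueField)
    {K : Type} [Field K] [NumberField K]
    {hcpt : isCompact_glFiniteIntegralLevel 2 K} (π : CuspidalAutomorphicRepData 2 K hcpt)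
    (hra : π.1.IsRegularAlgebraic)
    (hA : ∀ (ℓ : ℕ) [Fact ℓ.Prime] (ι : PadicAlgCl ℓ ≃+* ℂ),
      ∃ r : FramedGaloisRep K (PadicAlgCl ℓ) 2, r.toGaloisRep.IsSemisimple ∧
        ∀ (v : HeightOneSpectrum (𝓞 K)) (α : Multiset ℂ), π.1.HasSatakeParamAt v α →
          ((ℓ : ℕ) : 𝓞 K) ∉ v.asIdeal →
            r.IsUnramifiedAt v ∧ r.HasFrobCharpolyAt v (arithFrobPolyOfSatake ι v.residueCard 2 α)) :
    ∃ E : Subfield ℂ, FiniteDimensional ℚ E ∧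
      ∀ (ℓ : ℕ) [Fact ℓ.Prime] (ι : PadicAlgCl ℓ ≃+* ℂ),
        ∃ r : FramedGaloisRep K (PadicAlgCl ℓ) 2,
          (r.toGaloisRep.IsSemisimple ∧
            ∀ (v : HeightOneSpectrum (𝓞 K)) (β : Multiset ℂ), π.1.HasSatakeParamAt v β →
              ((ℓ : ℕ) : 𝓞 K) ∉ v.asIdeal →
                r.IsUnramifiedAt v ∧
                  r.HasFrobCharpolyAt v (arithFrobPolyOfSatake ι v.residueCard 2 β)) ∧
          ∀ (g : Field.absoluteGaloisGroup K) (i j : Fin 2),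
            ((r g : GL (Fin 2) (PadicAlgCl ℓ)) : Matrix (Fin 2) (Fin 2) (PadicAlgCl ℓ)) i j ∈
              closure (Set.range
                ((ι.symm : ℂ ≃+* PadicAlgCl ℓ).toRingHom.comp E.subtype)) := by
  classical
  by_cases hReg : ∃ᶠ v in Filter.cofinite, ∃ β : Multiset ℂ, π.1.HasSatakeParamAt v β ∧ β.Nodup
  · exact exists_rationalModel_of_attached_of_frequently_nodup hC le_rfl π hra hA hReg
  -- no regular place: every attached `r` is scalar-valued
  obtain ⟨E₀, hfd₀, hE₀⟩ := hC 2 K hcpt π hra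
  refine ⟨E₀, hfd₀, fun ℓ _ ι => ?_⟩
  obtain ⟨r, hss, hr⟩ := hA ℓ ι
  refine ⟨r, ⟨hss, hr⟩, fun g i j => ?_⟩
  have hnosep : ∀ g, ¬ (FramedRep.charpoly r g).Separable := fun g hsep =>
    hReg (frequently_satakeParam_nodup_of_separable_charpoly π ι r hr hsep)
  have hsq : ∀ g, ∃ c : PadicAlgCl ℓ,
      (((r g : GL (Fin 2) (PadicAlgCl ℓ)) : Matrix (Fin 2) (Fin 2) (PadicAlgCl ℓ)) - c • 1) *
        (((r g : GL (Fin 2) (PadicAlgCl ℓ)) : Matrix (Fin 2) (Fin 2) (PadicAlgCl ℓ)) - c • 1) = 0 :=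
    fun g => RegularDescent.exists_sub_sq_eq_zero_of_not_separable _ (hnosep g)
  haveI : (FramedRep.toRepresentation r).IsSemisimpleRepresentation := hss
  obtain ⟨c, hc⟩ := RegularDescent.forall_eq_smul_one_of_sub_sq_eq_zero two_ne_zero r.toMonoidHom
    (FramedRep.toRepresentation r) (fun g v => rfl) hsq g
  change ((r g : GL (Fin 2) (PadicAlgCl ℓ)) : Matrix (Fin 2) (Fin 2) (PadicAlgCl ℓ)) = c • 1 at hc
  -- `c = tr r(g) / 2 ∈ E_λ`
  set LE : Subfield (PadicAlgCl ℓ) :=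
    (E₀.map (ι.symm : ℂ ≃+* PadicAlgCl ℓ).toRingHom).topologicalClosure with hLE_def
  have hLE : (LE : Set (PadicAlgCl ℓ)) =
      closure (Set.range ((ι.symm : ℂ ≃+* PadicAlgCl ℓ).toRingHom.comp E₀.subtype)) := by
    change closure _ = closure _
    congr 1
    rw [Subfield.coe_map, RingHom.coe_comp, Set.range_comp]
    congr 1
    exact Set.ext fun z => ⟨fun hz => ⟨⟨z, hz⟩, rfl⟩, by rintro ⟨w, rfl⟩; exact w.2⟩
  have htr := trace_apply_mem_closure_of_attached two_pos π hE₀ ι r hr g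
  rw [hc, Matrix.trace_smul, Matrix.trace_one, Fintype.card_fin, smul_eq_mul] at htr
  have hcmem : c ∈ LE := by
    have h2 : ((2 : ℕ) : PadicAlgCl ℓ) ≠ 0 := by exact_mod_cast (two_ne_zero : (2 : PadicAlgCl ℓ) ≠ 0)
    have h := div_mem htr (natCast_mem LE 2)
    rwa [mul_div_cancel_right₀ _ h2] at h
  rw [← hLE, SetLike.mem_coe, hc, Matrix.smul_apply, smul_eq_mul]
  by_cases hij : i = j
  · subst hij
    rw [Matrix.one_apply_eq, mul_one]
    exact hcmem
  · rw [Matrix.one_apply_ne hij, mul_zero]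
    exact LE.zero_mem

/-- **The rank-`2` slice of `BLGGT2014_polarized_compatibleSystem_rationalModels` from the two
existing named facts `FakhruddinPilloni2021_galoisRep_of_weaklyRegular_normTwist` and
`Clozel1990_heckeEigenvalueField` ONLY** — no Sen theory (`exists_rationalModel_rank_two_of_attached`
with Fakhruddin–Pilloni's attached representations, semisimplified,
`exists_semisimple_attached_of_normTwist`).  No new named fact (D-0026).
[cite: BarnetlambEtAl2014, Thm. 2.1.1 and Lemma 5.3.1 (3) (rank two)]
[cite: FakhruddinPilloni2021, Thm. 9.10 and Thm. 9.1] [cite: Clozel1990, Thm. 3.13] -/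
theorem BLGGT2014_polarized_compatibleSystem_rationalModels_rank_two_of_normTwist
    (h910 : FakhruddinPilloni2021_galoisRep_of_weaklyRegular_normTwist)
    (hC : Clozel1990_heckeEigenvalueField)
    (K : Type) [Field K] [NumberField K] [IsCMField K]
    (hcpt : isCompact_glFiniteIntegralLevel 2 K) (π : CuspidalAutomorphicRepData 2 K hcpt)
    (hra : π.1.IsRegularAlgebraic)
    (hpol : ∃ (χ : HeckeCharacter K) (m : ℤ),
      (∀ x : ideleGroup K, ((χ x : ℂˣ) : ℂ) = (ideleNorm x : ℂ) ^ (m : ℂ)) ∧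
        π.1.IsEssConjSelfDual χ) :
    ∃ E : Subfield ℂ, FiniteDimensional ℚ E ∧
      ∀ (ℓ : ℕ) [Fact ℓ.Prime] (ι : PadicAlgCl ℓ ≃+* ℂ),
        ∃ r : FramedGaloisRep K (PadicAlgCl ℓ) 2,
          (r.toGaloisRep.IsSemisimple ∧
            ∀ (v : HeightOneSpectrum (𝓞 K)) (β : Multiset ℂ), π.1.HasSatakeParamAt v β →
              ((ℓ : ℕ) : 𝓞 K) ∉ v.asIdeal →
                r.IsUnramifiedAt v ∧
                  r.HasFrobCharpolyAt v (arithFrobPolyOfSatake ι v.residueCard 2 β)) ∧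
          ∀ (g : Field.absoluteGaloisGroup K) (i j : Fin 2),
            ((r g : GL (Fin 2) (PadicAlgCl ℓ)) : Matrix (Fin 2) (Fin 2) (PadicAlgCl ℓ)) i j ∈
              closure (Set.range
                ((ι.symm : ℂ ≃+* PadicAlgCl ℓ).toRingHom.comp E.subtype)) := by
  obtain ⟨χ, m, hχ, hsd⟩ := hpol
  exact exists_rationalModel_rank_two_of_attached hC π hra
    fun ℓ _ ι => exists_semisimple_attached_of_normTwist h910 two_pos π hra hχ hsd ℓ ι

/-- **The residue, sharpened: Sen theory is only needed in ranks `n ≥ 3`.**  A discharge of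
`BLGGT2014_polarized_compatibleSystem_rationalModels` follows from the two existing named facts
`FakhruddinPilloni2021_galoisRep_of_weaklyRegular_normTwist`, `Clozel1990_heckeEigenvalueField`
and the statement `hSen` of `…_of_normTwist_of_forall_isCompatible` RESTRICTED TO `3 ≤ n`: ranks
`0, 1` are proved (`_of_two_le_rank`), rank `2` is `exists_rationalModel_rank_two_of_attached`
(Sen-free), and for `n ≥ 3` the regular element of `hSen` (at `ℓ = 2`, any `ι`, for
Fakhruddin–Pilloni's semisimplified `r`) gives infinitely many regular places
(`frequently_satakeParam_nodup_of_separable_charpoly`) and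
`exists_rationalModel_of_attached_of_frequently_nodup` applies.  No new named fact (D-0026).
[cite: BarnetlambEtAl2014, Thm. 2.1.1 (3) and proof of Lemma 5.3.1 (3)]
[cite: FakhruddinPilloni2021, Thm. 9.10 and Thm. 9.1] [cite: Clozel1990, Thm. 3.13] -/
theorem BLGGT2014_polarized_compatibleSystem_rationalModels_of_normTwist_of_forall_isCompatible_three_le
    (h910 : FakhruddinPilloni2021_galoisRep_of_weaklyRegular_normTwist)
    (hC : Clozel1990_heckeEigenvalueField)
    (hSen : ∀ (n : ℕ), 3 ≤ n → ∀ (K : Type) [Field K] [NumberField K] [IsCMField K]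
      (hcpt : isCompact_glFiniteIntegralLevel n K) (π : CuspidalAutomorphicRepData n K hcpt),
        π.1.IsRegularAlgebraic →
        (∃ (χ : HeckeCharacter K) (m : ℤ),
            (∀ x : ideleGroup K, ((χ x : ℂˣ) : ℂ) = (ideleNorm x : ℂ) ^ (m : ℂ)) ∧
              π.1.IsEssConjSelfDual χ) →
          ∀ (ℓ : ℕ) [Fact ℓ.Prime] (ι : PadicAlgCl ℓ ≃+* ℂ) (r : FramedGaloisRep K (PadicAlgCl ℓ) n),
            r.toGaloisRep.IsSemisimple → HarrisLanTaylorThorne2016.IsCompatible π.1 ι r →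
              ∃ g₀ : absoluteGaloisGroup K, (FramedRep.charpoly r g₀).Separable) :
    BLGGT2014_polarized_compatibleSystem_rationalModels := by
  refine BLGGT2014_polarized_compatibleSystem_rationalModels_of_two_le_rank
    fun n hn K _ _ _ hcpt π hra hpol => ?_
  obtain ⟨χ, m, hχ, hsd⟩ := hpol
  have hA : ∀ (ℓ : ℕ) [Fact ℓ.Prime] (ι : PadicAlgCl ℓ ≃+* ℂ),
      ∃ r : FramedGaloisRep K (PadicAlgCl ℓ) n, r.toGaloisRep.IsSemisimple ∧
        ∀ (v : HeightOneSpectrum (𝓞 K)) (α : Multiset ℂ), π.1.HasSatakeParamAt v α →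
          ((ℓ : ℕ) : 𝓞 K) ∉ v.asIdeal →
            r.IsUnramifiedAt v ∧
              r.HasFrobCharpolyAt v (arithFrobPolyOfSatake ι v.residueCard n α) :=
    fun ℓ _ ι => exists_semisimple_attached_of_normTwist h910 (by omega) π hra hχ hsd ℓ ι
  rcases Nat.lt_or_ge n 3 with hlt | h3
  · obtain rfl : n = 2 := by omega
    exact exists_rationalModel_rank_two_of_attached hC π hra hA
  · haveI : Fact (Nat.Prime 2) := ⟨Nat.prime_two⟩
    obtain ⟨ι⟩ := PadicAlgCl.nonempty_ringEquiv_complex 2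
    obtain ⟨r, hss, hc, hr⟩ :=
      exists_semisimple_isCompatible_of_normTwist h910 (by omega) π hra hχ hsd 2 ι
    obtain ⟨g₀, hsep⟩ := hSen n h3 K hcpt π hra ⟨χ, m, hχ, hsd⟩ 2 ι r hss hc
    exact exists_rationalModel_of_attached_of_frequently_nodup hC hn π hra hA
      (frequently_satakeParam_nodup_of_separable_charpoly π ι r hr hsep)


/-! ### Appended 2026-08-17 (fifth pass): the rank-`3` slice, Sen-free

In rank `3` the Sen-theoretic first sentence of [BLGGT]'s proof of Lemma 5.3.1 (3) ("`G_λ^0`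
contains an element whose characteristic polynomial has `n` distinct roots", Hodge–Tate
regularity and Sen's theorem) can again be dispensed with, as in rank `2`
(`exists_rationalModel_rank_two_of_attached`), but by a genuinely representation-theoretic
argument (`Literature/RepresentationTheory/Semisimple/SimpleEigenvalueDescent.lean`,
`…/RationalFormRankLeThree.lean`).  Fix `π` of rank `3` with attached semisimple `r = r_{ℓ,ι}`
and Clozel's Hecke field `E₀`, `E_λ = ` the closure of `ι⁻¹(E₀)`.  EITHER `π` has infinitely
many places with a Satake parameter without repetition — [BLGGT]'s regular places, and the proved
assembly `exists_rationalModel_of_attached_of_frequently_nodup` applies — OR it has only finitely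
many.  In the latter case: (a) NO `r(g)` has separable characteristic polynomial (openness of
"separable" and Chebotarev, `frequently_satakeParam_nodup_of_separable_charpoly`); (b) ALL
coefficients of ALL `charpoly r(g)` lie in `E_λ` (at a good Frobenius they are
`e_j((q_v β_{v,i})⁻¹)`, rational in Clozel's `t_{v,1}, t_{v,2}, t_{v,3}` and `q_v`; the coefficient
maps are polynomial in the matrix entries, hence continuous, and Frobenius elements are dense —
`coeff_charpoly_apply_mem_closure_of_attached_three`); (c) a monic cubic with coefficients in a
field `L` and a repeated root has ALL its roots in `L` (`a = (s₁s₂ - 9s₃)/(2(s₁² - 3s₂))` or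
`s₁/3`, `RegularDescent.roots_mem_of_not_separable_three`); so every eigenvalue of every `r(g)`
lies in `E_λ`, and (d) a semisimple representation of rank `≤ 3` all of whose eigenvalues lie in a
subfield is conjugate into that subfield
(`Literature.RepresentationTheory.Semisimple.exists_conj_apply_mem_of_isSemisimple_of_le_three`:
an irreducible constituent either has an element with a simple rational eigenvalue — and the
`L`-span of its image, an `L`-form of the matrix algebra, contains a rank-one idempotent, which
splits it — or has a single eigenvalue everywhere and is scalar by Burnside's finiteness
argument).  Hence `r` is conjugate into `GL_3(E_λ)` with `E = E₀`, uniformly in `(ℓ, ι)`.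
The residue of the fact is thereby pushed to ranks `n ≥ 4`
(`…_of_normTwist_of_forall_isCompatible_four_le`), where it is genuinely Hodge-theoretic: from
rank `4` on an irreducible `ℓ`-adic representation without regular elements need not be definable
over its field of traces locally (local Schur indices), and only the Hodge–Tate regularity of
`r_{l,ı}(π)` excludes this.  No new named fact (D-0026).
-/

namespace RegularDescent

/-! #### Coefficients of the characteristic polynomial: universality and continuity -/

/-- The `j`-th coefficient of the characteristic polynomial of an `n × n` matrix is the evaluation
at its entries of ONE integer polynomial in `n²` variables (the coefficient of the universal
characteristic polynomial, Mathlib `Matrix.charpoly.univ`). [folklore] -/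
theorem coeff_charpoly_eq_eval₂Hom {A : Type*} [CommRing A] {n : ℕ} (M : Matrix (Fin n) (Fin n) A)
    (j : ℕ) :
    M.charpoly.coeff j =
      MvPolynomial.eval₂Hom (Int.castRingHom A) (fun ij : Fin n × Fin n => M ij.1 ij.2)
        ((Matrix.charpoly.univ ℤ (Fin n)).coeff j) := by
  have hM : Matrix.of (Function.curry fun ij : Fin n × Fin n => M ij.1 ij.2) = M := by
    ext i j; rfl
  have h1 : (Matrix.charpoly.univ ℤ (Fin n)).map
      (MvPolynomial.eval₂Hom (Int.castRingHom A) (fun ij : Fin n × Fin n => M ij.1 ij.2)) =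
        M.charpoly := by
    rw [Matrix.charpoly.univ_map_eval₂Hom, hM]
  rw [← h1, Polynomial.coeff_map]

/-- `M ↦ coeff_j (charpoly M)` is continuous on `n × n` matrices over a topological ring (a
polynomial in the entries). [folklore] -/
theorem continuous_coeff_charpoly {A : Type*} [CommRing A] [TopologicalSpace A]
    [IsTopologicalRing A] {n : ℕ} (j : ℕ) :
    Continuous fun M : Matrix (Fin n) (Fin n) A => M.charpoly.coeff j := by
  set D := (Matrix.charpoly.univ ℤ (Fin n)).coeff j
  have h : (fun M : Matrix (Fin n) (Fin n) A => M.charpoly.coeff j) =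
      fun M => MvPolynomial.eval (fun ij : Fin n × Fin n => M ij.1 ij.2)
        (MvPolynomial.map (Int.castRingHom A) D) := by
    funext M
    rw [coeff_charpoly_eq_eval₂Hom, MvPolynomial.coe_eval₂Hom, MvPolynomial.eval_map]
  rw [h]
  exact (MvPolynomial.continuous_eval _).comp
    (continuous_pi fun ij : Fin n × Fin n => (continuous_apply ij.2).comp (continuous_apply ij.1))

/-! #### Frobenius density for a continuous invariant -/

/-- **A continuous function on `Γ_K` takes values in a closed set as soon as it does at the
Frobenius elements outside a finite set of places** (Chebotarev density in the proved form
`chebotarev_artinRep_holds` / `absoluteGaloisGroup.frobenius_dense`); `trace_apply_mem_of_frobenius`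
is the case of the trace. [cite: SerreAbelianLadic1968, Ch. I §2.2, Cor. 2 (a)] -/
theorem apply_mem_of_frobenius {K : Type} [Field K] [NumberField K] {Y : Type*}
    [TopologicalSpace Y] (f : absoluteGaloisGroup K → Y) (hf : Continuous f)
    (S : Set (HeightOneSpectrum (𝓞 K))) (hS : S.Finite) {C : Set Y} (hC : IsClosed C)
    (h : ∀ v ∉ S, ∀ 𝔓 ∈ v.primesAbove, ∀ σ : absoluteGaloisGroup K, IsArithFrobAt (𝓞 K) σ 𝔓 →
      f σ ∈ C)
    (g : absoluteGaloisGroup K) : f g ∈ C := by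
  have hD := absoluteGaloisGroup.frobenius_dense Automorphic.chebotarev_artinRep_holds K S hS
  have hcl : IsClosed (f ⁻¹' C) := hC.preimage hf
  have hsub : {σ : absoluteGaloisGroup K |
      ∃ v ∉ S, ∃ 𝔓 ∈ v.primesAbove, IsArithFrobAt (𝓞 K) σ 𝔓} ⊆ f ⁻¹' C := by
    rintro σ ⟨v, hvS, 𝔓, h𝔓, hσ⟩
    exact h v hvS 𝔓 h𝔓 σ hσ
  have huniv : f ⁻¹' C = Set.univ := by
    have h1 := (hD.mono hsub).closure_eq
    rwa [hcl.closure_eq] at h1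
  have hg : g ∈ f ⁻¹' C := huniv ▸ Set.mem_univ g
  exact hg

/-! #### Elementary symmetric functions and coefficients in rank `3` -/

/-- `e_1` of `n` numbers is their sum. [folklore] -/
theorem esymm_univ_one {R : Type*} [CommSemiring R] {n : ℕ} (x : Fin n → R) :
    ((Finset.univ : Finset (Fin n)).val.map x).esymm 1 = ∑ i, x i := by
  rw [Finset.esymm_map_val, Finset.powersetCard_one, Finset.sum_map]
  exact Finset.sum_congr rfl fun i _ => Finset.prod_singleton _ _

/-- **The coefficients of `∏_{i<3} (X - zᵢ)` lie in `L` when `Σ zᵢ`, `(Σ zᵢ⁻¹) ∏ zᵢ = e₂(z)` and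
`∏ zᵢ` do** (Vieta, `Multiset.prod_X_sub_C_coeff`). [folklore] -/
theorem coeff_prod_X_sub_C_three_mem {F : Type*} [Field F] (L : Subfield F) (z : Fin 3 → F)
    (hz : ∀ i, z i ≠ 0) (h1 : ∑ i, z i ∈ L) (h2 : (∑ i, (z i)⁻¹) * ∏ i, z i ∈ L)
    (h3 : ∏ i, z i ∈ L) (j : ℕ) : (∏ i, (X - C (z i))).coeff j ∈ L := by
  classical
  have hprod : (∏ i, (X - C (z i))) =
      ((((Finset.univ : Finset (Fin 3)).val.map z).map fun a => X - C a).prod) :=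
    (prod_X_sub_C_eq_multiset z (fun a => a)).symm
  have hcard : Multiset.card ((Finset.univ : Finset (Fin 3)).val.map z) = 3 := by
    rw [Multiset.card_map, Finset.card_val, Finset.card_univ, Fintype.card_fin]
  rcases Nat.lt_or_ge j 4 with hj | hj
  · interval_cases j
    · rw [hprod, Multiset.prod_X_sub_C_coeff _ (by rw [hcard]; norm_num), hcard, esymm_univ_card]
      exact mul_mem (pow_mem (neg_mem (one_mem L)) _) h3
    · rw [hprod, Multiset.prod_X_sub_C_coeff _ (by rw [hcard]; norm_num), hcard,
        show 3 - 1 = 2 from rfl, esymm_univ_card_sub_one (by norm_num : 0 < 3),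
        ← sum_inv_mul_prod z hz]
      exact mul_mem (pow_mem (neg_mem (one_mem L)) _) h2
    · rw [hprod, Multiset.prod_X_sub_C_coeff _ (by rw [hcard]; norm_num), hcard,
        show 3 - 2 = 1 from rfl, esymm_univ_one]
      exact mul_mem (pow_mem (neg_mem (one_mem L)) _) h1
    · have hmonic : (∏ i : Fin 3, (X - C (z i))).Monic := monic_prod_of_monic _ _ fun i _ =>
        monic_X_sub_C (z i)
      have hdeg : (∏ i : Fin 3, (X - C (z i))).natDegree = 3 := by
        rw [natDegree_prod_of_monic _ _ fun i _ => monic_X_sub_C (z i)]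
        simp
      have h := hmonic.coeff_natDegree
      rw [hdeg] at h
      rw [h]
      exact one_mem L
  · have hdeg : (∏ i : Fin 3, (X - C (z i))).natDegree = 3 := by
      rw [natDegree_prod_of_monic _ _ fun i _ => monic_X_sub_C (z i)]
      simp
    rw [coeff_eq_zero_of_natDegree_lt (by rw [hdeg]; omega)]
    exact zero_mem L

/-- The three lower coefficients of `X³ - s₁X² + s₂X - s₃`. [folklore] -/
theorem coeff_cubic {k : Type*} [CommRing k] (s₁ s₂ s₃ : k) :
    (X ^ 3 - C s₁ * X ^ 2 + C s₂ * X - C s₃ : k[X]).coeff 2 = -s₁ ∧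
      (X ^ 3 - C s₁ * X ^ 2 + C s₂ * X - C s₃ : k[X]).coeff 1 = s₂ ∧
        (X ^ 3 - C s₁ * X ^ 2 + C s₂ * X - C s₃ : k[X]).coeff 0 = -s₃ := by
  refine ⟨?_, ?_, ?_⟩ <;> simp [coeff_X_pow, coeff_C, coeff_X, coeff_C_mul]

/-- **A monic cubic with coefficients in `L` and a repeated root has all its roots in `L`**
(`k` algebraically closed of characteristic `0`): writing the roots `a, a, b` and
`s₁ = 2a + b`, `s₂ = a² + 2ab`, `s₃ = a²b` (`±` the coefficients), either `a = b = s₁/3`, or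
`s₁² - 3s₂ = (a-b)² ≠ 0` and `a = (s₁s₂ - 9s₃)/(2(s₁² - 3s₂))`, `b = s₁ - 2a`. [folklore] -/
theorem roots_mem_of_not_separable_three {k : Type*} [Field k] [IsAlgClosed k] [CharZero k]
    (L : Subfield k) (p : k[X]) (hp : p.Monic) (hdeg : p.natDegree = 3)
    (hcoef : ∀ i, p.coeff i ∈ L) (hsep : ¬ p.Separable) : ∀ r ∈ p.roots, r ∈ L := by
  classical
  set s := p.roots with hsdef
  have hcard : Multiset.card s = 3 := by rw [hsdef, IsAlgClosed.card_roots_eq_natDegree, hdeg]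
  have hprod : (s.map fun a => X - C a).prod = p :=
    prod_multiset_X_sub_C_of_monic_of_roots_card_eq hp (by rw [IsAlgClosed.card_roots_eq_natDegree])
  have hnd : ¬ s.Nodup := fun hnd =>
    hsep ((nodup_roots_iff_of_splits hp.ne_zero (IsAlgClosed.splits p)).mp hnd)
  rw [Multiset.nodup_iff_count_le_one] at hnd
  push Not at hnd
  obtain ⟨a, ha⟩ := hnd
  -- `s = {a, a, b}`
  have ha_mem : a ∈ s := Multiset.count_pos.mp (by omega)
  have ha_mem' : a ∈ s.erase a := by
    rw [← Multiset.count_pos, Multiset.count_erase_self]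
    omega
  obtain ⟨b, hb⟩ : ∃ b, (s.erase a).erase a = {b} := by
    rw [← Multiset.card_eq_one]
    have h1 := Multiset.card_erase_of_mem ha_mem
    have h2 := Multiset.card_erase_of_mem ha_mem'
    rw [h2, h1, hcard]
    exact rfl
  have hs : s = a ::ₘ a ::ₘ {b} := by
    rw [← hb, Multiset.cons_erase ha_mem', Multiset.cons_erase ha_mem]
  have hpoly : p = X ^ 3 - C (2 * a + b) * X ^ 2 + C (a ^ 2 + 2 * a * b) * X - C (a ^ 2 * b) := by
    rw [← hprod, hs, Multiset.map_cons, Multiset.map_cons, Multiset.map_singleton,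
      Multiset.prod_cons, Multiset.prod_cons, Multiset.prod_singleton]
    simp only [map_add, map_mul, map_pow, map_ofNat]
    ring
  obtain ⟨hc2, hc1, hc0⟩ := hpoly ▸ coeff_cubic (2 * a + b) (a ^ 2 + 2 * a * b) (a ^ 2 * b)
  have hs1 : 2 * a + b ∈ L := by
    have h := neg_mem (hcoef 2)
    rwa [hc2, neg_neg] at h
  have hs2 : a ^ 2 + 2 * a * b ∈ L := hc1 ▸ hcoef 1
  have hs3 : a ^ 2 * b ∈ L := by
    have h := neg_mem (hcoef 0)
    rwa [hc0, neg_neg] at h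
  -- solve for `a` and `b`
  have hab : a ∈ L ∧ b ∈ L := by
    by_cases heq : a = b
    · subst heq
      have h3 : (3 : k) ≠ 0 := three_ne_zero
      have ha' : a = (2 * a + a) / 3 := by field_simp; ring
      have haL : a ∈ L := by
        rw [ha']
        exact div_mem hs1 (natCast_mem L 3)
      exact ⟨haL, haL⟩
    · have hne : (2 * a + b) ^ 2 - 3 * (a ^ 2 + 2 * a * b) ≠ 0 := by
        have h1 : (2 * a + b) ^ 2 - 3 * (a ^ 2 + 2 * a * b) = (a - b) ^ 2 := by ring
        rw [h1]
        exact pow_ne_zero 2 (sub_ne_zero.mpr heq)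
      have ha' : a = ((2 * a + b) * (a ^ 2 + 2 * a * b) - 9 * (a ^ 2 * b)) /
          (2 * ((2 * a + b) ^ 2 - 3 * (a ^ 2 + 2 * a * b))) := by
        rw [eq_div_iff (mul_ne_zero two_ne_zero hne)]
        ring
      have haL : a ∈ L := by
        rw [ha']
        exact div_mem (sub_mem (mul_mem hs1 hs2) (mul_mem (natCast_mem L 9) hs3))
          (mul_mem (natCast_mem L 2) (sub_mem (pow_mem hs1 2) (mul_mem (natCast_mem L 3) hs2)))
      have hb' : b = (2 * a + b) - 2 * a := by ring
      have hbL : b ∈ L := by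
        rw [hb']
        exact sub_mem hs1 (mul_mem (natCast_mem L 2) haL)
      exact ⟨haL, hbL⟩
  intro r hr
  rw [hs, Multiset.mem_cons, Multiset.mem_cons, Multiset.mem_singleton] at hr
  rcases hr with rfl | rfl | rfl
  · exact hab.1
  · exact hab.1
  · exact hab.2

end RegularDescent

/-! #### All coefficients of all characteristic polynomials of an attached `r` lie in `E_λ`
(rank `3`) -/

/-- **"`charpoly r(g) ∈ E_λ[X]`" in rank `3`.**  If `r` is attached to `(π, ι)` (`π` on `GL_3`)
at the finite `v ∤ ℓ` where `π` has a Satake parameter, and the Hecke eigenvalues of `π` off a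
finite set of places lie in the subfield `E₀ ⊂ ℂ` (Clozel), then every coefficient of every
`charpoly r(g)` lies in the closure `E_λ` of `ι⁻¹(E₀)` in `ℚ̄_ℓ`: at a good arithmetic Frobenius
the characteristic polynomial is `∏ᵢ (X - (q_v β_{v,i})⁻¹)` (transported by `ι⁻¹`), whose
coefficients `e₂(y)/e₃(y)`, `e₁(y)/e₃(y)`, `1/e₃(y)` (`yᵢ = q_v β_{v,i}`) are rational in
`t_{v,1} = q_v e₁(β)`, `t_{v,2} = q_v e₂(β)`, `t_{v,3} = e₃(β)` and `q_v`
(`RegularDescent.coeff_prod_X_sub_C_three_mem`, `RegularDescent.sum_inv_scaled_eq`); the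
coefficient maps are continuous (`RegularDescent.continuous_coeff_charpoly`) and Frobenius
elements are dense (`RegularDescent.apply_mem_of_frobenius`).  The rank-`3` companion of
`trace_apply_mem_closure_of_attached`. [cite: BarnetlambEtAl2014, proof of Lemma 5.3.1 (3)]
[cite: Clozel1990, Thm. 3.13] -/
theorem coeff_charpoly_apply_mem_closure_of_attached_three
    {K : Type} [Field K] [NumberField K] {hcpt : isCompact_glFiniteIntegralLevel 3 K}
    (π : CuspidalAutomorphicRepData 3 K hcpt) {E₀ : Subfield ℂ}
    (hE₀ : ∀ᶠ v : HeightOneSpectrum (𝓞 K) in Filter.cofinite, ∀ α : Multiset ℂ,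
      π.1.HasSatakeParamAt v α → ∀ i ≤ 3, heckeEigenvalueOf 3 v α i ∈ E₀)
    {ℓ : ℕ} [Fact ℓ.Prime] (ι : PadicAlgCl ℓ ≃+* ℂ) (r : FramedGaloisRep K (PadicAlgCl ℓ) 3)
    (hr : ∀ (v : HeightOneSpectrum (𝓞 K)) (α : Multiset ℂ), π.1.HasSatakeParamAt v α →
      ((ℓ : ℕ) : 𝓞 K) ∉ v.asIdeal →
        r.IsUnramifiedAt v ∧ r.HasFrobCharpolyAt v (arithFrobPolyOfSatake ι v.residueCard 3 α))
    (g : absoluteGaloisGroup K) (j : ℕ) :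
    ((r g : GL (Fin 3) (PadicAlgCl ℓ)) : Matrix (Fin 3) (Fin 3) (PadicAlgCl ℓ)).charpoly.coeff j ∈
      (E₀.map (ι.symm : ℂ ≃+* PadicAlgCl ℓ).toRingHom).topologicalClosure := by
  classical
  -- scaling factors `c v = (√q_v)^2 = q_v`
  set c : HeightOneSpectrum (𝓞 K) → ℂ := fun v =>
    (((Real.sqrt (v.residueCard : ℝ)) : ℝ) : ℂ) ^ (3 - 1) with hc_def
  have hsqrt : ∀ v : HeightOneSpectrum (𝓞 K), (((Real.sqrt (v.residueCard : ℝ)) : ℝ) : ℂ) ≠ 0 :=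
    fun v => by
      rw [Ne, Complex.ofReal_eq_zero, Real.sqrt_eq_zero (Nat.cast_nonneg _), Nat.cast_eq_zero]
      exact (zero_lt_one.trans v.one_lt_residueCard).ne'
  have hc0 : ∀ v, c v ≠ 0 := fun v => pow_ne_zero _ (hsqrt v)
  have hcq : ∀ v : HeightOneSpectrum (𝓞 K), c v = (v.residueCard : ℂ) := fun v => by
    rw [hc_def]
    simp only
    rw [show (3 - 1 : ℕ) = 2 from rfl, ← Complex.ofReal_pow, Real.sq_sqrt (Nat.cast_nonneg _),
      Complex.ofReal_natCast]
  set B : Set (HeightOneSpectrum (𝓞 K)) :=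
    {v | ¬ ∀ α : Multiset ℂ, π.1.HasSatakeParamAt v α → ∀ i ≤ 3, heckeEigenvalueOf 3 v α i ∈ E₀}
    with hB_def
  have hB : B.Finite := hE₀
  have hgood : ∀ {v : HeightOneSpectrum (𝓞 K)} {x : Fin 3 → ℂ}, v ∉ B →
      π.1.HasSatakeParamAt v ((Finset.univ : Finset (Fin 3)).val.map x) →
        ∀ i ≤ 3, heckeEigenvalueOf 3 v ((Finset.univ : Finset (Fin 3)).val.map x) i ∈ E₀ := by
    intro v x hvB hx i hi
    simp only [hB_def, Set.mem_setOf_eq, not_not] at hvB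
    exact hvB _ hx i hi
  set LE : Subfield (PadicAlgCl ℓ) :=
    (E₀.map (ι.symm : ℂ ≃+* PadicAlgCl ℓ).toRingHom).topologicalClosure with hLE_def
  have hmemLE : ∀ z ∈ E₀, (ι.symm : ℂ ≃+* PadicAlgCl ℓ) z ∈ LE := fun z hz =>
    Subfield.le_topologicalClosure _ (Subfield.mem_map.mpr ⟨z, hz, rfl⟩)
  -- Frobenius data at a good place
  have hfrob : ∀ {v : HeightOneSpectrum (𝓞 K)} {x : Fin 3 → ℂ},
      π.1.HasSatakeParamAt v ((Finset.univ : Finset (Fin 3)).val.map x) →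
      ((ℓ : ℕ) : 𝓞 K) ∉ v.asIdeal → ∀ 𝔓 ∈ v.primesAbove, ∀ σ : absoluteGaloisGroup K,
        IsArithFrobAt (𝓞 K) σ 𝔓 →
          ((r σ : GL (Fin 3) (PadicAlgCl ℓ)) : Matrix (Fin 3) (Fin 3) (PadicAlgCl ℓ)).charpoly =
              ∏ i, (X - C ((ι.symm : ℂ ≃+* PadicAlgCl ℓ) (c v * x i)⁻¹)) ∧
            ∀ i, x i ≠ 0 := by
    intro v x hx hℓv 𝔓 h𝔓 σ hσ
    have hcp : ((r σ : GL (Fin 3) (PadicAlgCl ℓ)) : Matrix (Fin 3) (Fin 3) (PadicAlgCl ℓ)).charpoly =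
        ∏ i, (X - C ((ι.symm : ℂ ≃+* PadicAlgCl ℓ) (c v * x i)⁻¹)) := by
      have h := (hr v _ hx hℓv).2 𝔓 h𝔓 σ hσ
      rw [FramedRep.charpoly, arithFrobPolyOfSatake] at h
      rw [h, ← RegularDescent.prod_X_sub_C_eq_multiset x
        (fun a => (ι.symm : ℂ ≃+* PadicAlgCl ℓ) ((((Real.sqrt (v.residueCard : ℝ)) : ℝ) : ℂ) ^
          (3 - 1) * a)⁻¹)]
    refine ⟨hcp, fun i hi => ?_⟩
    have hdet := RegularDescent.det_eq_prod_of_charpoly_eq _ _ hcp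
    have hne : ((r σ : GL (Fin 3) (PadicAlgCl ℓ)) : Matrix (Fin 3) (Fin 3) (PadicAlgCl ℓ)).det ≠ 0 := by
      rw [← Matrix.GeneralLinearGroup.val_det_apply]
      exact Units.ne_zero _
    rw [hdet] at hne
    exact hne (Finset.prod_eq_zero (Finset.mem_univ i) (by rw [hi, mul_zero, inv_zero, map_zero]))
  -- Frobenius density
  set S : Set (HeightOneSpectrum (𝓞 K)) :=
    ({v | ((ℓ : ℕ) : 𝓞 K) ∈ v.asIdeal} ∪ {v | ¬ π.1.IsUnramifiedAt v}) ∪ B with hS_def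
  have hSfin : S.Finite :=
    ((finite_setOf_natCast_mem_asIdeal_of_prime K (Fact.out : ℓ.Prime)).union
      π.1.hasSatakeParamAt_cofinite_holds).union hB
  refine RegularDescent.apply_mem_of_frobenius
    (fun g => ((r g : GL (Fin 3) (PadicAlgCl ℓ)) : Matrix (Fin 3) (Fin 3) (PadicAlgCl ℓ)).charpoly.coeff j)
    ((RegularDescent.continuous_coeff_charpoly j).comp
      (Units.continuous_val.comp (map_continuous r)))
    S hSfin (Subfield.isClosed_topologicalClosure _) (fun v hvS 𝔓 h𝔓 σ hσ => ?_) g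
  simp only [hS_def, Set.mem_union, Set.mem_setOf_eq, not_or, not_not] at hvS
  obtain ⟨⟨hℓv, β, hβ⟩, hvB⟩ := hvS
  obtain ⟨x, rfl⟩ := RegularDescent.exists_fin_enum β hβ.card_eq
  obtain ⟨hcp, hx0⟩ := hfrob hβ hℓv 𝔓 h𝔓 σ hσ
  have hvB' : v ∉ B := hvB
  show ((r σ : GL (Fin 3) (PadicAlgCl ℓ)) : Matrix (Fin 3) (Fin 3) (PadicAlgCl ℓ)).charpoly.coeff j
    ∈ (LE : Set (PadicAlgCl ℓ))
  rw [SetLike.mem_coe, hcp]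
  -- the three symmetric functions of `zᵢ = ι⁻¹((c xᵢ)⁻¹)`
  set z : Fin 3 → PadicAlgCl ℓ := fun i => (ι.symm : ℂ ≃+* PadicAlgCl ℓ) (c v * x i)⁻¹ with hz_def
  have hz : ∀ i, z i ≠ 0 := fun i => by
    rw [hz_def]
    exact (_root_.map_ne_zero _).mpr (inv_ne_zero (mul_ne_zero (hc0 v) (hx0 i)))
  have hcE : c v ∈ E₀ := by
    rw [hcq]
    exact natCast_mem E₀ _
  have ht1 : c v * ∑ i, x i ∈ E₀ := by
    have h := hgood hvB' hβ 1 (by norm_num)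
    rw [heckeEigenvalueOf, RegularDescent.esymm_univ_one] at h
    rwa [hc_def]
  have ht3 : ∏ i, x i ∈ E₀ := by
    have h := hgood hvB' hβ 3 le_rfl
    rw [heckeEigenvalueOf, RegularDescent.esymm_univ_card] at h
    simpa using h
  -- `Σ zᵢ = ι⁻¹(Σ (c xᵢ)⁻¹) = ι⁻¹(t₂ / (c² t₃))`
  have h1 : ∑ i, z i ∈ LE := by
    simp only [hz_def]
    rw [← map_sum, RegularDescent.sum_inv_scaled_eq (by norm_num : 0 < 3) _ (hsqrt v) x hx0]
    refine hmemLE _ (div_mem (hgood hvB' hβ (3 - 1) (by norm_num)) (mul_mem ?_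
      (hgood hvB' hβ 3 le_rfl)))
    exact pow_mem hcE 2
  -- `∏ zᵢ = ι⁻¹((c³ ∏ xᵢ)⁻¹)`
  have hprodz : ∏ i, z i = (ι.symm : ℂ ≃+* PadicAlgCl ℓ) ((c v) ^ 3 * ∏ i, x i)⁻¹ := by
    simp only [hz_def]
    rw [← map_prod, Finset.prod_inv_distrib, Finset.prod_mul_distrib, Finset.prod_const,
      Finset.card_univ, Fintype.card_fin]
  have h3 : ∏ i, z i ∈ LE := by
    rw [hprodz]
    exact hmemLE _ (inv_mem (mul_mem (pow_mem hcE 3) ht3))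
  -- `Σ zᵢ⁻¹ = ι⁻¹(c Σ xᵢ) = ι⁻¹(t₁)`
  have h2 : (∑ i, (z i)⁻¹) * ∏ i, z i ∈ LE := by
    refine mul_mem ?_ h3
    have hsum : ∑ i, (z i)⁻¹ = (ι.symm : ℂ ≃+* PadicAlgCl ℓ) (c v * ∑ i, x i) := by
      simp only [hz_def]
      rw [Finset.mul_sum, map_sum]
      exact Finset.sum_congr rfl fun i _ => by rw [← map_inv₀, inv_inv]
    rw [hsum]
    exact hmemLE _ ht1
  exact RegularDescent.coeff_prod_X_sub_C_three_mem LE z hz h1 h2 h3 j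

/-! #### The rank-`3` slice, Sen-free -/

/-- **An `E_λ`-rational attached representation at every `(ℓ, ι)` in RANK `3`, from attached
semisimple representations and Clozel's Hecke field ALONE** (no regular places assumed, no Sen
theory).  Either `π` has infinitely many regular places — then
`exists_rationalModel_of_attached_of_frequently_nodup` — or not; in the latter case no value of
any attached `r` has separable characteristic polynomial
(`frequently_satakeParam_nodup_of_separable_charpoly`), all coefficients of all `charpoly r(g)` lie
in `E_λ` for Clozel's field `E` (`coeff_charpoly_apply_mem_closure_of_attached_three`), hence —
a cubic over `E_λ` with a repeated root has its roots in `E_λ`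
(`RegularDescent.roots_mem_of_not_separable_three`) — all EIGENVALUES of all `r(g)` lie in `E_λ`,
and a semisimple representation of rank `≤ 3` with all eigenvalues in a subfield is conjugate into
it (`Literature.RepresentationTheory.Semisimple.exists_conj_apply_mem_of_isSemisimple_of_le_three`:
simple-eigenvalue descent or Burnside's scalar criterion on the irreducible constituents,
dévissage, Brauer–Nesbitt).  This replaces, in rank `3`, the Sen-theoretic first sentence of
[BLGGT]'s proof of Lemma 5.3.1 (3). [cite: BarnetlambEtAl2014, proof of Lemma 5.3.1 (3)]
[cite: Clozel1990, Thm. 3.13] -/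
theorem exists_rationalModel_rank_three_of_attached (hC : Clozel1990_heckeEigenvalueField)
    {K : Type} [Field K] [NumberField K]
    {hcpt : isCompact_glFiniteIntegralLevel 3 K} (π : CuspidalAutomorphicRepData 3 K hcpt)
    (hra : π.1.IsRegularAlgebraic)
    (hA : ∀ (ℓ : ℕ) [Fact ℓ.Prime] (ι : PadicAlgCl ℓ ≃+* ℂ),
      ∃ r : FramedGaloisRep K (PadicAlgCl ℓ) 3, r.toGaloisRep.IsSemisimple ∧
        ∀ (v : HeightOneSpectrum (𝓞 K)) (α : Multiset ℂ), π.1.HasSatakeParamAt v α →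
          ((ℓ : ℕ) : 𝓞 K) ∉ v.asIdeal →
            r.IsUnramifiedAt v ∧ r.HasFrobCharpolyAt v (arithFrobPolyOfSatake ι v.residueCard 3 α)) :
    ∃ E : Subfield ℂ, FiniteDimensional ℚ E ∧
      ∀ (ℓ : ℕ) [Fact ℓ.Prime] (ι : PadicAlgCl ℓ ≃+* ℂ),
        ∃ r : FramedGaloisRep K (PadicAlgCl ℓ) 3,
          (r.toGaloisRep.IsSemisimple ∧
            ∀ (v : HeightOneSpectrum (𝓞 K)) (β : Multiset ℂ), π.1.HasSatakeParamAt v β →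
              ((ℓ : ℕ) : 𝓞 K) ∉ v.asIdeal →
                r.IsUnramifiedAt v ∧
                  r.HasFrobCharpolyAt v (arithFrobPolyOfSatake ι v.residueCard 3 β)) ∧
          ∀ (g : Field.absoluteGaloisGroup K) (i j : Fin 3),
            ((r g : GL (Fin 3) (PadicAlgCl ℓ)) : Matrix (Fin 3) (Fin 3) (PadicAlgCl ℓ)) i j ∈
              closure (Set.range
                ((ι.symm : ℂ ≃+* PadicAlgCl ℓ).toRingHom.comp E.subtype)) := by
  classical
  by_cases hReg : ∃ᶠ v in Filter.cofinite, ∃ β : Multiset ℂ, π.1.HasSatakeParamAt v β ∧ β.Nodup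
  · exact exists_rationalModel_of_attached_of_frequently_nodup hC (by norm_num) π hra hA hReg
  -- no regular place
  obtain ⟨E₀, hfd₀, hE₀⟩ := hC 3 K hcpt π hra
  refine ⟨E₀, hfd₀, fun ℓ _ ι => ?_⟩
  obtain ⟨r, hss, hr⟩ := hA ℓ ι
  have hnosep : ∀ g, ¬ (FramedRep.charpoly r g).Separable := fun g hsep =>
    hReg (frequently_satakeParam_nodup_of_separable_charpoly π ι r hr hsep)
  set LE : Subfield (PadicAlgCl ℓ) :=
    (E₀.map (ι.symm : ℂ ≃+* PadicAlgCl ℓ).toRingHom).topologicalClosure with hLE_def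
  have hLE : (LE : Set (PadicAlgCl ℓ)) =
      closure (Set.range ((ι.symm : ℂ ≃+* PadicAlgCl ℓ).toRingHom.comp E₀.subtype)) := by
    change closure _ = closure _
    congr 1
    rw [Subfield.coe_map, RingHom.coe_comp, Set.range_comp]
    congr 1
    exact Set.ext fun z => ⟨fun hz => ⟨⟨z, hz⟩, rfl⟩, by rintro ⟨w, rfl⟩; exact w.2⟩
  -- all coefficients, hence (repeated root) all eigenvalues, of all `charpoly r(g)` lie in `E_λ`
  have hcoef := coeff_charpoly_apply_mem_closure_of_attached_three π hE₀ ι r hr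
  have heig : ∀ g, ∀ ρ ∈ ((r.toMonoidHom g : GL (Fin 3) (PadicAlgCl ℓ)) :
      Matrix (Fin 3) (Fin 3) (PadicAlgCl ℓ)).charpoly.roots, ρ ∈ LE := fun g =>
    RegularDescent.roots_mem_of_not_separable_three LE _ (Matrix.charpoly_monic _)
      (by rw [Matrix.charpoly_natDegree_eq_dim, Fintype.card_fin]) (hcoef g) (hnosep g)
  -- descent
  have hss' : Representation.IsSemisimpleRepresentation
      ((Representation.ofDistribMulAction (PadicAlgCl ℓ) (GL (Fin 3) (PadicAlgCl ℓ))
        (Fin 3 → PadicAlgCl ℓ)).comp r.toMonoidHom) := hss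
  obtain ⟨P, hP⟩ := exists_conj_apply_mem_of_isSemisimple_of_le_three LE le_rfl r.toMonoidHom hss'
    heig
  refine ⟨FramedRep.conj P r, ⟨?_, fun v β hβ hℓv => ?_⟩, fun g i j => ?_⟩
  · haveI : (FramedRep.toRepresentation r).IsSemisimpleRepresentation := hss
    exact RegularDescent.isSemisimpleRepresentation_conj r P
  · exact ⟨(FramedGaloisRep.isUnramifiedAt_conj_iff v P r).mpr (hr v β hβ hℓv).1,
      (FramedGaloisRep.hasFrobCharpolyAt_conj_iff v P _ r).mpr (hr v β hβ hℓv).2⟩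
  · rw [← hLE, SetLike.mem_coe, FramedRep.conj_apply]
    exact hP g i j

/-- **The rank-`3` slice of `BLGGT2014_polarized_compatibleSystem_rationalModels` from the two
existing named facts `FakhruddinPilloni2021_galoisRep_of_weaklyRegular_normTwist` and
`Clozel1990_heckeEigenvalueField` ONLY** — no Sen theory (`exists_rationalModel_rank_three_of_attached`
with Fakhruddin–Pilloni's attached representations, semisimplified,
`exists_semisimple_attached_of_normTwist`).  No new named fact (D-0026).
[cite: BarnetlambEtAl2014, Thm. 2.1.1 and Lemma 5.3.1 (3) (rank three)]
[cite: FakhruddinPilloni2021, Thm. 9.10 and Thm. 9.1] [cite: Clozel1990, Thm. 3.13] -/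
theorem BLGGT2014_polarized_compatibleSystem_rationalModels_rank_three_of_normTwist
    (h910 : FakhruddinPilloni2021_galoisRep_of_weaklyRegular_normTwist)
    (hC : Clozel1990_heckeEigenvalueField)
    (K : Type) [Field K] [NumberField K] [IsCMField K]
    (hcpt : isCompact_glFiniteIntegralLevel 3 K) (π : CuspidalAutomorphicRepData 3 K hcpt)
    (hra : π.1.IsRegularAlgebraic)
    (hpol : ∃ (χ : HeckeCharacter K) (m : ℤ),
      (∀ x : ideleGroup K, ((χ x : ℂˣ) : ℂ) = (ideleNorm x : ℂ) ^ (m : ℂ)) ∧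
        π.1.IsEssConjSelfDual χ) :
    ∃ E : Subfield ℂ, FiniteDimensional ℚ E ∧
      ∀ (ℓ : ℕ) [Fact ℓ.Prime] (ι : PadicAlgCl ℓ ≃+* ℂ),
        ∃ r : FramedGaloisRep K (PadicAlgCl ℓ) 3,
          (r.toGaloisRep.IsSemisimple ∧
            ∀ (v : HeightOneSpectrum (𝓞 K)) (β : Multiset ℂ), π.1.HasSatakeParamAt v β →
              ((ℓ : ℕ) : 𝓞 K) ∉ v.asIdeal →
                r.IsUnramifiedAt v ∧
                  r.HasFrobCharpolyAt v (arithFrobPolyOfSatake ι v.residueCard 3 β)) ∧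
          ∀ (g : Field.absoluteGaloisGroup K) (i j : Fin 3),
            ((r g : GL (Fin 3) (PadicAlgCl ℓ)) : Matrix (Fin 3) (Fin 3) (PadicAlgCl ℓ)) i j ∈
              closure (Set.range
                ((ι.symm : ℂ ≃+* PadicAlgCl ℓ).toRingHom.comp E.subtype)) := by
  obtain ⟨χ, m, hχ, hsd⟩ := hpol
  exact exists_rationalModel_rank_three_of_attached hC π hra
    fun ℓ _ ι => exists_semisimple_attached_of_normTwist h910 (by norm_num) π hra hχ hsd ℓ ι

/-- **The residue, sharpened once more: Sen theory is only needed in ranks `n ≥ 4`.**  A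
discharge of `BLGGT2014_polarized_compatibleSystem_rationalModels` follows from the two existing
named facts `FakhruddinPilloni2021_galoisRep_of_weaklyRegular_normTwist`,
`Clozel1990_heckeEigenvalueField` and the statement `hSen` of
`…_of_normTwist_of_forall_isCompatible` RESTRICTED TO `4 ≤ n`: ranks `0, 1` are proved
(`_of_two_le_rank`), rank `2` is `exists_rationalModel_rank_two_of_attached`, rank `3` is
`exists_rationalModel_rank_three_of_attached` (both Sen-free), and for `n ≥ 4` the regular
element of `hSen` (at `ℓ = 2`, any `ι`, for Fakhruddin–Pilloni's semisimplified `r`) gives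
infinitely many regular places (`frequently_satakeParam_nodup_of_separable_charpoly`) and
`exists_rationalModel_of_attached_of_frequently_nodup` applies.  In ranks `≥ 4` the input is
genuinely Hodge-theoretic ([BLGGT, Thm. 2.1.1 (3)] with Sen's theorem).  No new named fact
(D-0026). [cite: BarnetlambEtAl2014, Thm. 2.1.1 (3) and proof of Lemma 5.3.1 (3)]
[cite: FakhruddinPilloni2021, Thm. 9.10 and Thm. 9.1] [cite: Clozel1990, Thm. 3.13] -/
theorem BLGGT2014_polarized_compatibleSystem_rationalModels_of_normTwist_of_forall_isCompatible_four_le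
    (h910 : FakhruddinPilloni2021_galoisRep_of_weaklyRegular_normTwist)
    (hC : Clozel1990_heckeEigenvalueField)
    (hSen : ∀ (n : ℕ), 4 ≤ n → ∀ (K : Type) [Field K] [NumberField K] [IsCMField K]
      (hcpt : isCompact_glFiniteIntegralLevel n K) (π : CuspidalAutomorphicRepData n K hcpt),
        π.1.IsRegularAlgebraic →
        (∃ (χ : HeckeCharacter K) (m : ℤ),
            (∀ x : ideleGroup K, ((χ x : ℂˣ) : ℂ) = (ideleNorm x : ℂ) ^ (m : ℂ)) ∧
              π.1.IsEssConjSelfDual χ) →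
          ∀ (ℓ : ℕ) [Fact ℓ.Prime] (ι : PadicAlgCl ℓ ≃+* ℂ) (r : FramedGaloisRep K (PadicAlgCl ℓ) n),
            r.toGaloisRep.IsSemisimple → HarrisLanTaylorThorne2016.IsCompatible π.1 ι r →
              ∃ g₀ : absoluteGaloisGroup K, (FramedRep.charpoly r g₀).Separable) :
    BLGGT2014_polarized_compatibleSystem_rationalModels := by
  refine BLGGT2014_polarized_compatibleSystem_rationalModels_of_two_le_rank
    fun n hn K _ _ _ hcpt π hra hpol => ?_
  obtain ⟨χ, m, hχ, hsd⟩ := hpol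
  have hA : ∀ (ℓ : ℕ) [Fact ℓ.Prime] (ι : PadicAlgCl ℓ ≃+* ℂ),
      ∃ r : FramedGaloisRep K (PadicAlgCl ℓ) n, r.toGaloisRep.IsSemisimple ∧
        ∀ (v : HeightOneSpectrum (𝓞 K)) (α : Multiset ℂ), π.1.HasSatakeParamAt v α →
          ((ℓ : ℕ) : 𝓞 K) ∉ v.asIdeal →
            r.IsUnramifiedAt v ∧
              r.HasFrobCharpolyAt v (arithFrobPolyOfSatake ι v.residueCard n α) :=
    fun ℓ _ ι => exists_semisimple_attached_of_normTwist h910 (by omega) π hra hχ hsd ℓ ι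
  rcases Nat.lt_or_ge n 4 with hlt | h4
  · interval_cases n
    · exact exists_rationalModel_rank_two_of_attached hC π hra hA
    · exact exists_rationalModel_rank_three_of_attached hC π hra hA
  · haveI : Fact (Nat.Prime 2) := ⟨Nat.prime_two⟩
    obtain ⟨ι⟩ := PadicAlgCl.nonempty_ringEquiv_complex 2
    obtain ⟨r, hss, hc, hr⟩ :=
      exists_semisimple_isCompatible_of_normTwist h910 (by omega) π hra hχ hsd 2 ι
    obtain ⟨g₀, hsep⟩ := hSen n h4 K hcpt π hra ⟨χ, m, hχ, hsd⟩ 2 ι r hss hc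
    exact exists_rationalModel_of_attached_of_frequently_nodup hC hn π hra hA
      (frequently_satakeParam_nodup_of_separable_charpoly π ι r hr hsep)


end Literature.NumberTheory.Automorphic

end
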